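import Mathlib
import Summits.Schanuel.Schanuel.Theorems.RigidCoreMinimalCounterexampleInAclAclCriterion
import Literature.NumberTheory.Transcendental.ExpPointsBranchAtInfinity
import Literature.NumberTheory.Transcendental.ExpPointsDegenerateSections
import Summits.Schanuel.Schanuel.Theorems.AclSubsetLogFreeCore.Negative.ExpAclField
import Summits.Schanuel.Schanuel.Theorems.AclSubsetLogFreeCore.Negative.ExpAclDefinability
import Literature.ModelTheory.ExponentialFields.DefinabilityParams
import Summits.Schanuel.Schanuel.Theorems.RigidCoreMinimalCounterexampleInAclLogSector
import Summits.Schanuel.Schanuel.Theorems.RigidCoreMinimalCounterexampleInAclOfSparsityTwo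
import Literature.NumberTheory.Transcendental.TrdegZariskiDimConverse
import Literature.NumberTheory.Transcendental.ExpPointsLogTypePole
import Literature.NumberTheory.Transcendental.ExpPointsCuspTranscendence
import Literature.NumberTheory.Transcendental.ExpPointsConstantExponential
import Literature.NumberTheory.Transcendental.ExpPointsBranchLaurent
import Literature.Analysis.Complex.BranchOrders

/-!
# CERTIFICATE (one self-contained file over BUILT tree modules): (S*) at rank 2 on the MIXED SECTOR

Crux stmt-Schanuel-0969 `RigidCore.MinimalCounterexampleInAcl`, line kernel-arithmetic-selection, lead c3, 2026-08-16.
Concatenation of the landed/pending stub files (rigidity coset p110359+p111257, cover p109563, selectors p108332/p108275,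
bridge p108361, GL2 p108809, core p109883/p111460/(C)) and the gen-15 composition; `rankTwo_mixedSector_certificate` at the end.
-/

-- ======== segment: work/stubs/scratch_coset_monolith.lean ========
/-!
# COSET WINDOW RIGIDITY, file 1: analytic lemmas — crux stmt-Schanuel-0969
`RigidCore.MinimalCounterexampleInAcl`

Line `kernel-arithmetic-selection`, helper file for the registered stub `stub_windowRigidity_coset`
(gen 14 coset window rigidity; file 2 `…WindowRigidityCoset.lean` assembles the theorem),
`--supports stmt-Schanuel-0969`.  Mathlib only.  Contents:

* Part A — iterated Rolle and the MEAN VALUE THEOREM FOR DIVIDED DIFFERENCES (real), via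
  `Lagrange.interpolate` / `Lagrange.eval_iterate_derivative_eq_sum`;
* Part B — bookkeeping: real/imaginary parts of complex curves, the polar form of a real power
  `u ^ y = ‖u‖ ^ y · e^{iy arg u}`, preconnectedness of the punctured disc, the lattice step;
* Part C — the meromorphic derivative chain: `F₀ = t ^ p · M`, `F_{k+1} = α (t F_k' + (ke-p) F_k)`,
  `M_k = F_k · t^{ke-p}`, `α t^{e+1} M_k' = M_{k+1}`, and along the principal root curve
  `s(σ) = (c + βσ)^{-1/e}` (`s' = (-β/e) s^{e+1}`) the chain rule `d/dσ M_k (s σ) = M_{k+1} (s σ)`;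
* Part D — the degenerate case: `F_n ≡ 0` near `0` forces `M = Q((t^e)⁻¹)` near `0`
  (downward integration of the chain on the punctured disc).

## References

* [folklore] mean value theorem for divided differences; Laurent/Puiseux bookkeeping.
-/

noncomputable section

set_option linter.dupNamespace false

open Filter Topology Polynomial

namespace Summit.Schanuel.Schanuel.Cruxes.MinimalCounterexampleInAcl.KernelArithmeticSelection

/-! ## Part A.  Iterated Rolle and the mean value theorem for divided differences (real) -/

/-- Iterated Rolle: if `r 0, r 1, …` is a derivative chain on `[lo, hi]` and `r k` has `m + 1`
strictly increasing zeros in `[lo, hi]` with `k + m = n`, then `r n` vanishes somewhere in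
`[lo, hi]`. [folklore] -/
theorem coset_rolle_iterate {lo hi : ℝ} (r : ℕ → ℝ → ℝ) (n : ℕ)
    (hder : ∀ k < n, ∀ x ∈ Set.Icc lo hi, HasDerivAt (r k) (r (k + 1) x) x) :
    ∀ m k : ℕ, k + m = n → ∀ x : Fin (m + 1) → ℝ, StrictMono x →
      (∀ i, x i ∈ Set.Icc lo hi) → (∀ i, r k (x i) = 0) → ∃ ξ ∈ Set.Icc lo hi, r n ξ = 0 := by
  intro m
  induction m with
  | zero =>
    intro k hk x _ hxI hx0
    obtain rfl : k = n := by omega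
    exact ⟨x 0, hxI 0, hx0 0⟩
  | succ m ih =>
    intro k hk x hx hxI hx0
    have hk' : k < n := by omega
    have gap : ∀ i : Fin (m + 1), ∃ y ∈ Set.Ioo (x i.castSucc) (x i.succ), r (k + 1) y = 0 := by
      intro i
      have hlt : x i.castSucc < x i.succ := hx i.castSucc_lt_succ
      refine exists_hasDerivAt_eq_zero (f := r k) (f' := r (k + 1)) hlt ?_ ?_ ?_
      · intro y hy
        have hyI : y ∈ Set.Icc lo hi := ⟨(hxI _).1.trans hy.1, hy.2.trans (hxI _).2⟩
        exact (hder k hk' y hyI).continuousAt.continuousWithinAt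
      · rw [hx0, hx0]
      · intro y hy
        have hyI : y ∈ Set.Icc lo hi := ⟨(hxI _).1.trans hy.1.le, hy.2.le.trans (hxI _).2⟩
        exact hder k hk' y hyI
    choose y hy hy0 using gap
    refine ih (k + 1) (by omega) y ?_ ?_ hy0
    · refine Fin.strictMono_iff_lt_succ.2 fun i => ?_
      calc y i.castSucc < x i.castSucc.succ := (hy _).2
        _ = x i.succ.castSucc := by rw [Fin.succ_castSucc]
        _ < y i.succ := (hy _).1
    · exact fun i => ⟨(hxI _).1.trans (hy i).1.le, (hy i).2.le.trans (hxI _).2⟩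

/-- **Mean value theorem for divided differences.**  If `f 0, f 1, …, f n` is a derivative
chain on `[lo, hi]` and `x₀ < ⋯ < xₙ` are nodes in `[lo, hi]`, the divided difference
`∑ⱼ f 0 (xⱼ) / ∏_{i ≠ j} (xⱼ - xᵢ)` equals `f n ξ / n!` for some `ξ ∈ [lo, hi]`. [folklore] -/
theorem coset_dividedDiff_mvt : ∀ {n : ℕ} (f : ℕ → ℝ → ℝ) {lo hi : ℝ},
    (∀ k < n, ∀ x ∈ Set.Icc lo hi, HasDerivAt (f k) (f (k + 1) x) x) → ∀ (x : Fin (n + 1) → ℝ),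
    StrictMono x → (∀ i, x i ∈ Set.Icc lo hi) → ∃ ξ ∈ Set.Icc lo hi,
    f n ξ = n.factorial * ∑ i, f 0 (x i) / ∏ j ∈ Finset.univ.erase i, (x i - x j) := by
  intro n f lo hi hder x hx hxI
  classical
  set q : ℝ[X] := Lagrange.interpolate Finset.univ x (fun i => f 0 (x i)) with hq
  have hinj : Set.InjOn x (Finset.univ : Finset (Fin (n + 1))) := hx.injective.injOn
  have hdeg : q.degree < (Finset.univ : Finset (Fin (n + 1))).card :=
    Lagrange.degree_interpolate_lt _ hinj
  set r : ℕ → ℝ → ℝ := fun k y => f k y - (derivative^[k] q).eval y with hr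
  have hrder : ∀ k < n, ∀ y ∈ Set.Icc lo hi, HasDerivAt (r k) (r (k + 1) y) y := by
    intro k hk y hy
    show HasDerivAt (fun y => f k y - (derivative^[k] q).eval y)
      (f (k + 1) y - (derivative^[k + 1] q).eval y) y
    rw [Function.iterate_succ_apply']
    exact (hder k hk y hy).sub (Polynomial.hasDerivAt _ y)
  have hr0 : ∀ i, r 0 (x i) = 0 := by
    intro i
    simp only [hr, Function.iterate_zero, id]
    rw [hq, Lagrange.eval_interpolate_at_node _ hinj (Finset.mem_univ i), sub_self]
  obtain ⟨ξ, hξI, hξ⟩ := coset_rolle_iterate r n hrder n 0 (by simp) x hx hxI hr0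
  refine ⟨ξ, hξI, ?_⟩
  have hn : n < (Finset.univ : Finset (Fin (n + 1))).card := by simp
  have key := Lagrange.eval_iterate_derivative_eq_sum hinj hdeg hn ξ
  have hξ' : f n ξ = (derivative^[n] q).eval ξ := by simpa [hr, sub_eq_zero] using hξ
  rw [hξ', key]
  have hcard : (Finset.univ : Finset (Fin (n + 1))).card - (n + 1) = 0 := by simp
  simp only [hcard, Finset.powersetCard_zero, Finset.sum_singleton, Finset.prod_empty, mul_one]
  congr 1
  refine Finset.sum_congr rfl fun i _ => ?_
  rw [hq, Lagrange.eval_interpolate_at_node _ hinj (Finset.mem_univ i)]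

/-! ## Part B.  Elementary complex bookkeeping -/

/-- The real part of a differentiable complex curve is differentiable. [folklore] -/
theorem coset_hasDerivAt_re {φ : ℝ → ℂ} {φ' : ℂ} {τ : ℝ} (h : HasDerivAt φ φ' τ) :
    HasDerivAt (fun σ => (φ σ).re) φ'.re τ := by
  simpa [Function.comp_def] using Complex.reCLM.hasFDerivAt.comp_hasDerivAt τ h

/-- The imaginary part of a differentiable complex curve is differentiable. [folklore] -/
theorem coset_hasDerivAt_im {φ : ℝ → ℂ} {φ' : ℂ} {τ : ℝ} (h : HasDerivAt φ φ' τ) :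
    HasDerivAt (fun σ => (φ σ).im) φ'.im τ := by
  simpa [Function.comp_def] using Complex.imCLM.hasFDerivAt.comp_hasDerivAt τ h

/-- Polar form of a real power: `u ^ y = ‖u‖ ^ y · exp (i y arg u)`. [folklore] -/
theorem coset_cpow_polar {u : ℂ} (hu : u ≠ 0) (y : ℝ) :
    u ^ (y : ℂ) =
      ((‖u‖ ^ y : ℝ) : ℂ) * Complex.exp (((Complex.arg u * y : ℝ) : ℂ) * Complex.I) := by
  rw [Complex.cpow_def_of_ne_zero hu, Real.rpow_def_of_pos (norm_pos_iff.2 hu), Complex.ofReal_exp,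
    ← Complex.exp_add]
  congr 1
  apply Complex.ext
  · simp [Complex.log_re]
  · simp [Complex.log_im]

/-- The punctured disc is preconnected (polar coordinates). [folklore] -/
theorem coset_puncturedBall_isPreconnected (r : ℝ) :
    IsPreconnected (Metric.ball (0 : ℂ) r \ {0}) := by
  have hset : Metric.ball (0 : ℂ) r \ {0} =
      (fun q : ℝ × ℝ => (q.1 : ℂ) * Complex.exp ((q.2 : ℂ) * Complex.I)) ''
        (Set.Ioo 0 r ×ˢ Set.univ) := by
    ext z
    simp only [Set.mem_sdiff, Metric.mem_ball, dist_zero_right, Set.mem_singleton_iff,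
      Set.mem_image, Set.mem_prod, Set.mem_Ioo, Set.mem_univ, and_true, Prod.exists]
    constructor
    · rintro ⟨hz, hz0⟩
      exact ⟨‖z‖, Complex.arg z, ⟨norm_pos_iff.2 hz0, hz⟩, Complex.norm_mul_exp_arg_mul_I z⟩
    · rintro ⟨a, b, ⟨ha0, har⟩, rfl⟩
      refine ⟨?_, mul_ne_zero (Complex.ofReal_ne_zero.2 ha0.ne') (Complex.exp_ne_zero _)⟩
      rw [norm_mul, Complex.norm_exp_ofReal_mul_I, mul_one, Complex.norm_of_nonneg ha0.le]
      exact har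
  rw [hset]
  refine (isPreconnected_Ioo.prod isPreconnected_univ).image _ ?_
  fun_prop

/-- The lattice step: with integer nodes `g` and integer values `L`, the divided difference
`∑ Lᵢ / ∏_{j≠i} (gᵢ - gⱼ)` times `W = ∏ᵢ ∏_{j ≠ i} (gᵢ - gⱼ) ≠ 0` is an integer. [folklore] -/
theorem coset_lattice {n : ℕ} (g : Fin (n + 1) → ℤ) (hg : Function.Injective g) :
    (∏ i, ∏ j ∈ Finset.univ.erase i, (g i - g j)) ≠ 0 ∧
    ∀ L : Fin (n + 1) → ℤ, ∃ Z : ℤ,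
      (∑ i, (L i : ℝ) / ∏ j ∈ Finset.univ.erase i, ((g i : ℝ) - g j)) *
        ((∏ i, ∏ j ∈ Finset.univ.erase i, (g i - g j) : ℤ) : ℝ) = Z := by
  classical
  set P : Fin (n + 1) → ℤ := fun i => ∏ j ∈ Finset.univ.erase i, (g i - g j) with hP
  have hP0 : ∀ i, P i ≠ 0 := fun i => Finset.prod_ne_zero_iff.2 fun j hj =>
    sub_ne_zero.2 fun h => (Finset.mem_erase.1 hj).1 (hg h).symm
  have hPR : ∀ i, (∏ j ∈ Finset.univ.erase i, ((g i : ℝ) - g j)) = (P i : ℝ) := by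
    intro i; simp [hP]
  refine ⟨Finset.prod_ne_zero_iff.2 fun i _ => hP0 i, fun L => ?_⟩
  refine ⟨∑ i, L i * ∏ j ∈ Finset.univ.erase i, P j, ?_⟩
  rw [Finset.sum_mul]
  push_cast
  refine Finset.sum_congr rfl fun i _ => ?_
  rw [hPR i, ← Finset.mul_prod_erase Finset.univ (fun j => (P j : ℝ)) (Finset.mem_univ i)]
  have : (P i : ℝ) ≠ 0 := by exact_mod_cast hP0 i
  field_simp

/-! ## Part C.  The meromorphic derivative chain -/

/-- The numerators `F_k` (`F₀ = F`, `F_{k+1} = α (t F_k' + (ke - p) F_k)`) are analytic on the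
disc where `F` is. [folklore] -/
theorem coset_Fk_analyticOnNhd {e p : ℕ} {α : ℂ} {ρ : ℝ} {F : ℂ → ℂ} {Fk : ℕ → ℂ → ℂ}
    (hF : AnalyticOnNhd ℂ F (Metric.ball 0 ρ)) (h0 : Fk 0 = F)
    (hs : ∀ k, Fk (k + 1) =
      fun t => α * (t * deriv (Fk k) t + (((k * e : ℕ) : ℂ) - p) * Fk k t)) :
    ∀ k, AnalyticOnNhd ℂ (Fk k) (Metric.ball 0 ρ) := by
  intro k
  induction k with
  | zero => simpa [h0] using hF
  | succ k ih =>
    rw [hs k]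
    intro t ht
    have h1 : AnalyticAt ℂ (deriv (Fk k)) t := ih.deriv t ht
    have h2 : AnalyticAt ℂ (Fk k) t := ih t ht
    exact analyticAt_const.mul ((analyticAt_id.mul h1).add (analyticAt_const.mul h2))

/-- The phases `M_k t = F_k t · t^{ke - p}` satisfy `α t^{e+1} M_k' = M_{k+1}` off the
origin. [folklore] -/
theorem coset_Mk_hasDerivAt {e p : ℕ} {α : ℂ} {ρ : ℝ} {F : ℂ → ℂ} {Fk Mk : ℕ → ℂ → ℂ}
    (hF : AnalyticOnNhd ℂ F (Metric.ball 0 ρ)) (h0 : Fk 0 = F)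
    (hs : ∀ k, Fk (k + 1) =
      fun t => α * (t * deriv (Fk k) t + (((k * e : ℕ) : ℂ) - p) * Fk k t))
    (hMk : ∀ k t, Mk k t = Fk k t * t ^ (((k * e : ℕ) : ℤ) - p))
    (k : ℕ) {t : ℂ} (ht : t ∈ Metric.ball 0 ρ) (ht0 : t ≠ 0) :
    ∃ D : ℂ, HasDerivAt (Mk k) D t ∧ α * t ^ (e + 1) * D = Mk (k + 1) t := by
  have hFa := coset_Fk_analyticOnNhd hF h0 hs k t ht
  set m : ℤ := ((k * e : ℕ) : ℤ) - p with hm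
  set m' : ℤ := (((k + 1) * e : ℕ) : ℤ) - p with hm'
  have hd1 : HasDerivAt (Fk k) (deriv (Fk k) t) t := hFa.differentiableAt.hasDerivAt
  have hd2 := hasDerivAt_zpow m t (Or.inl ht0)
  have hfun : Mk k = fun t => Fk k t * t ^ m := funext (hMk k)
  refine ⟨deriv (Fk k) t * t ^ m + Fk k t * ((m : ℂ) * t ^ (m - 1)), ?_, ?_⟩
  · rw [hfun]
    exact hd1.fun_mul hd2
  rw [hMk, hs k]
  have e1 : t ^ (e + 1) * t ^ m = t * t ^ m' := by
    calc t ^ (e + 1) * t ^ m = t ^ ((e + 1 : ℕ) : ℤ) * t ^ m := by rw [zpow_natCast]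
      _ = t ^ (((e + 1 : ℕ) : ℤ) + m) := (zpow_add₀ ht0 _ _).symm
      _ = t ^ ((1 : ℤ) + m') := by congr 1; push_cast [hm, hm']; ring
      _ = t * t ^ m' := by rw [zpow_add₀ ht0, zpow_one]
  have e2 : t ^ (e + 1) * t ^ (m - 1) = t ^ m' := by
    calc t ^ (e + 1) * t ^ (m - 1) = t ^ ((e + 1 : ℕ) : ℤ) * t ^ (m - 1) := by rw [zpow_natCast]
      _ = t ^ (((e + 1 : ℕ) : ℤ) + (m - 1)) := (zpow_add₀ ht0 _ _).symm
      _ = t ^ m' := by congr 1; push_cast [hm, hm']; ring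
  have e3 : ((m : ℤ) : ℂ) = ((k * e : ℕ) : ℂ) - p := by push_cast [hm]; ring
  simp only
  rw [← e3]
  linear_combination (α * deriv (Fk k) t) * e1 + (α * Fk k t * (m : ℂ)) * e2

/-- The principal root curve `σ ↦ (c + βσ)^{-1/e}` has derivative `(-β/e) · s^{e+1}` wherever
`c + βσ` lies in the slit plane. [folklore] -/
theorem coset_root_hasDerivAt {e : ℕ} (he : 0 < e) (c β : ℂ) {τ : ℝ}
    (hslit : c + β * (τ : ℂ) ∈ Complex.slitPlane) :
    HasDerivAt (fun σ : ℝ => (c + β * (σ : ℂ)) ^ (-((e : ℂ)⁻¹)))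
      ((-β / e) * ((c + β * (τ : ℂ)) ^ (-((e : ℂ)⁻¹))) ^ (e + 1)) τ := by
  have hu0 : c + β * (τ : ℂ) ≠ 0 := Complex.slitPlane_ne_zero hslit
  have he0 : (e : ℂ) ≠ 0 := by exact_mod_cast he.ne'
  have h1 : HasDerivAt (fun w : ℂ => c + β * w) β (τ : ℂ) := by
    simpa using ((hasDerivAt_id (τ : ℂ)).const_mul β).const_add c
  have h2 := (h1.cpow_const (c := -((e : ℂ)⁻¹)) hslit).comp_ofReal
  convert h2 using 1
  have key : (c + β * (τ : ℂ)) ^ (-((e : ℂ)⁻¹) - 1) =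
      ((c + β * (τ : ℂ)) ^ (-((e : ℂ)⁻¹))) ^ (e + 1) := by
    rw [Complex.cpow_sub _ _ hu0, Complex.cpow_one, pow_succ, ← Complex.cpow_nat_mul]
    have : (e : ℂ) * -((e : ℂ)⁻¹) = -1 := by field_simp
    rw [this, Complex.cpow_neg_one, div_eq_mul_inv, mul_comm]
  rw [key]
  field_simp

/-- Chain rule along the root curve: `d/dσ M_k (s σ) = M_{k+1} (s σ)` with `α = -β/e`.
[folklore] -/
theorem coset_chain {e p : ℕ} {α β c : ℂ} {ρ : ℝ} {F : ℂ → ℂ} {Fk Mk : ℕ → ℂ → ℂ}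
    (he : 0 < e) (hα : α = -β / e)
    (hF : AnalyticOnNhd ℂ F (Metric.ball 0 ρ)) (h0 : Fk 0 = F)
    (hs : ∀ k, Fk (k + 1) =
      fun t => α * (t * deriv (Fk k) t + (((k * e : ℕ) : ℂ) - p) * Fk k t))
    (hMk : ∀ k t, Mk k t = Fk k t * t ^ (((k * e : ℕ) : ℤ) - p))
    (k : ℕ) {τ : ℝ} (hslit : c + β * (τ : ℂ) ∈ Complex.slitPlane)
    (hball : (c + β * (τ : ℂ)) ^ (-((e : ℂ)⁻¹)) ∈ Metric.ball (0 : ℂ) ρ) :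
    HasDerivAt (fun σ : ℝ => Mk k ((c + β * (σ : ℂ)) ^ (-((e : ℂ)⁻¹))))
      (Mk (k + 1) ((c + β * (τ : ℂ)) ^ (-((e : ℂ)⁻¹)))) τ := by
  have hs0 : (c + β * (τ : ℂ)) ^ (-((e : ℂ)⁻¹)) ≠ 0 :=
    Complex.cpow_ne_zero_iff.2 (Or.inl (Complex.slitPlane_ne_zero hslit))
  obtain ⟨D, hD, hDeq⟩ := coset_Mk_hasDerivAt hF h0 hs hMk k hball hs0
  have hroot := coset_root_hasDerivAt he c β hslit
  have hcomp := hD.comp τ hroot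
  have hfun : (fun σ : ℝ => Mk k ((c + β * (σ : ℂ)) ^ (-((e : ℂ)⁻¹)))) =
      Mk k ∘ fun σ : ℝ => (c + β * (σ : ℂ)) ^ (-((e : ℂ)⁻¹)) := rfl
  rw [hfun]
  refine hcomp.congr_deriv ?_
  rw [← hDeq, hα]
  ring

/-- `M₀ = M` off the origin. [folklore] -/
theorem coset_Mk_zero {e p : ℕ} {M F : ℂ → ℂ} {Fk Mk : ℕ → ℂ → ℂ}
    (hFM : ∀ t, F t = t ^ p * M t) (h0 : Fk 0 = F)
    (hMk : ∀ k t, Mk k t = Fk k t * t ^ (((k * e : ℕ) : ℤ) - p)) {t : ℂ} (ht : t ≠ 0) :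
    Mk 0 t = M t := by
  rw [hMk, h0, hFM]
  simp only [zero_mul, Nat.cast_zero, zero_sub, zpow_neg, zpow_natCast]
  field_simp

/-! ## Part D.  The degenerate case: `F_n ≡ 0` near `0` forces `M = Q((t^e)⁻¹)` -/

/-- If the `n`-th numerator vanishes identically near `0`, then integrating the chain
`α t^{e+1} M_k' = M_{k+1}` downwards on the punctured disc shows that `M` is a polynomial in
`(t^e)⁻¹` near `0`. [folklore] -/
theorem coset_degenerate {e p n : ℕ} {α : ℂ} {ρ : ℝ} {M F : ℂ → ℂ} {Fk Mk : ℕ → ℂ → ℂ}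
    (he : 0 < e) (hα : α ≠ 0) (hρ : 0 < ρ)
    (hF : AnalyticOnNhd ℂ F (Metric.ball 0 ρ)) (hFM : ∀ t, F t = t ^ p * M t) (h0 : Fk 0 = F)
    (hs : ∀ k, Fk (k + 1) =
      fun t => α * (t * deriv (Fk k) t + (((k * e : ℕ) : ℂ) - p) * Fk k t))
    (hMk : ∀ k t, Mk k t = Fk k t * t ^ (((k * e : ℕ) : ℤ) - p))
    (hzero : ∀ᶠ t in 𝓝 (0 : ℂ), Fk n t = 0) :
    ∃ Q : Polynomial ℂ, ∀ᶠ t in 𝓝[≠] (0 : ℂ), M t = Q.eval (t ^ e)⁻¹ := by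
  obtain ⟨ρ₁, hρ₁, hρ₁z⟩ := Metric.eventually_nhds_iff_ball.1 hzero
  set ρ' : ℝ := min ρ ρ₁ with hρ'def
  have hρ' : 0 < ρ' := lt_min hρ hρ₁
  set U : Set ℂ := Metric.ball (0 : ℂ) ρ' \ {0} with hU
  have hUopen : IsOpen U := Metric.isOpen_ball.sdiff isClosed_singleton
  have hUconn : IsPreconnected U := coset_puncturedBall_isPreconnected ρ'
  have hUρ : ∀ t ∈ U, t ∈ Metric.ball (0 : ℂ) ρ := fun t ht =>
    Metric.ball_subset_ball (min_le_left _ _) ht.1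
  have hUρ₁ : ∀ t ∈ U, t ∈ Metric.ball (0 : ℂ) ρ₁ := fun t ht =>
    Metric.ball_subset_ball (min_le_right _ _) ht.1
  have hU0 : ∀ t ∈ U, t ≠ 0 := fun t ht => ht.2
  have claim : ∀ d, d ≤ n → ∃ (N : ℕ) (a : ℕ → ℂ), ∀ t ∈ U,
      Mk (n - d) t = ∑ q ∈ Finset.range N, a q * t ^ (-((q * e : ℕ) : ℤ)) := by
    intro d
    induction d with
    | zero =>
      intro _
      refine ⟨0, fun _ => 0, fun t ht => ?_⟩
      simp [hMk, hρ₁z t (hUρ₁ t ht)]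
    | succ d ih =>
      intro hd
      obtain ⟨N, a, ha⟩ := ih (by omega)
      have hj : n - d = (n - (d + 1)) + 1 := by omega
      set j := n - (d + 1) with hjdef
      rw [hj] at ha
      set b : ℕ → ℂ := fun q => a q / (α * (-(((q + 1) * e : ℕ) : ℂ))) with hb
      set A : ℂ → ℂ := fun t => ∑ q ∈ Finset.range N, b q * t ^ (-(((q + 1) * e : ℕ) : ℤ))
        with hA
      have hqe : ∀ q : ℕ, (((q + 1) * e : ℕ) : ℂ) ≠ 0 := fun q =>
        Nat.cast_ne_zero.2 (Nat.mul_ne_zero (Nat.succ_ne_zero q) he.ne')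
      have hcoef : ∀ q : ℕ, α * (-(((q + 1) * e : ℕ) : ℂ)) ≠ 0 := fun q =>
        mul_ne_zero hα (neg_ne_zero.2 (hqe q))
      have hAder : ∀ t ∈ U, HasDerivAt A (∑ q ∈ Finset.range N,
          b q * (((-(((q + 1) * e : ℕ) : ℤ) : ℤ) : ℂ) * t ^ (-(((q + 1) * e : ℕ) : ℤ) - 1))) t := by
        intro t ht
        refine HasDerivAt.fun_sum fun q _ => ?_
        exact (hasDerivAt_zpow _ t (Or.inl (hU0 t ht))).const_mul (b q)
      have hMkdiff : DifferentiableOn ℂ (Mk j) U := fun t ht =>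
        (coset_Mk_hasDerivAt hF h0 hs hMk j (hUρ t ht) (hU0 t ht)).choose_spec.1
          |>.differentiableAt.differentiableWithinAt
      have hAdiff : DifferentiableOn ℂ A U := fun t ht =>
        (hAder t ht).differentiableAt.differentiableWithinAt
      have hderiv : U.EqOn (deriv (Mk j)) (deriv A) := by
        intro t ht
        have ht0 := hU0 t ht
        obtain ⟨D, hD, hDeq⟩ := coset_Mk_hasDerivAt hF h0 hs hMk j (hUρ t ht) ht0
        rw [hD.deriv, (hAder t ht).deriv]
        apply mul_left_cancel₀ (mul_ne_zero hα (pow_ne_zero (e + 1) ht0))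
        rw [hDeq, ha t ht, Finset.mul_sum]
        refine Finset.sum_congr rfl fun q _ => ?_
        have hz : t ^ (e + 1) * t ^ (-(((q + 1) * e : ℕ) : ℤ) - 1) = t ^ (-((q * e : ℕ) : ℤ)) := by
          calc t ^ (e + 1) * t ^ (-(((q + 1) * e : ℕ) : ℤ) - 1)
              = t ^ ((e + 1 : ℕ) : ℤ) * t ^ (-(((q + 1) * e : ℕ) : ℤ) - 1) := by
                rw [zpow_natCast]
            _ = t ^ (((e + 1 : ℕ) : ℤ) + (-(((q + 1) * e : ℕ) : ℤ) - 1)) :=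
                (zpow_add₀ ht0 _ _).symm
            _ = t ^ (-((q * e : ℕ) : ℤ)) := by congr 1; push_cast; ring
        simp only [hb]
        have hγ0 := hqe q
        set γ : ℂ := (((q + 1) * e : ℕ) : ℂ) with hγ
        have hcast : ((-(((q + 1) * e : ℕ) : ℤ) : ℤ) : ℂ) = -γ := by rw [hγ]; push_cast; ring
        rw [hcast, ← hz]
        field_simp
      obtain ⟨κ, hκ⟩ := hUopen.exists_eq_add_of_deriv_eq hUconn hMkdiff hAdiff hderiv
      refine ⟨N + 1, fun q => if q = 0 then κ else b (q - 1), fun t ht => ?_⟩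
      rw [hκ ht, Finset.sum_range_succ']
      simp [hA, add_comm]
  obtain ⟨N, a, ha⟩ := claim n le_rfl
  rw [Nat.sub_self] at ha
  refine ⟨∑ q ∈ Finset.range N, Polynomial.C (a q) * Polynomial.X ^ q, ?_⟩
  have hUmem : U ∈ 𝓝[≠] (0 : ℂ) :=
    sdiff_mem_nhdsWithin_compl (Metric.ball_mem_nhds 0 hρ') {0}
  filter_upwards [hUmem] with t ht
  rw [← coset_Mk_zero hFM h0 hMk (hU0 t ht), ha t ht, Polynomial.eval_finsetSum]
  refine Finset.sum_congr rfl fun q _ => ?_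
  simp only [Polynomial.eval_mul, Polynomial.eval_C, Polynomial.eval_pow, Polynomial.eval_X]
  congr 1
  rw [zpow_neg, zpow_natCast, pow_mul', ← inv_pow]


/-! ## Part E.  Asymptotics of the root curve `s(τ) = (c + βτ)^{-1/e}` -/

/-- `‖c + βτ‖ → ∞` as `τ → +∞` (`β ≠ 0`). [folklore] -/
theorem coset_norm_tendsto_atTop (c β : ℂ) (hβ : β ≠ 0) :
    Tendsto (fun τ : ℝ => ‖c + β * (τ : ℂ)‖) atTop atTop := by
  have h1 : Tendsto (fun τ : ℝ => ‖β‖ * τ + -‖c‖) atTop atTop :=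
    tendsto_atTop_add_const_right _ _ (Tendsto.const_mul_atTop (norm_pos_iff.2 hβ) tendsto_id)
  refine tendsto_atTop_mono' atTop ?_ h1
  filter_upwards [eventually_ge_atTop (0 : ℝ)] with τ hτ
  have : ‖β * (τ : ℂ)‖ ≤ ‖c + β * τ‖ + ‖c‖ := by
    calc ‖β * (τ : ℂ)‖ = ‖(c + β * τ) - c‖ := by ring_nf
      _ ≤ ‖c + β * τ‖ + ‖c‖ := norm_sub_le _ _
  rw [norm_mul, Complex.norm_real, Real.norm_eq_abs, abs_of_nonneg hτ] at this
  linarith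

/-- `s(τ) → 0` as `τ → +∞`. [folklore] -/
theorem coset_root_tendsto_zero {e : ℕ} (he : 0 < e) (c β : ℂ) (hβ : β ≠ 0) :
    Tendsto (fun τ : ℝ => (c + β * (τ : ℂ)) ^ (-((e : ℂ)⁻¹))) atTop (𝓝 0) := by
  rw [tendsto_zero_iff_norm_tendsto_zero]
  have hexp : (-((e : ℂ)⁻¹)) = ((-(e : ℝ)⁻¹ : ℝ) : ℂ) := by push_cast; ring
  have h := (tendsto_rpow_neg_atTop (by positivity : 0 < (e : ℝ)⁻¹)).comp
    (coset_norm_tendsto_atTop c β hβ)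
  refine h.congr' (Eventually.of_forall fun τ => ?_)
  simp only [Function.comp_def]
  rw [hexp, Complex.norm_cpow_real]

/-- `arg (c + βτ) → arg β` as `τ → +∞` (`Im β ≠ 0`). [folklore] -/
theorem coset_arg_tendsto (c β : ℂ) (hβ : β.im ≠ 0) :
    Tendsto (fun τ : ℝ => Complex.arg (c + β * (τ : ℂ))) atTop (𝓝 (Complex.arg β)) := by
  have hslit : β ∈ Complex.slitPlane := Complex.mem_slitPlane_iff.2 (Or.inr hβ)
  have hinv : Tendsto (fun τ : ℝ => ((τ⁻¹ : ℝ) : ℂ)) atTop (𝓝 0) := by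
    have := (Complex.continuous_ofReal.tendsto 0).comp tendsto_inv_atTop_zero
    simpa [Function.comp_def] using this
  have h2 : Tendsto (fun τ : ℝ => c * ((τ⁻¹ : ℝ) : ℂ) + β) atTop (𝓝 β) := by
    simpa using ((tendsto_const_nhds (x := c)).mul hinv).add (tendsto_const_nhds (x := β))
  have h3 := ((Complex.continuousAt_arg hslit).tendsto).comp h2
  refine h3.congr' ?_
  filter_upwards [eventually_gt_atTop (0 : ℝ)] with τ hτ
  simp only [Function.comp_def]
  have hτ0 : (τ : ℂ) ≠ 0 := Complex.ofReal_ne_zero.2 hτ.ne'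
  have : c + β * (τ : ℂ) = (τ : ℂ) * (c * ((τ⁻¹ : ℝ) : ℂ) + β) := by
    push_cast; field_simp
  rw [this, Complex.arg_real_mul _ hτ]

/-- Eventually `Im (c + βτ) ≠ 0` (`Im β ≠ 0`). [folklore] -/
theorem coset_im_eventually_ne (c β : ℂ) (hβ : β.im ≠ 0) :
    ∀ᶠ τ : ℝ in atTop, (c + β * (τ : ℂ)).im ≠ 0 := by
  have hβ' : 0 < |β.im| := abs_pos.2 hβ
  filter_upwards [eventually_ge_atTop ((|c.im| + 1) / |β.im|)] with τ hτ
  have hτ0 : 0 ≤ τ := le_trans (by positivity) hτ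
  have h1 : |c.im| + 1 ≤ |β.im| * τ := by
    rw [div_le_iff₀ hβ'] at hτ; linarith
  have him : (c + β * (τ : ℂ)).im = c.im + β.im * τ := by simp
  rw [him]
  intro h
  have h2 : |β.im * τ| = |c.im| := by
    rw [show β.im * τ = -c.im by linarith, abs_neg]
  rw [abs_mul, abs_of_nonneg hτ0] at h2
  linarith

/-! ## Part F.  The one-sided tail lemma and the theorem -/

/-- **One tail.**  For `Im β ≠ 0` only finitely many `k ≥ 0` have all translates `k + j`,
`j ∈ G`, hitting: `M ((c + β(k+j))^{-1/e}) ∈ 2πiℤ`. [folklore] -/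
theorem coset_tail (e p : ℕ) (M : ℂ → ℂ) (c β : ℂ) (G : Finset ℤ) (he : 0 < e)
    (hF : AnalyticAt ℂ (fun t : ℂ => t ^ p * M t) 0)
    (hnd : ¬ ∃ Q : Polynomial ℂ, ∀ᶠ t in 𝓝[≠] (0 : ℂ), M t = Q.eval (t ^ e)⁻¹)
    (hG : p + 2 ≤ G.card) (hβ : β.im ≠ 0) :
    Set.Finite {k : ℤ | 0 ≤ k ∧ ∀ j ∈ G, ∃ L : ℤ,
      M ((c + β * ((k + j : ℤ) : ℂ)) ^ (-((e : ℂ)⁻¹))) = (L : ℂ) * (2 * ↑Real.pi * Complex.I)} := by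
  classical
  -- Step 0: notation and the chains
  set F : ℂ → ℂ := fun t => t ^ p * M t with hFdef
  have hFM : ∀ t, F t = t ^ p * M t := fun t => rfl
  obtain ⟨ρ, hρ, hFρ⟩ : ∃ ρ > 0, AnalyticOnNhd ℂ F (Metric.ball 0 ρ) := by
    obtain ⟨ρ, hρ, h⟩ := Metric.eventually_nhds_iff_ball.1 hF.eventually_analyticAt
    exact ⟨ρ, hρ, fun t ht => h t ht⟩
  have hβ0 : β ≠ 0 := fun h => hβ (by simp [h])
  have he0 : (e : ℂ) ≠ 0 := by exact_mod_cast he.ne'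
  set α : ℂ := -β / e with hαdef
  have hα : α ≠ 0 := div_ne_zero (neg_ne_zero.2 hβ0) he0
  obtain ⟨Fk, hFk0, hFks⟩ : ∃ Fk : ℕ → ℂ → ℂ, Fk 0 = F ∧ ∀ k, Fk (k + 1) =
      fun t => α * (t * deriv (Fk k) t + (((k * e : ℕ) : ℂ) - p) * Fk k t) :=
    ⟨fun k => Nat.rec F
      (fun k fk => fun t => α * (t * deriv fk t + (((k * e : ℕ) : ℂ) - p) * fk t)) k,
      rfl, fun k => rfl⟩
  set Mk : ℕ → ℂ → ℂ := fun k t => Fk k t * t ^ (((k * e : ℕ) : ℤ) - p) with hMkdef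
  have hMk : ∀ k t, Mk k t = Fk k t * t ^ (((k * e : ℕ) : ℤ) - p) := fun k t => rfl
  obtain ⟨n, hn, hcard⟩ : ∃ n : ℕ, p + 1 ≤ n ∧ G.card = n + 1 :=
    ⟨G.card - 1, by omega, by omega⟩
  set g : Fin (n + 1) ↪o ℤ := G.orderEmbOfFin hcard with hgdef
  have hgmem : ∀ i, g i ∈ G := fun i => Finset.orderEmbOfFin_mem G hcard i
  have hgmono : StrictMono g := g.strictMono
  -- Step 1: `F_n` is not identically zero near `0`
  have hFn_an : AnalyticAt ℂ (Fk n) 0 :=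
    coset_Fk_analyticOnNhd hFρ hFk0 hFks n 0 (Metric.mem_ball_self hρ)
  have hFn_nz : ¬ ∀ᶠ t in 𝓝 (0 : ℂ), Fk n t = 0 := fun hz =>
    hnd (coset_degenerate he hα hρ hFρ hFM hFk0 hFks hMk hz)
  obtain ⟨m, v, hv_an, hv0, hv_eq⟩ :=
    hFn_an.exists_eventuallyEq_pow_smul_nonzero_iff.2 hFn_nz
  obtain ⟨ρ₂, hρ₂, hρ₂v⟩ := Metric.eventually_nhds_iff_ball.1 hv_eq
  -- Step 2: the root curve and its asymptotics
  set u : ℝ → ℂ := fun τ => c + β * (τ : ℂ) with hudef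
  set s : ℝ → ℂ := fun τ => (c + β * (τ : ℂ)) ^ (-((e : ℂ)⁻¹)) with hsdef
  set y : ℝ := -(e : ℝ)⁻¹ with hydef
  have hexp : (-((e : ℂ)⁻¹)) = ((y : ℝ) : ℂ) := by push_cast [hydef]; ring
  have hs_tend : Tendsto s atTop (𝓝 0) := coset_root_tendsto_zero he c β hβ0
  have harg : Tendsto (fun τ => Complex.arg (u τ)) atTop (𝓝 (Complex.arg β)) :=
    coset_arg_tendsto c β hβ
  have hne : p ≤ n * e := by nlinarith
  set N' : ℕ := m + (n * e - p) with hN'def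
  have hN' : N' ≠ 0 := by
    have : p + 1 ≤ n * e := by nlinarith
    omega
  set ε : ℝ → ℂ := fun τ =>
    Complex.exp (((Complex.arg (u τ) * y : ℝ) : ℂ) * Complex.I) with hεdef
  set E : ℝ → ℂ := fun τ => ε τ ^ N' * v (s τ) with hEdef
  set z₀ : ℂ := Complex.exp (((Complex.arg β * y : ℝ) : ℂ) * Complex.I) ^ N' * v 0 with hz₀def
  have hz₀ : z₀ ≠ 0 := mul_ne_zero (pow_ne_zero _ (Complex.exp_ne_zero _)) hv0
  have hE_tend : Tendsto E atTop (𝓝 z₀) := by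
    have h1 : Tendsto ε atTop
        (𝓝 (Complex.exp (((Complex.arg β * y : ℝ) : ℂ) * Complex.I))) := by
      refine (Complex.continuous_exp.tendsto _).comp ?_
      refine Tendsto.mul_const _ ?_
      exact (Complex.continuous_ofReal.tendsto _).comp (harg.mul_const y)
    have h2 : Tendsto (fun τ => v (s τ)) atTop (𝓝 (v 0)) :=
      hv_an.continuousAt.tendsto.comp hs_tend
    exact (h1.pow N').mul h2
  have hMkn : ∀ τ, s τ ∈ Metric.ball (0 : ℂ) ρ₂ → Mk n (s τ) = (s τ) ^ N' * v (s τ) := by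
    intro τ hsb
    rw [hMk, hρ₂v _ hsb, sub_zero, smul_eq_mul]
    have : (s τ) ^ (((n * e : ℕ) : ℤ) - p) = (s τ) ^ (n * e - p : ℕ) := by
      rw [← Nat.cast_sub hne, zpow_natCast]
    rw [this, hN'def, pow_add]
    ring
  have hpolar : ∀ τ, u τ ≠ 0 → s τ ∈ Metric.ball (0 : ℂ) ρ₂ →
      Mk n (s τ) = (((‖u τ‖ ^ y) ^ N' : ℝ) : ℂ) * E τ := by
    intro τ hu0 hsb
    have h2 : s τ = ((‖u τ‖ ^ y : ℝ) : ℂ) * ε τ := by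
      show (c + β * (τ : ℂ)) ^ (-((e : ℂ)⁻¹)) = _
      rw [hexp]
      exact coset_cpow_polar hu0 y
    have h3 : (s τ) ^ N' = (((‖u τ‖ ^ y) ^ N' : ℝ) : ℂ) * ε τ ^ N' := by
      rw [h2, mul_pow]; push_cast; ring
    rw [hMkn τ hsb, h3]
    simp only [hEdef]
    ring
  have hdecay : Tendsto (fun τ => Mk n (s τ)) atTop (𝓝 0) := by
    have h1 : Tendsto (fun τ => (s τ) ^ N' * v (s τ)) atTop (𝓝 0) := by
      have := (hs_tend.pow N').mul (hv_an.continuousAt.tendsto.comp hs_tend)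
      simpa [zero_pow hN'] using this
    refine h1.congr' ?_
    filter_upwards [hs_tend.eventually_mem (Metric.ball_mem_nhds 0 hρ₂)] with τ h1
    exact (hMkn τ h1).symm
  -- Step 3: the lattice constant and a threshold
  obtain ⟨hW0, hWZ⟩ := coset_lattice (fun i => g i) hgmono.injective
  set W : ℤ := ∏ i, ∏ j ∈ Finset.univ.erase i, (g i - g j) with hWdef
  have hev : ∀ᶠ τ : ℝ in atTop, (u τ).im ≠ 0 ∧ s τ ∈ Metric.ball (0 : ℂ) ρ ∧
      s τ ∈ Metric.ball (0 : ℂ) ρ₂ ∧ ‖Mk n (s τ)‖ * |(W : ℝ)| < 1 := by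
    refine (coset_im_eventually_ne c β hβ).and
      ((hs_tend.eventually_mem (Metric.ball_mem_nhds 0 hρ)).and
        ((hs_tend.eventually_mem (Metric.ball_mem_nhds 0 hρ₂)).and ?_))
    have : Tendsto (fun τ => ‖Mk n (s τ)‖ * |(W : ℝ)|) atTop (𝓝 0) := by
      simpa using (tendsto_zero_iff_norm_tendsto_zero.1 hdecay).mul_const |(W : ℝ)|
    exact this.eventually (eventually_lt_nhds zero_lt_one)
  obtain ⟨T, hT⟩ := eventually_atTop.1 hev
  have hu0T : ∀ τ, T ≤ τ → u τ ≠ 0 := fun τ hτ h => (hT τ hτ).1 (by simp [h])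
  have hchain : ∀ k τ, T ≤ τ → HasDerivAt (fun σ => Mk k (s σ)) (Mk (k + 1) (s τ)) τ := by
    intro k τ hτ
    obtain ⟨him, hb, -, -⟩ := hT τ hτ
    exact coset_chain he hαdef hFρ hFk0 hFks hMk k (Complex.mem_slitPlane_iff.2 (Or.inr him)) hb
  have hpol : ∀ τ, T ≤ τ →
      Mk n (s τ) = (((‖u τ‖ ^ y) ^ N' : ℝ) : ℂ) * E τ ∧ 0 < (‖u τ‖ ^ y) ^ N' := by
    intro τ hτ
    obtain ⟨-, -, hb2, -⟩ := hT τ hτ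
    exact ⟨hpolar τ (hu0T τ hτ) hb2,
      pow_pos (Real.rpow_pos_of_pos (norm_pos_iff.2 (hu0T τ hτ)) y) N'⟩
  -- Step 4: the window consequence
  have hwindow : ∀ k : ℤ, T ≤ (k : ℝ) + g 0 →
      (∀ i, ∃ L : ℤ, M (s ((k : ℝ) + g i)) = (L : ℂ) * (2 * Real.pi * Complex.I)) →
      (∃ ξ₁, (k : ℝ) + g 0 ≤ ξ₁ ∧ (E ξ₁).re = 0) ∧
      (∃ ξ₂, (k : ℝ) + g 0 ≤ ξ₂ ∧ (E ξ₂).im = 0) := by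
    intro k hk hhit
    choose L hL using hhit
    set x : Fin (n + 1) → ℝ := fun i => (k : ℝ) + g i with hxdef
    have hxmono : StrictMono x := fun i j hij => by
      have : ((g i : ℤ) : ℝ) < g j := Int.cast_lt.2 (hgmono hij)
      simp only [hxdef]
      linarith
    have hxI : ∀ i, x i ∈ Set.Icc (x 0) (x (Fin.last n)) := fun i =>
      ⟨hxmono.monotone (Fin.zero_le i), hxmono.monotone (Fin.le_last i)⟩
    have hxT : ∀ τ ∈ Set.Icc (x 0) (x (Fin.last n)), T ≤ τ := fun τ hτ => hk.trans hτ.1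
    have hs0x : ∀ i, s (x i) ≠ 0 := fun i =>
      Complex.cpow_ne_zero_iff.2 (Or.inl (hu0T _ (hxT _ (hxI i))))
    have hval : ∀ i, Mk 0 (s (x i)) = (L i : ℂ) * (2 * Real.pi * Complex.I) := fun i => by
      rw [coset_Mk_zero hFM hFk0 hMk (hs0x i)]; exact hL i
    have hval_re : ∀ i, (Mk 0 (s (x i))).re = 0 := fun i => by rw [hval i]; simp
    have hval_im : ∀ i, (Mk 0 (s (x i))).im = 2 * Real.pi * L i := fun i => by
      rw [hval i]; simp; ring
    have hwt : ∀ i, (∏ j ∈ Finset.univ.erase i, (x i - x j)) =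
        ∏ j ∈ Finset.univ.erase i, ((g i : ℝ) - g j) :=
      fun i => Finset.prod_congr rfl fun j _ => by simp only [hxdef]; ring
    constructor
    · obtain ⟨ξ, hξI, hξ⟩ := coset_dividedDiff_mvt (fun k τ => (Mk k (s τ)).re)
        (fun k _ τ hτ => coset_hasDerivAt_re (hchain k τ (hxT τ hτ))) x hxmono hxI
      have hξ' : (Mk n (s ξ)).re = n.factorial *
          ∑ i, (Mk 0 (s (x i))).re / ∏ j ∈ Finset.univ.erase i, (x i - x j) := hξ
      have hsum : (∑ i, (Mk 0 (s (x i))).re / ∏ j ∈ Finset.univ.erase i, (x i - x j)) = 0 := by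
        simp [hval_re]
      rw [hsum, mul_zero] at hξ'
      obtain ⟨hp1, hp2⟩ := hpol ξ (hxT ξ hξI)
      refine ⟨ξ, hξI.1, ?_⟩
      rw [hp1, Complex.re_ofReal_mul] at hξ'
      exact (mul_eq_zero.1 hξ').resolve_left hp2.ne'
    · obtain ⟨ξ, hξI, hξ⟩ := coset_dividedDiff_mvt (fun k τ => (Mk k (s τ)).im)
        (fun k _ τ hτ => coset_hasDerivAt_im (hchain k τ (hxT τ hτ))) x hxmono hxI
      have hξ' : (Mk n (s ξ)).im = n.factorial *
          ∑ i, (Mk 0 (s (x i))).im / ∏ j ∈ Finset.univ.erase i, (x i - x j) := hξ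
      obtain ⟨Z, hZ⟩ := hWZ L
      have hsum : (∑ i, (Mk 0 (s (x i))).im / ∏ j ∈ Finset.univ.erase i, (x i - x j)) =
          2 * Real.pi * ∑ i, (L i : ℝ) / ∏ j ∈ Finset.univ.erase i, ((g i : ℝ) - g j) := by
        rw [Finset.mul_sum]
        refine Finset.sum_congr rfl fun i _ => ?_
        rw [hval_im, hwt]
        ring
      rw [hsum] at hξ'
      have hkey : (Mk n (s ξ)).im * W = 2 * Real.pi * n.factorial * Z := by
        rw [hξ', ← hZ]
        ring
      obtain ⟨-, -, -, hb4⟩ := hT ξ (hxT ξ hξI)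
      have hZ0 : Z = 0 := by
        have h1 : |(Mk n (s ξ)).im * (W : ℝ)| < 1 := by
          rw [abs_mul]
          exact lt_of_le_of_lt
            (mul_le_mul_of_nonneg_right (Complex.abs_im_le_norm _) (abs_nonneg _)) hb4
        rw [hkey] at h1
        have h2 : (1 : ℝ) ≤ 2 * Real.pi * n.factorial := by
          have : (1 : ℝ) ≤ n.factorial := by exact_mod_cast Nat.factorial_pos n
          nlinarith [Real.pi_gt_three]
        have h3 : |(Z : ℝ)| < 1 := by
          rw [abs_mul, abs_of_pos (by positivity : (0 : ℝ) < 2 * Real.pi * n.factorial)] at h1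
          by_contra hcon
          push Not at hcon
          nlinarith [abs_nonneg (Z : ℝ)]
        have h4 : |Z| < 1 := by exact_mod_cast h3
        exact Int.abs_lt_one_iff.1 h4
      rw [hZ0, Int.cast_zero, mul_zero] at hkey
      have hW0' : ((W : ℤ) : ℝ) ≠ 0 := by exact_mod_cast hW0
      have him0 : (Mk n (s ξ)).im = 0 := (mul_eq_zero.1 hkey).resolve_right hW0'
      obtain ⟨hp1, hp2⟩ := hpol ξ (hxT ξ hξI)
      refine ⟨ξ, hξI.1, ?_⟩
      rw [hp1, Complex.im_ofReal_mul] at him0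
      exact (mul_eq_zero.1 him0).resolve_left hp2.ne'
  -- Step 5: conclusion
  rw [← Set.not_infinite]
  intro hinf
  have hunb : ∀ T' : ℝ, ∃ k : ℤ, (0 ≤ k ∧ ∀ j ∈ G, ∃ L : ℤ,
      M ((c + β * ((k + j : ℤ) : ℂ)) ^ (-((e : ℂ)⁻¹))) = (L : ℂ) * (2 * ↑Real.pi * Complex.I)) ∧
      T' ≤ (k : ℝ) + g 0 := by
    intro T'
    by_contra hcon
    push Not at hcon
    refine hinf ((Set.finite_Icc (0 : ℤ) ⌈T' - g 0⌉).subset ?_)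
    intro k hk
    refine ⟨hk.1, ?_⟩
    have h1 : (k : ℝ) + g 0 < T' := hcon k hk
    have h2 : (k : ℝ) ≤ ((⌈T' - g 0⌉ : ℤ) : ℝ) := by
      have := Int.le_ceil (T' - g 0)
      linarith
    exact_mod_cast h2
  have hnode : ∀ (k : ℤ) (i : Fin (n + 1)),
      s ((k : ℝ) + g i) = (c + β * ((k + g i : ℤ) : ℂ)) ^ (-((e : ℂ)⁻¹)) := by
    intro k i
    simp only [hsdef]
    push_cast
    ring_nf
  have hhits : ∀ k : ℤ, (∀ j ∈ G, ∃ L : ℤ,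
      M ((c + β * ((k + j : ℤ) : ℂ)) ^ (-((e : ℂ)⁻¹))) = (L : ℂ) * (2 * ↑Real.pi * Complex.I)) →
      ∀ i, ∃ L : ℤ, M (s ((k : ℝ) + g i)) = (L : ℂ) * (2 * Real.pi * Complex.I) := by
    intro k hk i
    rw [hnode]
    exact hk (g i) (hgmem i)
  have hre : z₀.re = 0 := by
    by_contra hne0
    have hev' : ∀ᶠ τ in atTop, (E τ).re ≠ 0 :=
      ((Complex.continuous_re.tendsto z₀).comp hE_tend).eventually_ne hne0
    obtain ⟨T', hT'⟩ := eventually_atTop.1 hev'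
    obtain ⟨k, ⟨-, hk⟩, hkT⟩ := hunb (max T T')
    obtain ⟨⟨ξ₁, hξ₁, hE1⟩, -⟩ := hwindow k ((le_max_left _ _).trans hkT) (hhits k hk)
    exact hT' ξ₁ ((le_max_right _ _).trans (hkT.trans hξ₁)) hE1
  have him : z₀.im = 0 := by
    by_contra hne0
    have hev' : ∀ᶠ τ in atTop, (E τ).im ≠ 0 :=
      ((Complex.continuous_im.tendsto z₀).comp hE_tend).eventually_ne hne0
    obtain ⟨T', hT'⟩ := eventually_atTop.1 hev'
    obtain ⟨k, ⟨-, hk⟩, hkT⟩ := hunb (max T T')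
    obtain ⟨-, ⟨ξ₂, hξ₂, hE2⟩⟩ := hwindow k ((le_max_left _ _).trans hkT) (hhits k hk)
    exact hT' ξ₂ ((le_max_right _ _).trans (hkT.trans hξ₂)) hE2
  exact hz₀ (Complex.ext hre him)

/-- **Stub S4ᶜ — COSET WINDOW RIGIDITY.**  Let `e ≥ 1` and let `M` be meromorphic at `0`
(`t ↦ t ^ p * M t` analytic at `0`) and not of the form `Q((t^e)⁻¹)` near `0`.  Then for every
coset `c + 2πiℤ` and every pattern `G ⊆ ℤ` with `|G| ≥ p + 2`, only finitely many `k ∈ ℤ` have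
all translates `k + j` (`j ∈ G`) hitting: `M ((c + 2πi(k+j))^{-1/e}) ∈ 2πiℤ` (principal power).
[folklore] -/
theorem stub_windowRigidity_coset : ∀ (e p : ℕ) (M : ℂ → ℂ) (c : ℂ) (G : Finset ℤ), 0 < e →
    AnalyticAt ℂ (fun t : ℂ => t ^ p * M t) 0 →
    (¬ ∃ Q : Polynomial ℂ, ∀ᶠ t in 𝓝[≠] (0 : ℂ), M t = Q.eval (t ^ e)⁻¹) → p + 2 ≤ G.card →
    Set.Finite {k : ℤ | ∀ j ∈ G, ∃ L : ℤ, M ((c + 2 * ↑Real.pi * Complex.I * ((k + j : ℤ) : ℂ)) ^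
      (-((e : ℂ)⁻¹))) = (L : ℂ) * (2 * ↑Real.pi * Complex.I)} := by
  intro e p M c G he hF hnd hG
  have hβim : (2 * ↑Real.pi * Complex.I : ℂ).im ≠ 0 := by simp [Real.pi_ne_zero]
  have hβim' : (-(2 * ↑Real.pi * Complex.I) : ℂ).im ≠ 0 := by simp [Real.pi_ne_zero]
  have hpos := coset_tail e p M c (2 * ↑Real.pi * Complex.I) G he hF hnd hG hβim
  have hcardneg : (G.image fun j => -j).card = G.card :=
    Finset.card_image_of_injective _ neg_injective
  have hneg := coset_tail e p M c (-(2 * ↑Real.pi * Complex.I)) (G.image fun j => -j) he hF hnd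
    (by rw [hcardneg]; exact hG) hβim'
  refine (hpos.union (hneg.image fun k => -k)).subset ?_
  intro k hk
  simp only [Set.mem_setOf_eq] at hk
  rcases le_or_gt 0 k with h0 | h0
  · exact Or.inl ⟨h0, hk⟩
  · right
    refine ⟨-k, ⟨by omega, fun j hj => ?_⟩, neg_neg k⟩
    obtain ⟨j', hj', rfl⟩ := Finset.mem_image.1 hj
    obtain ⟨L, hL⟩ := hk j' hj'
    refine ⟨L, ?_⟩
    have : c + -(2 * ↑Real.pi * Complex.I) * ((-k + -j' : ℤ) : ℂ) =
        c + 2 * ↑Real.pi * Complex.I * ((k + j' : ℤ) : ℂ) := by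
      push_cast; ring
    rw [this]
    exact hL

end Summit.Schanuel.Schanuel.Cruxes.MinimalCounterexampleInAcl.KernelArithmeticSelection

end


-- ======== segment: work/stubs/stub_cosetBranchCover.lean ========
/-!
# Coset branch cover at infinity — crux stmt-Schanuel-0969 `RigidCore.MinimalCounterexampleInAcl`

Line `kernel-arithmetic-selection`, stub `stub_cosetBranchCover` (gen 14), `--supports
stmt-Schanuel-0969`.  This is the COVERING version, on a kernel coset `x₀ ∈ c + 2πiℤ`, of the tree
theorem `Literature.NumberTheory.Transcendental.exists_branch_through_hits`.

Let `W ⊆ ℂ² × ℂ²` be Zariski closed with `zariskiDim ℂ W < 2` and let `c ∈ ℂ`.  Then there are a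
ramification `e ≥ 1`, radii `R, r > 0`, a FINITE set `B` of branch data `b = (Φ₁, Φ₂, Φ₃, N)`
(`Φⱼ` analytic on `|t| < r`, the germ `𝔟_b(t) = ((t⁻ᵉ, Φ₁(t) t⁻ᴺ), (Φ₂(t) t⁻ᴺ, Φ₃(t) t⁻ᴺ))`
contained in `W` for `0 < |t| < r`) and a FINITE exceptional set `X ⊆ ℂ²`, such that every
independent exponential point `x` of `W` (`x ∈ indepExpPoints W`) on the coset `x₀ ∈ c + 2πiℤ`
with `R < |x₀|` and `x ∉ X` is the point `𝔟_b(ρ)` of some branch `b ∈ B` at the PRINCIPAL root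
`ρ = x₀ ^ (-1/e)` (so `ρ ^ e = x₀⁻¹`, `0 < |ρ| < r`).

Proof (that of `exists_branch_through_hits`, class by class).  The coordinate pairs `(x₀, x₁)`,
`(x₀, y₀)`, `(x₀, y₁)` satisfy non-trivial polynomial relations on `W`
(`exists_relation_pair_of_zariskiDim_lt_two`); near `x₀ = ∞` their solutions lie on finitely many
Puiseux branches (`exists_branch_atlas`), valid at every root `t` of `t ^ {eᵢ} = x₀⁻¹`, in
particular at the powers `ρ ^ {mᵢ}` of the principal `e`-th root, `e = e₁ e₂ e₃`.  This sorts
the large points into finitely many classes `U_b`; on a class, `x₁` is a function of `x₀`, so the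
coset points of a class with `|x₀| ≤ R'` are finitely many (finitely many `k`).  Hence a class
carrying infinitely many coset points carries coset points with `|x₀|` arbitrarily large, i.e.
with parameter `ρ` arbitrarily small, and — the branch point being a curve germ with meromorphic
coordinates on which every defining polynomial of `W` then vanishes frequently near `t = 0` —
its rescaled branch lies in `W` on a punctured disc (`MeromorphicCurveGerms`).  The finitely
many coset points of the remaining (finite) classes form the exceptional set `X`. [folklore]
-/

noncomputable section

set_option linter.dupNamespace false

open Complex Filter Topology Set Metric MvPolynomial

namespace Summit.Schanuel.Schanuel.Cruxes.MinimalCounterexampleInAcl.KernelArithmeticSelection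

open Literature.NumberTheory.Transcendental
open Literature.Analysis.Complex.PuiseuxInfinity (exists_branch_atlas)
open Literature.Analysis.Complex.MeromorphicGerm (analyticAt_pow_succ_mul_div_pow
  analyticAt_pow_succ_mul_inv_pow exists_analyticAt_pow_mul_aeval exists_radius_eq_zero
  frequently_nhdsNE_of_forall_exists ne_zero_and_norm_lt_of_pow_eq_inv)

/-- The branch point `((t⁻ᵉ, Φ₁ t / tᴺ), (Φ₂ t / tᴺ, Φ₃ t / tᴺ)) ∈ ℂ² × ℂ²` (local notation). -/
local notation3 "𝔟[" e ", " N ", " Φ₁ ", " Φ₂ ", " Φ₃ ", " t "]" =>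
  (Sum.elim ![((t : ℂ) ^ (e : ℕ))⁻¹, (Φ₁ : ℂ → ℂ) t / t ^ (N : ℕ)]
    ![(Φ₂ : ℂ → ℂ) t / t ^ (N : ℕ), (Φ₃ : ℂ → ℂ) t / t ^ (N : ℕ)] : Fin 2 ⊕ Fin 2 → ℂ)

/-! ## Preliminaries -/

/-- The principal `e`-th root `z ^ (-1/e)` of `z⁻¹` satisfies `(z ^ (-1/e)) ^ e = z⁻¹` (also at
`z = 0`, where both sides vanish). [folklore] -/
theorem cosetBranchCover_cpow_neg_inv_pow (z : ℂ) {e : ℕ} (he : e ≠ 0) :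
    (z ^ (-((e : ℂ)⁻¹))) ^ e = z⁻¹ := by
  rw [← Complex.cpow_nat_mul, mul_neg, mul_inv_cancel₀ (Nat.cast_ne_zero.2 he),
    Complex.cpow_neg_one]

/-- A bounded piece of a coset `c + 2πiℤ` is finite. [folklore] -/
theorem cosetBranchCover_finite_coset_norm_le (c : ℂ) (M : ℝ) :
    Set.Finite {u : ℂ | (∃ k : ℤ, u = c + 2 * ↑Real.pi * Complex.I * (k : ℂ)) ∧ ‖u‖ ≤ M} := by
  have hZ : (Metric.closedBall (0 : ℤ) ((M + ‖c‖) / (2 * Real.pi))).Finite := by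
    rw [Int.closedBall_eq_Icc]
    exact Set.finite_Icc _ _
  refine (hZ.image fun k : ℤ => c + 2 * ↑Real.pi * Complex.I * (k : ℂ)).subset ?_
  rintro u ⟨⟨k, rfl⟩, hu⟩
  refine ⟨k, ?_, rfl⟩
  have h2π : (0 : ℝ) < 2 * Real.pi := by positivity
  rw [Metric.mem_closedBall, dist_zero_right, le_div_iff₀ h2π]
  have hnorm : ‖(2 * ↑Real.pi * Complex.I * (k : ℂ) : ℂ)‖ = ‖k‖ * (2 * Real.pi) := by
    rw [norm_mul, norm_mul, norm_mul, Complex.norm_I, mul_one, Complex.norm_real,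
      Real.norm_of_nonneg Real.pi_pos.le, Complex.norm_intCast, Int.norm_eq_abs,
      Complex.norm_two]
    ring
  calc ‖k‖ * (2 * Real.pi) = ‖(c + 2 * ↑Real.pi * Complex.I * (k : ℂ)) - c‖ := by
        rw [add_sub_cancel_left, hnorm]
    _ ≤ ‖c + 2 * ↑Real.pi * Complex.I * (k : ℂ)‖ + ‖c‖ := norm_sub_le _ _
    _ ≤ M + ‖c‖ := by gcongr

/-- **A curve germ at infinity hit frequently by `W` lies in `W`.**  If the branch point
`𝔟(t) = ((t⁻ᵉ, Φ₁ t / tᴺ), (Φ₂ t / tᴺ, Φ₃ t / tᴺ))` (`Φⱼ` analytic at `0`) belongs to the Zariski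
closed set `W` for parameters `t ≠ 0` arbitrarily close to `0`, then it belongs to `W` on a whole
punctured disc: every generator of the (finitely generated) ideal of `W` is, along the germ, a
meromorphic function vanishing frequently near `0` (`exists_analyticAt_pow_mul_aeval`,
`exists_radius_eq_zero`).  Extracted from the proof of `exists_branch_through_hits`. [folklore] -/
theorem cosetBranchCover_branch_mem_of_forall_exists {W : Set (Fin 2 ⊕ Fin 2 → ℂ)}
    (hcl : IsZariskiClosed ℂ W) {e N : ℕ} {Φ₁ Φ₂ Φ₃ : ℂ → ℂ} (ha₁ : AnalyticAt ℂ Φ₁ 0)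
    (ha₂ : AnalyticAt ℂ Φ₂ 0) (ha₃ : AnalyticAt ℂ Φ₃ 0)
    (hfr : ∀ ε : ℝ, 0 < ε → ∃ t : ℂ, 0 < ‖t‖ ∧ ‖t‖ < ε ∧ 𝔟[e, N, Φ₁, Φ₂, Φ₃, t] ∈ W) :
    ∃ δ > 0, ∀ t : ℂ, 0 < ‖t‖ → ‖t‖ < δ → 𝔟[e, N, Φ₁, Φ₂, Φ₃, t] ∈ W := by
  classical
  obtain ⟨J, hJ⟩ := hcl
  obtain ⟨G, hG⟩ := (isNoetherian_def.1 (inferInstance : IsNoetherian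
    (MvPolynomial (Fin 2 ⊕ Fin 2) ℂ) (MvPolynomial (Fin 2 ⊕ Fin 2) ℂ))) J
  have hcoord : ∀ k : Fin 2 ⊕ Fin 2, ∃ K : ℕ,
      AnalyticAt ℂ (fun t : ℂ => t ^ K * 𝔟[e, N, Φ₁, Φ₂, Φ₃, t] k) 0 := by
    intro k
    rcases k with k | k <;> fin_cases k
    · exact ⟨e + 1, analyticAt_pow_succ_mul_inv_pow e⟩
    · exact ⟨N + 1, analyticAt_pow_succ_mul_div_pow ha₁ N⟩
    · exact ⟨N + 1, analyticAt_pow_succ_mul_div_pow ha₂ N⟩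
    · exact ⟨N + 1, analyticAt_pow_succ_mul_div_pow ha₃ N⟩
  have hrad : ∀ p ∈ G, ∃ δ > 0, ∀ t : ℂ, 0 < ‖t‖ → ‖t‖ < δ →
      MvPolynomial.aeval 𝔟[e, N, Φ₁, Φ₂, Φ₃, t] p = 0 := by
    intro p hp
    obtain ⟨K, hK⟩ :=
      exists_analyticAt_pow_mul_aeval (fun t : ℂ => 𝔟[e, N, Φ₁, Φ₂, Φ₃, t]) hcoord p
    refine exists_radius_eq_zero hK (frequently_nhdsNE_of_forall_exists fun ε hε => ?_)
    obtain ⟨t, ht0, htε, htW⟩ := hfr ε hε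
    refine ⟨t, ht0, htε, ?_⟩
    rw [hJ, MvPolynomial.mem_zeroLocus_iff] at htW
    exact htW p (hG ▸ Ideal.subset_span hp)
  choose! δp hδp hzero using hrad
  set δ₀ : ℝ := if hG0 : G.Nonempty then G.inf' hG0 δp else 1 with hδ₀
  have hδ₀pos : 0 < δ₀ := by
    rw [hδ₀]; split_ifs with hG0
    · exact (Finset.lt_inf'_iff hG0).2 fun p hp => hδp p hp
    · exact one_pos
  have hδ₀le : ∀ p ∈ G, δ₀ ≤ δp p := fun p hp => by
    rw [hδ₀, dif_pos ⟨p, hp⟩]; exact Finset.inf'_le _ hp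
  refine ⟨δ₀, hδ₀pos, fun t ht0 htr => ?_⟩
  rw [hJ, ← hG, MvPolynomial.zeroLocus_span]
  intro p hp
  exact hzero p hp t ht0 (htr.trans_le (hδ₀le p hp))

/-! ## The cover -/

/-- **Stub `stub_cosetBranchCover` — COSET BRANCH COVER AT INFINITY** (covering version of
`Literature.NumberTheory.Transcendental.exists_branch_through_hits` on a kernel coset; see the
module docstring).  For `W ⊆ ℂ² × ℂ²` Zariski closed of `zariskiDim < 2` and `c ∈ ℂ`: finitely
many analytic branches at `x₀ = ∞` contained in `W`, parametrised by the principal root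
`ρ = x₀ ^ (-1/e)`, cover all but finitely many independent exponential points of `W` on the coset
`x₀ ∈ c + 2πiℤ` beyond a radius `R`. [folklore] -/
theorem stub_cosetBranchCover : ∀ (W : Set (Fin 2 ⊕ Fin 2 → ℂ)), Literature.NumberTheory.Transcendental.IsZariskiClosed ℂ W → Literature.NumberTheory.Transcendental.zariskiDim ℂ W < 2 → ∀ (c : ℂ), ∃ (e : ℕ) (R r : ℝ) (B : Finset ((ℂ → ℂ) × (ℂ → ℂ) × (ℂ → ℂ) × ℕ)) (X : Set (Fin 2 → ℂ)), 0 < e ∧ 0 < r ∧ X.Finite ∧ (∀ b ∈ B, (∀ t : ℂ, ‖t‖ < r → AnalyticAt ℂ b.1 t ∧ AnalyticAt ℂ b.2.1 t ∧ AnalyticAt ℂ b.2.2.1 t) ∧ ∀ t : ℂ, 0 < ‖t‖ → ‖t‖ < r → (Sum.elim ![(t ^ e)⁻¹, b.1 t / t ^ b.2.2.2] ![b.2.1 t / t ^ b.2.2.2, b.2.2.1 t / t ^ b.2.2.2] : Fin 2 ⊕ Fin 2 → ℂ) ∈ W) ∧ ∀ x ∈ Literature.NumberTheory.Transcendental.indepExpPoints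 W, (∃ k : ℤ, x 0 = c + 2 * ↑Real.pi * Complex.I * (k : ℂ)) → R < ‖x 0‖ → x ∉ X → ∃ b ∈ B, 0 < ‖(x 0) ^ (-((e : ℂ)⁻¹))‖ ∧ ‖(x 0) ^ (-((e : ℂ)⁻¹))‖ < r ∧ Sum.elim x (Complex.exp ∘ x) = (Sum.elim ![(((x 0) ^ (-((e : ℂ)⁻¹))) ^ e)⁻¹, b.1 ((x 0) ^ (-((e : ℂ)⁻¹))) / ((x 0) ^ (-((e : ℂ)⁻¹))) ^ b.2.2.2] ![b.2.1 ((x 0) ^ (-((e : ℂ)⁻¹))) / ((x 0) ^ (-((e : ℂ)⁻¹))) ^ b.2.2.2, b.2.2.1 ((x 0) ^ (-((e : ℂ)⁻¹))) / ((x 0) ^ (-((e : ℂ)⁻¹))) ^ b.2.2.2] : Fin 2 ⊕ Fin 2 → ℂ) := by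
  intro W hcl hdim c
  classical
  -- ### relations and atlases
  obtain ⟨P₁, hP₁, hrel₁⟩ :=
    exists_relation_pair_of_zariskiDim_lt_two W hdim (Sum.inl 0) (Sum.inl 1)
  obtain ⟨P₂, hP₂, hrel₂⟩ :=
    exists_relation_pair_of_zariskiDim_lt_two W hdim (Sum.inl 0) (Sum.inr 0)
  obtain ⟨P₃, hP₃, hrel₃⟩ :=
    exists_relation_pair_of_zariskiDim_lt_two W hdim (Sum.inl 0) (Sum.inr 1)
  obtain ⟨e₁, he₁, R₁, r₁, hr₁, hr₁1, B₁, hB₁, hat₁⟩ := exists_branch_atlas P₁ hP₁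
  obtain ⟨e₂, he₂, R₂, r₂, hr₂, hr₂1, B₂, hB₂, hat₂⟩ := exists_branch_atlas P₂ hP₂
  obtain ⟨e₃, he₃, R₃, r₃, hr₃, hr₃1, B₃, hB₃, hat₃⟩ := exists_branch_atlas P₃ hP₃
  -- ### the common ramification and the principal master root
  obtain ⟨m₁, hm₁⟩ : ∃ m : ℕ, m = e₂ * e₃ := ⟨_, rfl⟩
  obtain ⟨m₂, hm₂⟩ : ∃ m : ℕ, m = e₁ * e₃ := ⟨_, rfl⟩
  obtain ⟨m₃, hm₃⟩ : ∃ m : ℕ, m = e₁ * e₂ := ⟨_, rfl⟩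
  obtain ⟨e, he_def⟩ : ∃ e : ℕ, e = e₁ * e₂ * e₃ := ⟨_, rfl⟩
  have he : 0 < e := he_def ▸ Nat.mul_pos (Nat.mul_pos he₁ he₂) he₃
  have hm₁e : m₁ * e₁ = e := by rw [hm₁, he_def]; ring
  have hm₂e : m₂ * e₂ = e := by rw [hm₂, he_def]; ring
  have hm₃e : m₃ * e₃ = e := by rw [hm₃, he_def]
  have hm₁pos : 0 < m₁ := hm₁ ▸ Nat.mul_pos he₂ he₃
  have hm₂pos : 0 < m₂ := hm₂ ▸ Nat.mul_pos he₁ he₃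
  have hm₃pos : 0 < m₃ := hm₃ ▸ Nat.mul_pos he₁ he₂
  -- the principal `e`-th root `ρt x` of `(x 0)⁻¹`
  set ρt : (Fin 2 → ℂ) → ℂ := fun x => (x 0) ^ (-((e : ℂ)⁻¹)) with hρt_def
  have hρt : ∀ x, ρt x ^ e = (x 0)⁻¹ := fun x =>
    cosetBranchCover_cpow_neg_inv_pow (x 0) he.ne'
  have hρt₁ : ∀ x, (ρt x ^ m₁) ^ e₁ = (x 0)⁻¹ := fun x => by rw [← pow_mul, hm₁e, hρt]
  have hρt₂ : ∀ x, (ρt x ^ m₂) ^ e₂ = (x 0)⁻¹ := fun x => by rw [← pow_mul, hm₂e, hρt]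
  have hρt₃ : ∀ x, (ρt x ^ m₃) ^ e₃ = (x 0)⁻¹ := fun x => by rw [← pow_mul, hm₃e, hρt]
  -- ### values at the independent exponential points
  have hvals : ∀ x ∈ indepExpPoints W, MvPolynomial.eval ![x 0, x 1] P₁ = 0 ∧
      MvPolynomial.eval ![x 0, Complex.exp (x 0)] P₂ = 0 ∧
      MvPolynomial.eval ![x 0, Complex.exp (x 1)] P₃ = 0 :=
    fun x hx => ⟨hrel₁ (Sum.elim x (Complex.exp ∘ x)) hx.2,
      hrel₂ (Sum.elim x (Complex.exp ∘ x)) hx.2, hrel₃ (Sum.elim x (Complex.exp ∘ x)) hx.2⟩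
  -- ### the classes of the large points
  set R₀ : ℝ := max R₁ (max R₂ R₃) with hR₀
  set U : ((ℂ → ℂ) × ℕ) × (((ℂ → ℂ) × ℕ) × ((ℂ → ℂ) × ℕ)) → Set (Fin 2 → ℂ) := fun b =>
    {x | x 1 = b.1.1 (ρt x ^ m₁) / (ρt x ^ m₁) ^ b.1.2 ∧
      Complex.exp (x 0) = b.2.1.1 (ρt x ^ m₂) / (ρt x ^ m₂) ^ b.2.1.2 ∧
      Complex.exp (x 1) = b.2.2.1 (ρt x ^ m₃) / (ρt x ^ m₃) ^ b.2.2.2} with hU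
  have hcov : ∀ x ∈ indepExpPoints W, R₀ < ‖x 0‖ → ∃ b ∈ B₁ ×ˢ (B₂ ×ˢ B₃), x ∈ U b := by
    intro x hx hRx
    obtain ⟨h1, h2, h3⟩ := hvals x hx
    have hR₁x : R₁ < ‖x 0‖ := lt_of_le_of_lt (le_max_left _ _) hRx
    have hR₂x : R₂ < ‖x 0‖ := lt_of_le_of_lt ((le_max_left _ _).trans (le_max_right _ _)) hRx
    have hR₃x : R₃ < ‖x 0‖ :=
      lt_of_le_of_lt ((le_max_right _ _).trans (le_max_right _ _)) hRx
    obtain ⟨-, -, b₁, hb₁, hv₁⟩ := hat₁ (x 0) (x 1) hR₁x h1 (ρt x ^ m₁) (hρt₁ x)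
    obtain ⟨-, -, b₂, hb₂, hv₂⟩ := hat₂ (x 0) (Complex.exp (x 0)) hR₂x h2 (ρt x ^ m₂) (hρt₂ x)
    obtain ⟨-, -, b₃, hb₃, hv₃⟩ := hat₃ (x 0) (Complex.exp (x 1)) hR₃x h3 (ρt x ^ m₃) (hρt₃ x)
    exact ⟨(b₁, (b₂, b₃)), Finset.mk_mem_product hb₁ (Finset.mk_mem_product hb₂ hb₃),
      hv₁, hv₂, hv₃⟩
  -- on a class, a point is determined by its first coordinate
  have hinj : ∀ b, Set.InjOn (fun x : Fin 2 → ℂ => x 0) (U b) := by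
    intro b x hx x' hx' h0
    have h0' : x 0 = x' 0 := h0
    have hρ : ρt x = ρt x' := by
      show (x 0) ^ (-((e : ℂ)⁻¹)) = (x' 0) ^ (-((e : ℂ)⁻¹))
      rw [h0']
    have h1 : x 1 = x' 1 := by rw [hx.1, hx'.1, hρ]
    funext k
    fin_cases k
    · exact h0'
    · exact h1
  -- ### the coset points of a class
  set Tc : ((ℂ → ℂ) × ℕ) × (((ℂ → ℂ) × ℕ) × ((ℂ → ℂ) × ℕ)) → Set (Fin 2 → ℂ) := fun b =>
    {x | x ∈ indepExpPoints W ∧ (∃ k : ℤ, x 0 = c + 2 * ↑Real.pi * Complex.I * (k : ℂ)) ∧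
      R₀ < ‖x 0‖ ∧ x ∈ U b} with hTc
  -- an infinite class of coset points is unbounded in the first coordinate (strong form)
  have hunb : ∀ b, (Tc b).Infinite → ∀ R' : ℝ, Set.Infinite {x | x ∈ Tc b ∧ R' < ‖x 0‖} := by
    intro b hb R' hcon
    have hfin : Set.Finite {x | x ∈ Tc b ∧ ‖x 0‖ ≤ R'} := by
      refine Set.Finite.of_finite_image (f := fun x : Fin 2 → ℂ => x 0)
        ((cosetBranchCover_finite_coset_norm_le c R').subset ?_)
        ((hinj b).mono fun x hx => hx.1.2.2.2)
      rintro _ ⟨x, ⟨hxT, hle⟩, rfl⟩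
      exact ⟨hxT.2.1, hle⟩
    refine hb ((hcon.union hfin).subset fun x hx => ?_)
    rcases lt_or_ge R' ‖x 0‖ with h | h
    · exact Or.inl ⟨hx, h⟩
    · exact Or.inr ⟨hx, h⟩
  -- ### the infinite classes and the exceptional set
  set Bi : Finset (((ℂ → ℂ) × ℕ) × (((ℂ → ℂ) × ℕ) × ((ℂ → ℂ) × ℕ))) :=
    (B₁ ×ˢ (B₂ ×ˢ B₃)).filter (fun b => (Tc b).Infinite) with hBi
  set Bf : Finset (((ℂ → ℂ) × ℕ) × (((ℂ → ℂ) × ℕ) × ((ℂ → ℂ) × ℕ))) :=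
    (B₁ ×ˢ (B₂ ×ˢ B₃)).filter (fun b => (Tc b).Finite) with hBf
  set X : Set (Fin 2 → ℂ) := ⋃ b ∈ (↑Bf : Set _), Tc b with hX
  have hXfin : X.Finite :=
    Set.Finite.biUnion Bf.finite_toSet fun b hb => (Finset.mem_filter.1 (Finset.mem_coe.1 hb)).2
  -- ### the branches
  set Nf : ((ℂ → ℂ) × ℕ) × (((ℂ → ℂ) × ℕ) × ((ℂ → ℂ) × ℕ)) → ℕ := fun b =>
    m₁ * b.1.2 + m₂ * b.2.1.2 + m₃ * b.2.2.2 with hNf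
  have hN₁ : ∀ b, m₁ * b.1.2 ≤ Nf b := fun b => by
    show m₁ * b.1.2 ≤ m₁ * b.1.2 + m₂ * b.2.1.2 + m₃ * b.2.2.2
    omega
  have hN₂ : ∀ b, m₂ * b.2.1.2 ≤ Nf b := fun b => by
    show m₂ * b.2.1.2 ≤ m₁ * b.1.2 + m₂ * b.2.1.2 + m₃ * b.2.2.2
    omega
  have hN₃ : ∀ b, m₃ * b.2.2.2 ≤ Nf b := fun b => by
    show m₃ * b.2.2.2 ≤ m₁ * b.1.2 + m₂ * b.2.1.2 + m₃ * b.2.2.2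
    omega
  set Φ₁f : ((ℂ → ℂ) × ℕ) × (((ℂ → ℂ) × ℕ) × ((ℂ → ℂ) × ℕ)) → ℂ → ℂ := fun b t =>
    b.1.1 (t ^ m₁) * t ^ (Nf b - m₁ * b.1.2) with hΦ₁f
  set Φ₂f : ((ℂ → ℂ) × ℕ) × (((ℂ → ℂ) × ℕ) × ((ℂ → ℂ) × ℕ)) → ℂ → ℂ := fun b t =>
    b.2.1.1 (t ^ m₂) * t ^ (Nf b - m₂ * b.2.1.2) with hΦ₂f
  set Φ₃f : ((ℂ → ℂ) × ℕ) × (((ℂ → ℂ) × ℕ) × ((ℂ → ℂ) × ℕ)) → ℂ → ℂ := fun b t =>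
    b.2.2.1 (t ^ m₃) * t ^ (Nf b - m₃ * b.2.2.2) with hΦ₃f
  set r₀ : ℝ := min 1 (min r₁ (min r₂ r₃)) with hr₀
  have hr₀pos : 0 < r₀ := lt_min one_pos (lt_min hr₁ (lt_min hr₂ hr₃))
  have hr₀1 : r₀ ≤ 1 := min_le_left _ _
  have hr₀₁ : r₀ ≤ r₁ := (min_le_right _ _).trans (min_le_left _ _)
  have hr₀₂ : r₀ ≤ r₂ := (min_le_right _ _).trans ((min_le_right _ _).trans (min_le_left _ _))
  have hr₀₃ : r₀ ≤ r₃ := (min_le_right _ _).trans ((min_le_right _ _).trans (min_le_right _ _))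
  have hanΦ : ∀ b ∈ B₁ ×ˢ (B₂ ×ˢ B₃), ∀ t : ℂ, ‖t‖ < r₀ →
      AnalyticAt ℂ (Φ₁f b) t ∧ AnalyticAt ℂ (Φ₂f b) t ∧ AnalyticAt ℂ (Φ₃f b) t := by
    intro b hb t ht
    simp only [Finset.mem_product] at hb
    obtain ⟨hy₁, hy₂, hy₃⟩ := hb
    exact ⟨analyticAt_rescale (hB₁ _ hy₁) hr₀1 hr₀₁ hm₁pos _ ht,
      analyticAt_rescale (hB₂ _ hy₂) hr₀1 hr₀₂ hm₂pos _ ht,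
      analyticAt_rescale (hB₃ _ hy₃) hr₀1 hr₀₃ hm₃pos _ ht⟩
  -- the points of a class lie on its branch, at the principal root
  have hpt : ∀ b, ∀ x ∈ U b, ρt x ≠ 0 →
      Sum.elim x (Complex.exp ∘ x) = 𝔟[e, Nf b, Φ₁f b, Φ₂f b, Φ₃f b, ρt x] := by
    rintro b x ⟨hx1, hx2, hx3⟩ ht0
    funext k
    rcases k with k | k <;> fin_cases k
    · simp only [Sum.elim_inl, Fin.zero_eta, Fin.isValue, Matrix.cons_val_zero]
      rw [hρt, inv_inv]
    · simp only [Sum.elim_inl, Fin.mk_one, Fin.isValue, Matrix.cons_val_one, Matrix.cons_val_zero]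
      rw [hx1, div_pow_eq_rescale ht0 (hN₁ b)]
    · simp only [Sum.elim_inr, Function.comp_apply, Fin.zero_eta, Fin.isValue,
        Matrix.cons_val_zero]
      rw [hx2, div_pow_eq_rescale ht0 (hN₂ b)]
    · simp only [Sum.elim_inr, Function.comp_apply, Fin.mk_one, Fin.isValue, Matrix.cons_val_one,
        Matrix.cons_val_zero]
      rw [hx3, div_pow_eq_rescale ht0 (hN₃ b)]
  -- ### the branch of an infinite class lies in `W`
  have hW : ∀ b ∈ Bi, ∃ δ > 0, ∀ t : ℂ, 0 < ‖t‖ → ‖t‖ < δ →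
      𝔟[e, Nf b, Φ₁f b, Φ₂f b, Φ₃f b, t] ∈ W := by
    intro b hb
    obtain ⟨hbS, hinfb⟩ := Finset.mem_filter.1 hb
    have h0 : ‖(0 : ℂ)‖ < r₀ := by rw [norm_zero]; exact hr₀pos
    obtain ⟨ha₁, ha₂, ha₃⟩ := hanΦ b hbS 0 h0
    refine cosetBranchCover_branch_mem_of_forall_exists hcl ha₁ ha₂ ha₃ fun ε hε => ?_
    obtain ⟨x, hxT, hxε⟩ := (hunb b hinfb (ε⁻¹ ^ e)).nonempty
    obtain ⟨hx0, hlt⟩ := ne_zero_and_norm_lt_of_pow_eq_inv he hε (hρt x) hxε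
    refine ⟨ρt x, norm_pos_iff.2 hx0, hlt, ?_⟩
    rw [← hpt b x hxT.2.2.2 hx0]
    exact hxT.1.2
  choose! δ hδpos hδW using hW
  set δ₀ : ℝ := if hBi0 : Bi.Nonempty then Bi.inf' hBi0 δ else 1 with hδ₀
  have hδ₀pos : 0 < δ₀ := by
    rw [hδ₀]; split_ifs with hBi0
    · exact (Finset.lt_inf'_iff hBi0).2 fun b hb => hδpos b hb
    · exact one_pos
  have hδ₀le : ∀ b ∈ Bi, δ₀ ≤ δ b := fun b hb => by
    rw [hδ₀, dif_pos ⟨b, hb⟩]; exact Finset.inf'_le _ hb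
  -- ### the radii and the cover
  set r : ℝ := min r₀ δ₀ with hr
  have hrpos : 0 < r := lt_min hr₀pos hδ₀pos
  set R : ℝ := max R₀ (r⁻¹ ^ e) with hR
  refine ⟨e, R, r, Bi.image (fun b => (Φ₁f b, Φ₂f b, Φ₃f b, Nf b)), X, he, hrpos, hXfin,
    ?_, ?_⟩
  · -- the branches are analytic on `‖t‖ < r` and lie in `W` on `0 < ‖t‖ < r`
    intro b' hb'
    obtain ⟨b, hb, rfl⟩ := Finset.mem_image.1 hb'
    have hbS : b ∈ B₁ ×ˢ (B₂ ×ˢ B₃) := (Finset.mem_filter.1 hb).1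
    exact ⟨fun t ht => hanΦ b hbS t (ht.trans_le (min_le_left _ _)), fun t ht0 htr =>
      hδW b hb t ht0 (htr.trans_le ((min_le_right _ _).trans (hδ₀le b hb)))⟩
  · -- every large coset point outside `X` lies on a branch of an infinite class
    intro x hx hk hRx hxX
    have hR₀x : R₀ < ‖x 0‖ := lt_of_le_of_lt (le_max_left _ _) hRx
    obtain ⟨b, hbS, hxU⟩ := hcov x hx hR₀x
    have hxT : x ∈ Tc b := ⟨hx, hk, hR₀x, hxU⟩
    have hb : b ∈ Bi := by
      refine Finset.mem_filter.2 ⟨hbS, fun hfin => hxX ?_⟩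
      exact Set.mem_biUnion (Finset.mem_coe.2 (Finset.mem_filter.2 ⟨hbS, hfin⟩)) hxT
    obtain ⟨h0, hlt⟩ := ne_zero_and_norm_lt_of_pow_eq_inv he hrpos (hρt x)
      (lt_of_le_of_lt (le_max_right _ _) hRx)
    exact ⟨_, Finset.mem_image_of_mem _ hb, norm_pos_iff.2 h0, hlt, hpt b x hxU h0⟩

end Summit.Schanuel.Schanuel.Cruxes.MinimalCounterexampleInAcl.KernelArithmeticSelection

end

-- ======== segment: work/stubs/stub_selectorOneSided.lean ========
/-!
# The ONE-SIDED COSET SELECTOR — crux stmt-Schanuel-0969 `RigidCore.MinimalCounterexampleInAcl`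

Line `kernel-arithmetic-selection` (gen 12), `--supports stmt-Schanuel-0969`, stub `stub_selectorOneSided`.

Let `E ⊆ ℂ` be `∅`-definable in `ℂ_exp = (ℂ, +, ·, −, 0, 1, exp)` with `exp '' E` finite (so `E` lies on
finitely many cosets of the kernel `2πiℤ`), and let `u ∈ E`.  If the hit set `K = {k : ℤ | u + 2πik ∈ E}` of
`u`'s coset is bounded below or bounded above, then `u ∈ acl^{ℂ_exp}(∅) = expAcl`.

Proof.  `ℂ_exp` sees the ORDER of `ℤ` on its kernel: `ℤ` (`intSet`) and the kernel generators `{±2πi}`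
(`kerGenSet`) are `∅`-definable (Kirby–Macintyre–Onshuus 2012, §2), and `0 ≤ m ⟺ m` is a sum of four squares
of integers (Lagrange).  Hence the SELECTOR
`S = {s ∈ E | ∃ t ∈ {±2πi}, ∀ m ∈ ℤ, s + tm ∈ E → 0 ≤ m}` ("no point of `E` strictly before `s` on its coset,
in direction `t`") is `∅`-definable (`definable₁_selector`); it has at most one point per coset and sign (two
such points differ by `tm` with `0 ≤ m` and `0 ≤ −m`; `selector_subsingleton`), so it is finite
(`selector_finite`); and it contains `u + 2πi · min K` with `t = 2πi` (resp. `u + 2πi · max K` with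
`t = −2πi`).  Since `expAcl` is closed under `+`, `·`, `−` and contains `2πi` and `ℤ`, `u ∈ expAcl`.

References: [KirbyMacintyreOnshuus2012] J. Kirby, A. Macintyre, A. Onshuus, *The algebraic numbers definable
in various exponential fields*, J. Inst. Math. Jussieu 11 (2012) 825–834, §2 (`ℤ`, `±2πi` parameter-free
definable); [Marker2002] D. Marker, *Model Theory: An Introduction*, GTM 217, §1.3 (`acl`).
-/

noncomputable section

set_option linter.dupNamespace false

open Set FirstOrder

namespace Summit.Schanuel.Schanuel.Cruxes.MinimalCounterexampleInAcl.KernelArithmeticSelection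

open Literature.ModelTheory.ExponentialFields
open Summit.Schanuel.Schanuel.Theorems.AclSubsetLogFreeCore.Negative

/-- Lagrange inside `ℂ_exp`: an integer `n` is a sum of four squares of elements of `intSet = ℤ` iff
`0 ≤ n` (`Nat.sum_four_squares`). [folklore] -/
theorem intCast_fourSquares_iff (n : ℤ) :
    (∃ a, a ∈ intSet ∧ ∃ b, b ∈ intSet ∧ ∃ c, c ∈ intSet ∧ ∃ d, d ∈ intSet ∧
      (n : ℂ) = a * a + b * b + c * c + d * d) ↔ 0 ≤ n := by
  constructor
  · rintro ⟨a, ha, b, hb, c, hc, d, hd, h⟩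
    obtain ⟨a, rfl⟩ := mem_intSet_iff.1 ha
    obtain ⟨b, rfl⟩ := mem_intSet_iff.1 hb
    obtain ⟨c, rfl⟩ := mem_intSet_iff.1 hc
    obtain ⟨d, rfl⟩ := mem_intSet_iff.1 hd
    have h' : n = a * a + b * b + c * c + d * d := by exact_mod_cast h
    rw [h']
    nlinarith [mul_self_nonneg a, mul_self_nonneg b, mul_self_nonneg c, mul_self_nonneg d]
  · intro hn
    obtain ⟨a, b, c, d, h⟩ := Nat.sum_four_squares n.toNat
    refine ⟨a, mem_intSet_iff.2 ⟨a, by simp⟩, b, mem_intSet_iff.2 ⟨b, by simp⟩,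
      c, mem_intSet_iff.2 ⟨c, by simp⟩, d, mem_intSet_iff.2 ⟨d, by simp⟩, ?_⟩
    have h1 : ((n.toNat : ℕ) : ℤ) = n := Int.toNat_of_nonneg hn
    have h2 : (n : ℂ) = ((n.toNat : ℕ) : ℂ) := by rw [← Int.cast_natCast, h1]
    rw [h2, ← h]
    push_cast
    ring

/-- The one-sided selector `S = {s ∈ E | ∃ t ∈ {±2πi}, ∀ m ∈ ℤ, s + tm ∈ E → m ∈ ℕ}` (with `ℕ ⊆ ℤ` cut out by
four squares) is `∅`-definable in `ℂ_exp` whenever `E` is. [cite: KirbyMacintyreOnshuus2012, §2] -/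
theorem definable₁_selector {E : Set ℂ} (hE : Set.Definable₁ (∅ : Set ℂ) Language.expRing E) :
    Set.Definable₁ (∅ : Set ℂ) Language.expRing
      {s : ℂ | s ∈ E ∧ ∃ t, t ∈ kerGenSet ∧ ∀ m, m ∈ intSet → s + t * m ∈ E →
        ∃ a, a ∈ intSet ∧ ∃ b, b ∈ intSet ∧ ∃ c, c ∈ intSet ∧ ∃ d, d ∈ intSet ∧
          m = a * a + b * b + c * c + d * d} := by
  have h : (∅ : Set ℂ).Definable Language.expRing
      {v : Fin 1 → ℂ | v 0 ∈ E ∧ ∃ t, t ∈ kerGenSet ∧ ∀ m, m ∈ intSet → v 0 + t * m ∈ E →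
        ∃ a, a ∈ intSet ∧ ∃ b, b ∈ intSet ∧ ∃ c, c ∈ intSet ∧ ∃ d, d ∈ intSet ∧
          m = a * a + b * b + c * c + d * d} := by
    refine definable_setOf_and_params ?_ ?_
    · exact definable_mem_of_definable₁ hE (definableFun_proj_params _)
    · refine definable_setOf_exists_params (definable_setOf_and_params ?_ ?_)
      · exact definable_mem_kerGenSet (definableFun_proj_params _)
      · refine definable_setOf_forall_params
          (definable_setOf_imp_params ?_ (definable_setOf_imp_params ?_ ?_))
        · exact definable_mem_intSet (definableFun_proj_params _)
        · exact definable_mem_of_definable₁ hE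
            (definableFun_add' (definableFun_proj_params _)
              (definableFun_mul' (definableFun_proj_params _) (definableFun_proj_params _)))
        · refine definable_setOf_exists_params (definable_setOf_and_params ?_ ?_)
          · exact definable_mem_intSet (definableFun_proj_params _)
          · refine definable_setOf_exists_params (definable_setOf_and_params ?_ ?_)
            · exact definable_mem_intSet (definableFun_proj_params _)
            · refine definable_setOf_exists_params (definable_setOf_and_params ?_ ?_)
              · exact definable_mem_intSet (definableFun_proj_params _)
              · refine definable_setOf_exists_params (definable_setOf_and_params ?_ ?_)
                · exact definable_mem_intSet (definableFun_proj_params _)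
                · exact definable_setOf_eq_params (definableFun_proj_params _)
                    (definableFun_add'
                      (definableFun_add'
                        (definableFun_add'
                          (definableFun_mul' (definableFun_proj_params _)
                            (definableFun_proj_params _))
                          (definableFun_mul' (definableFun_proj_params _)
                            (definableFun_proj_params _)))
                        (definableFun_mul' (definableFun_proj_params _)
                          (definableFun_proj_params _)))
                      (definableFun_mul' (definableFun_proj_params _)
                        (definableFun_proj_params _)))
  unfold Set.Definable₁
  exact h

/-- On one coset of the kernel and for one sign `t ∈ {±2πi}`, at most one point `s ∈ E` has no point of `E`
strictly before it in direction `t`: two such points differ by `t·n` with `0 ≤ n` and `0 ≤ -n`. [folklore] -/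
theorem selector_subsingleton {E : Set ℂ} {r t : ℂ} (ht : t ∈ kerGenSet) :
    Set.Subsingleton {s : ℂ | s ∈ E ∧ Complex.exp s = r ∧ ∀ n : ℤ, s + t * n ∈ E → 0 ≤ n} := by
  rintro s₁ ⟨h1E, h1r, h1⟩ s₂ ⟨h2E, h2r, h2⟩
  obtain ⟨-, htgen⟩ : Complex.exp t = 1 ∧
      ∀ w : ℂ, Complex.exp w = 1 → ∃ m : ℂ, m ∈ intSet ∧ w = m * t := ht
  have hexp : Complex.exp (s₂ - s₁) = 1 := by
    rw [Complex.exp_sub, h1r, h2r]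
    exact div_self (h1r ▸ Complex.exp_ne_zero s₁)
  obtain ⟨m, hm, hms⟩ := htgen _ hexp
  obtain ⟨n, rfl⟩ := mem_intSet_iff.1 hm
  have hn : 0 ≤ n := h1 n (by
    rw [show s₁ + t * (n : ℂ) = s₂ by linear_combination -hms]
    exact h2E)
  have hn' : 0 ≤ -n := h2 (-n) (by
    rw [show s₂ + t * ((-n : ℤ) : ℂ) = s₁ by push_cast; linear_combination hms]
    exact h1E)
  have hn0 : (n : ℂ) = 0 := by exact_mod_cast (show n = 0 by omega)
  rw [hn0, zero_mul, sub_eq_zero] at hms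
  exact hms.symm

/-- The one-sided selector of a set `E` lying on finitely many cosets of the kernel (`exp '' E` finite) is
FINITE: it is covered by the subsingletons of `selector_subsingleton`, indexed by `exp '' E × {±2πi}`.
[folklore] -/
theorem selector_finite {E : Set ℂ} (hEfin : (Complex.exp '' E).Finite) :
    Set.Finite {s : ℂ | s ∈ E ∧ ∃ t, t ∈ kerGenSet ∧ ∀ m, m ∈ intSet → s + t * m ∈ E →
        ∃ a, a ∈ intSet ∧ ∃ b, b ∈ intSet ∧ ∃ c, c ∈ intSet ∧ ∃ d, d ∈ intSet ∧
          m = a * a + b * b + c * c + d * d} := by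
  have hker : (kerGenSet : Set ℂ).Finite := by
    refine ((Set.finite_singleton (-(2 * ↑Real.pi * Complex.I : ℂ))).insert
      (2 * ↑Real.pi * Complex.I)).subset ?_
    intro t ht
    rcases mem_kerGenSet_iff.1 ht with h | h
    · exact Or.inl h
    · exact Or.inr h
  refine ((hEfin.biUnion (t := fun r => ⋃ t ∈ kerGenSet,
      {s : ℂ | s ∈ E ∧ Complex.exp s = r ∧ ∀ n : ℤ, s + t * n ∈ E → 0 ≤ n})
    fun r _ => hker.biUnion fun t ht => (selector_subsingleton ht).finite).subset ?_)
  rintro s ⟨hsE, t, ht, hsel⟩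
  simp only [Set.mem_iUnion, Set.mem_setOf_eq]
  exact ⟨Complex.exp s, ⟨s, hsE, rfl⟩, t, ht, hsE, rfl, fun n hn =>
    (intCast_fourSquares_iff n).1 (hsel n (mem_intSet_iff.2 ⟨n, rfl⟩) hn)⟩

/-- **ONE-SIDED COSET SELECTOR.**  Let `E ⊆ ℂ` be `∅`-definable in `ℂ_exp` with `exp '' E` finite and
`u ∈ E`.  If the hit set `K = {k : ℤ | u + 2πik ∈ E}` of `u`'s coset is bounded below or above, then
`u ∈ acl^{ℂ_exp}(∅)`: the finite `∅`-definable selector (`definable₁_selector`, `selector_finite`) contains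
`u + 2πi · min K` (direction `t = 2πi`), resp. `u + 2πi · max K` (direction `t = -2πi`), and `acl(∅)` is closed
under `+`, `·`, `−` and contains `2πi`, `ℤ`. [cite: KirbyMacintyreOnshuus2012, §2] -/
theorem stub_selectorOneSided : ∀ (E : Set ℂ) (u : ℂ), Set.Definable₁ (∅ : Set ℂ) Literature.ModelTheory.ExponentialFields.Language.expRing E → (Complex.exp '' E).Finite → u ∈ E → (BddBelow {k : ℤ | u + 2 * ↑Real.pi * Complex.I * (k : ℂ) ∈ E} ∨ BddAbove {k : ℤ | u + 2 * ↑Real.pi * Complex.I * (k : ℂ) ∈ E}) → u ∈ Summit.Schanuel.Schanuel.Theorems.AclSubsetLogFreeCore.Negative.expAcl := by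
  intro E u hE hEfin huE hK
  -- a point of `E` with no point of `E` strictly before it (direction `t`) is selected, hence in `acl(∅)`
  have hsel : ∀ s t : ℂ, s ∈ E → t ∈ kerGenSet → (∀ n : ℤ, s + t * n ∈ E → 0 ≤ n) → s ∈ expAcl := by
    intro s t hsE ht hmin
    refine ⟨_, selector_finite hEfin, definable₁_selector hE, hsE, t, ht, fun m hm hmE => ?_⟩
    obtain ⟨n, rfl⟩ := mem_intSet_iff.1 hm
    exact (intCast_fourSquares_iff n).2 (hmin n hmE)
  -- the extremal hit of `u`'s coset
  have hK0 : (0 : ℤ) ∈ {k : ℤ | u + 2 * ↑Real.pi * Complex.I * (k : ℂ) ∈ E} := by simpa using huE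
  obtain ⟨s, t, k, hsE, ht, hmin, hu⟩ : ∃ (s t : ℂ) (k : ℤ), s ∈ E ∧ t ∈ kerGenSet ∧
      (∀ n : ℤ, s + t * n ∈ E → 0 ≤ n) ∧ u = s + -(2 * ↑Real.pi * Complex.I) * (k : ℂ) := by
    rcases hK with hbdd | hbdd
    · have hk := Int.csInf_mem ⟨0, hK0⟩ hbdd
      refine ⟨_, 2 * ↑Real.pi * Complex.I, _, hk, mem_kerGenSet_iff.2 (Or.inl rfl), fun n hn => ?_,
        by ring⟩
      have hmem : sInf {k : ℤ | u + 2 * ↑Real.pi * Complex.I * (k : ℂ) ∈ E} + n ∈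
          {k : ℤ | u + 2 * ↑Real.pi * Complex.I * (k : ℂ) ∈ E} := by
        simp only [Set.mem_setOf_eq, Int.cast_add]
        convert hn using 1
        ring
      have := csInf_le hbdd hmem
      omega
    · have hk := Int.csSup_mem ⟨0, hK0⟩ hbdd
      refine ⟨_, -(2 * ↑Real.pi * Complex.I), _, hk, mem_kerGenSet_iff.2 (Or.inr rfl), fun n hn => ?_,
        by ring⟩
      have hmem : sSup {k : ℤ | u + 2 * ↑Real.pi * Complex.I * (k : ℂ) ∈ E} - n ∈
          {k : ℤ | u + 2 * ↑Real.pi * Complex.I * (k : ℂ) ∈ E} := by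
        simp only [Set.mem_setOf_eq, Int.cast_sub]
        convert hn using 1
        ring
      have := le_csSup hbdd hmem
      omega
  rw [hu]
  exact add_mem_expAcl (hsel s t hsE ht hmin)
    (mul_mem_expAcl (neg_mem_expAcl two_pi_I_mem_expAcl) (intCast_mem_expAcl k))

end Summit.Schanuel.Schanuel.Cruxes.MinimalCounterexampleInAcl.KernelArithmeticSelection

end


-- ======== segment: work/stubs/stub_selectorWindow.lean ========
/-!
# The WINDOW SELECTOR for (S*) — crux stmt-Schanuel-0969 `RigidCore.MinimalCounterexampleInAcl`

Line `kernel-arithmetic-selection`, stub `stub_selectorWindow` (gen 12 window selector),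
`--supports stmt-Schanuel-0969`.

Let `E ⊆ ℂ` be `∅`-definable in `ℂ_exp = (ℂ, +, ·, −, 0, 1, exp)` and let `G ⊆ ℤ` be a finite
"translate pattern".  The set of WINDOW POSITIONS
`S = {s | ∃ t ∈ {±2πi}, ∀ g ∈ G, s + t·g ∈ E}`
is `∅`-definable (the kernel generators `±2πi` are `∅`-definable, Kirby–Macintyre–Onshuus 2012
§2.3, tree `definable_mem_kerGenSet`; integer numerals are terms), and it is contained in the
union of the two one-signed pattern sets `{s | ∀ g ∈ G, s + 2πi g ∈ E}`,
`{s | ∀ g ∈ G, s − 2πi g ∈ E}`.  Hence, if both of these are finite, `S` is a finite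
`∅`-definable set, so `S ⊆ acl^{ℂ_exp}(∅) = expAcl`; if the pattern occurs at `u + 2πi k₀`
(`u + 2πi (k₀ + g) ∈ E` for `g ∈ G`) then `u + 2πi k₀ ∈ S ⊆ acl(∅)` and, `acl(∅)` being a
subring of `ℂ` containing `2πi` and `ℤ` (tree `ExpAclField`), `u ∈ acl(∅)`.

This is the selector used in the mixed sector of the rank-2 case of (S*): `acl`-membership of a
coordinate is obtained WITHOUT finiteness of the mate set, from finite recurrence of a window of
hits on the coset `u + 2πiℤ`.

## References

* [KirbyMacintyreOnshuus2012] J. Kirby, A. Macintyre, A. Onshuus, *The algebraic numbers definable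
  in various exponential fields*, J. Inst. Math. Jussieu 11 (2012) 825–834, arXiv:1101.4224, §2.3
  (`±2πi` is `∅`-definable in any exponential field with cyclic kernel).
* [Marker2002] D. Marker, *Model Theory: An Introduction*, Springer GTM 217, §1.3 (`acl`).
-/

noncomputable section

set_option linter.dupNamespace false

open Complex Set FirstOrder

namespace Summit.Schanuel.Schanuel.Cruxes.MinimalCounterexampleInAcl.KernelArithmeticSelection

open Literature.ModelTheory.ExponentialFields
open Summit.Schanuel.Schanuel.Theorems.AclSubsetLogFreeCore.Negative

/-- The window-position set `{s | ∃ t ∈ {±2πi}, ∀ g ∈ G, s + t·g ∈ E}` lies in the union of the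
two one-signed pattern sets (the kernel generators are exactly `±2πi`, KMO 2012 §2.3, tree
`mem_kerGenSet_iff`). [cite: KirbyMacintyreOnshuus2012, §2] -/
theorem windowSet_subset_union (E : Set ℂ) (G : Finset ℤ) :
    {s : ℂ | ∃ t : ℂ, t ∈ kerGenSet ∧ ∀ g ∈ G, s + t * (g : ℂ) ∈ E} ⊆
      {s : ℂ | ∀ g ∈ G, s + 2 * ↑Real.pi * Complex.I * (g : ℂ) ∈ E} ∪
        {s : ℂ | ∀ g ∈ G, s - 2 * ↑Real.pi * Complex.I * (g : ℂ) ∈ E} := by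
  rintro s ⟨t, ht, hs⟩
  rcases mem_kerGenSet_iff.1 ht with rfl | rfl
  · exact Or.inl hs
  · refine Or.inr fun g hg => ?_
    have h := hs g hg
    rwa [neg_mul, ← sub_eq_add_neg] at h

/-- The window-position set of an `∅`-definable `E ⊆ ℂ` is `∅`-definable: `t ∈ {±2πi}` is a
parameter-free first-order condition (KMO 2012 §2.3, tree `definable_mem_kerGenSet`) and the
pattern condition is a finite conjunction of atoms `s + t·g ∈ E` with integer numerals `g`.
[cite: KirbyMacintyreOnshuus2012, §2] -/
theorem definable₁_windowSet {E : Set ℂ}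
    (hE : Set.Definable₁ (∅ : Set ℂ) Language.expRing E) (G : Finset ℤ) :
    Set.Definable₁ (∅ : Set ℂ) Language.expRing
      {s : ℂ | ∃ t : ℂ, t ∈ kerGenSet ∧ ∀ g ∈ G, s + t * (g : ℂ) ∈ E} := by
  have hd : (∅ : Set ℂ).Definable Language.expRing
      {v : Fin 1 → ℂ | ∃ t : ℂ, t ∈ kerGenSet ∧ ∀ g ∈ G, v 0 + t * (g : ℂ) ∈ E} := by
    refine definable_setOf_exists_params (definable_setOf_and_params ?_ ?_)
    · exact definable_mem_kerGenSet (definableFun_proj_params _)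
    · have hG : (∅ : Set ℂ).Definable Language.expRing
          (⋂ g ∈ G, {w : Fin 1 ⊕ Unit → ℂ | w (Sum.inl 0) + w (Sum.inr ()) * (g : ℂ) ∈ E}) :=
        Set.definable_biInter_finset (fun g => definable_mem_of_definable₁ hE
          (definableFun_add' (definableFun_proj_params _)
            (definableFun_mul' (definableFun_proj_params _) (definableFun_intCast' g)))) G
      convert hG using 1
      ext w
      simp only [Set.mem_setOf_eq, Set.mem_iInter]
  have e : {x : Fin 1 → ℂ | x 0 ∈ {s : ℂ | ∃ t : ℂ, t ∈ kerGenSet ∧ ∀ g ∈ G, s + t * (g : ℂ) ∈ E}} =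
      {v : Fin 1 → ℂ | ∃ t : ℂ, t ∈ kerGenSet ∧ ∀ g ∈ G, v 0 + t * (g : ℂ) ∈ E} := rfl
  unfold Set.Definable₁
  rw [e]
  exact hd

/-- **Stub S2 — THE WINDOW SELECTOR (gen 12).**  If `E ⊆ ℂ` is `∅`-definable in `ℂ_exp`, the
finite pattern `G ∋ 0` occurs in `E` at `u + 2πi k₀` (`u + 2πi (k₀ + g) ∈ E` for all `g ∈ G`),
and both one-signed pattern sets `{s | ∀ g ∈ G, s ± 2πi g ∈ E}` are finite, then
`u ∈ acl^{ℂ_exp}(∅)`: the window-position set is a finite `∅`-definable set containing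
`u + 2πi k₀`, and `acl(∅)` is a subring containing `2πi` and `ℤ`. [cite: KirbyMacintyreOnshuus2012, §2] -/
theorem stub_selectorWindow : ∀ (E : Set ℂ) (u : ℂ) (G : Finset ℤ) (k₀ : ℤ), Set.Definable₁ (∅ : Set ℂ) Literature.ModelTheory.ExponentialFields.Language.expRing E → (0 : ℤ) ∈ G → (∀ g ∈ G, u + 2 * ↑Real.pi * Complex.I * ((k₀ + g : ℤ) : ℂ) ∈ E) → Set.Finite {s : ℂ | ∀ g ∈ G, s + 2 * ↑Real.pi * Complex.I * (g : ℂ) ∈ E} → Set.Finite {s : ℂ | ∀ g ∈ G, s - 2 * ↑Real.pi * Complex.I * (g : ℂ) ∈ E} → u ∈ Summit.Schanuel.Schanuel.Theorems.AclSubsetLogFreeCore.Negative.expAcl := by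
  intro E u G k₀ hE _ hwin hfinP hfinN
  -- the window-position set is a finite `∅`-definable set containing `u + 2πi k₀`
  have hmem : u + 2 * ↑Real.pi * Complex.I * (k₀ : ℂ) ∈
      {s : ℂ | ∃ t : ℂ, t ∈ kerGenSet ∧ ∀ g ∈ G, s + t * (g : ℂ) ∈ E} := by
    refine ⟨2 * ↑Real.pi * Complex.I, mem_kerGenSet_iff.2 (Or.inl rfl), fun g hg => ?_⟩
    have e : u + 2 * ↑Real.pi * Complex.I * (k₀ : ℂ) + 2 * ↑Real.pi * Complex.I * (g : ℂ) =
        u + 2 * ↑Real.pi * Complex.I * ((k₀ + g : ℤ) : ℂ) := by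
      push_cast; ring
    rw [e]
    exact hwin g hg
  have h1 : u + 2 * ↑Real.pi * Complex.I * (k₀ : ℂ) ∈ expAcl :=
    ⟨_, (hfinP.union hfinN).subset (windowSet_subset_union E G), definable₁_windowSet hE G,
      hmem⟩
  have h2 : -(2 * ↑Real.pi * Complex.I * (k₀ : ℂ)) ∈ expAcl :=
    neg_mem_expAcl (mul_mem_expAcl two_pi_I_mem_expAcl (intCast_mem_expAcl k₀))
  have h3 := add_mem_expAcl h1 h2
  rwa [add_neg_cancel_right] at h3

end Summit.Schanuel.Schanuel.Cruxes.MinimalCounterexampleInAcl.KernelArithmeticSelection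

end


-- ======== segment: work/stubs/stub_mixedBridge.lean ========
/-!
# The MIXED-SECTOR BRIDGE for (S*) — crux stmt-Schanuel-0969 `RigidCore.MinimalCounterexampleInAcl`

Line `kernel-arithmetic-selection`, stub `stub_mixedBridge` (gen 12 mixed-sector bridge),
`--supports stmt-Schanuel-0969`.

For a tuple `x : Fin n → ℂ` and an integer vector `M : Fin n → ℤ` put
`E = {Σᵢ Mᵢ x'ᵢ : x' ∈ locusMates x}`, the set of values of the integer combination `M` on the
MATES of `x` (the ℚ-linearly independent tuples `x'` such that `(x', e^{x'})` satisfies every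
ℚ-polynomial relation of `(x, eˣ)`).  Two structural facts about `E`, for EVERY `x` and `M`:

* `E` is `∅`-definable in `ℂ_exp = (ℂ, +, ·, −, 0, 1, exp)` (`intCombo_locusMates_definable₁`):
  it is the projection to the first coordinate of the `∅`-definable set
  `{(s, x') | x' ∈ locusMates x ∧ s = Σᵢ Mᵢ x'ᵢ}` (the mate set is `∅`-definable, tree
  `locusMates_definable`; integer numerals are terms; `Set.Definable.exists_of_finite`).
* If `e^{Σ Mᵢxᵢ}` is algebraic, a root of `p ∈ ℚ[T] ∖ 0`, then `exp '' E ⊆ {roots of p}` is finite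
  (`cexp_image_intCombo_locusMates_finite`): writing `M = M⁺ − M⁻` with `M± ≥ 0`, the
  HOMOGENISED relation `R = Σⱼ pⱼ · (∏ Yᵢ^{M⁺ᵢ})ʲ · (∏ Yᵢ^{M⁻ᵢ})^{d−j} ∈ ℚ[X, Y]` (`d = deg p`)
  evaluates at any point `(z, eᶻ)` to `N_z^d · p(e^{Σ Mᵢzᵢ})` with `N_z = e^{Σ M⁻ᵢzᵢ} ≠ 0`
  (`aeval_expPoint_homogenised`), so `R` is a relation of `(x, eˣ)`, hence of every
  `(x', e^{x'})` with `x'` a mate, hence `p(e^{Σ Mᵢx'ᵢ}) = 0`.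

The registered stub `stub_mixedBridge` is the case `n = 2`.  In the line these feed the coset
selectors on `E` (the mixed sector of the rank-2 case of (S*)).

## References

* [Marker2002] D. Marker, *Model Theory: An Introduction*, Springer GTM 217, §1.3 (definable sets
  are closed under projections and Boolean combinations).
* [Lang1966] S. Lang, *Introduction to transcendental numbers*, Addison–Wesley 1966, Ch. II §1
  (specialisation of polynomial relations; conjugates of an algebraic value are roots of the same
  rational polynomial).
-/

noncomputable section

set_option linter.dupNamespace false

open Complex Set FirstOrder Polynomial

namespace Summit.Schanuel.Schanuel.Cruxes.MinimalCounterexampleInAcl.KernelArithmeticSelection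

open Literature.ModelTheory.ExponentialFields
open Summit.Schanuel.Schanuel.Theorems.AclSubsetLogFreeCore.Negative

variable {n : ℕ}

/-! ## Definability of `E` -/

/-- Finite sums of definable functions are definable functions (in `ℂ_exp`, any parameter set).
[folklore] -/
theorem definableFun_finsetSum {α ι : Type*} {A : Set ℂ} (s : Finset ι) {g : ι → (α → ℂ) → ℂ}
    (hg : ∀ i ∈ s, A.DefinableFun Language.expRing (g i)) :
    A.DefinableFun Language.expRing (fun v => ∑ i ∈ s, g i v) := by
  classical
  induction s using Finset.induction_on with
  | empty => simpa using (definableFun_zero' (A := A) (α := α))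
  | insert a s ha ih =>
    have h := definableFun_add' (hg a (Finset.mem_insert_self a s))
      (ih fun i hi => hg i (Finset.mem_insert_of_mem hi))
    simpa [Finset.sum_insert ha] using h

/-- The set `{(s, x') | x' ∈ locusMates x ∧ s = Σᵢ Mᵢ x'ᵢ}` (coordinates `Fin 1 ⊕ Fin n`) is
`∅`-definable in `ℂ_exp`. [folklore] -/
theorem intCombo_graph_locusMates_definable (x : Fin n → ℂ) (M : Fin n → ℤ) :
    (∅ : Set ℂ).Definable Language.expRing
      {w : Fin 1 ⊕ Fin n → ℂ | w ∘ Sum.inr ∈ locusMates x ∧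
        w (Sum.inl 0) = ∑ i, (M i : ℂ) * w (Sum.inr i)} := by
  refine definable_setOf_and_params ?_ ?_
  · exact (locusMates_definable x).preimage_comp Sum.inr
  · exact definable_setOf_eq_params (definableFun_proj_params _)
      (definableFun_finsetSum _ fun i _ =>
        definableFun_mul' (definableFun_intCast' _) (definableFun_proj_params _))

/-- **`E = {Σᵢ Mᵢ x'ᵢ : x' ∈ locusMates x}` is `∅`-definable in `ℂ_exp`**, for every tuple `x`
and integer vector `M` (projection of `intCombo_graph_locusMates_definable`). [folklore] -/
theorem intCombo_locusMates_definable₁ (x : Fin n → ℂ) (M : Fin n → ℤ) :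
    Set.Definable₁ (∅ : Set ℂ) Language.expRing
      {s : ℂ | ∃ x' ∈ locusMates x, s = ∑ i, (M i : ℂ) * x' i} := by
  have h := (intCombo_graph_locusMates_definable x M).exists_of_finite
  unfold Set.Definable₁
  convert h using 1
  ext v
  simp only [mem_setOf_eq, Sum.elim_comp_inr, Sum.elim_inl, Sum.elim_inr]

/-! ## Finiteness of `exp '' E` -/

/-- `∏ᵢ (e^{zᵢ})^{M⁺ᵢ} = e^{Σ Mᵢzᵢ} · ∏ᵢ (e^{zᵢ})^{M⁻ᵢ}` for the splitting `M = M⁺ − M⁻`,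
`M⁺ᵢ = (Mᵢ).toNat`, `M⁻ᵢ = (−Mᵢ).toNat`. [folklore] -/
theorem prod_cexp_pow_toNat (M : Fin n → ℤ) (z : Fin n → ℂ) :
    ∏ i, cexp (z i) ^ (M i).toNat =
      cexp (∑ i, (M i : ℂ) * z i) * ∏ i, cexp (z i) ^ (-M i).toNat := by
  rw [Complex.exp_sum, ← Finset.prod_mul_distrib]
  refine Finset.prod_congr rfl fun i _ => ?_
  rw [Complex.exp_int_mul, ← zpow_natCast, ← zpow_natCast, ← zpow_add₀ (Complex.exp_ne_zero _)]
  congr 1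
  have := Int.toNat_sub_toNat_neg (M i)
  omega

/-- HOMOGENISATION IDENTITY: `Σ_{j ≤ d} pⱼ (wN)ʲ N^{d−j} = N^d · p(w)` for `deg p ≤ d`. [folklore] -/
theorem sum_coeff_mul_pow_eq {K : Type*} [CommRing K] [Algebra ℚ K] (p : ℚ[X]) {d : ℕ}
    (hd : p.natDegree ≤ d) (w N : K) :
    ∑ j ∈ Finset.range (d + 1), algebraMap ℚ K (p.coeff j) * (w * N) ^ j * N ^ (d - j) =
      N ^ d * Polynomial.aeval w p := by
  rw [Polynomial.aeval_eq_sum_range' (Nat.lt_succ_of_le hd), Finset.mul_sum]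
  refine Finset.sum_congr rfl fun j hj => ?_
  have hjd : j ≤ d := Nat.lt_succ_iff.1 (Finset.mem_range.1 hj)
  rw [Algebra.smul_def, mul_pow, ← pow_sub_mul_pow N hjd]
  ring

/-- THE HOMOGENISED RELATION. For `p ∈ ℚ[T]` of degree `≤ d` and `M : Fin n → ℤ`, the polynomial
`R = Σⱼ pⱼ (∏ Yᵢ^{M⁺ᵢ})ʲ (∏ Yᵢ^{M⁻ᵢ})^{d−j} ∈ ℚ[X, Y]` evaluates at the point `(z, eᶻ)` to
`N_z^d · p(e^{Σ Mᵢzᵢ})`, `N_z = ∏ᵢ (e^{zᵢ})^{M⁻ᵢ}`. [folklore] -/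
theorem aeval_expPoint_homogenised (p : ℚ[X]) {d : ℕ} (hd : p.natDegree ≤ d) (M : Fin n → ℤ)
    (z : Fin n → ℂ) :
    MvPolynomial.aeval (Sum.elim z (cexp ∘ z))
        (∑ j ∈ Finset.range (d + 1), MvPolynomial.C (p.coeff j) *
          (∏ i, MvPolynomial.X (Sum.inr i) ^ (M i).toNat) ^ j *
          (∏ i, MvPolynomial.X (Sum.inr i) ^ (-M i).toNat) ^ (d - j) :
            MvPolynomial (Fin n ⊕ Fin n) ℚ) =
      (∏ i, cexp (z i) ^ (-M i).toNat) ^ d * Polynomial.aeval (cexp (∑ i, (M i : ℂ) * z i)) p := by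
  have hP : MvPolynomial.aeval (Sum.elim z (cexp ∘ z))
      (∏ i, MvPolynomial.X (Sum.inr i) ^ (M i).toNat : MvPolynomial (Fin n ⊕ Fin n) ℚ) =
      ∏ i, cexp (z i) ^ (M i).toNat := by
    simp [map_prod]
  have hN : MvPolynomial.aeval (Sum.elim z (cexp ∘ z))
      (∏ i, MvPolynomial.X (Sum.inr i) ^ (-M i).toNat : MvPolynomial (Fin n ⊕ Fin n) ℚ) =
      ∏ i, cexp (z i) ^ (-M i).toNat := by
    simp [map_prod]
  rw [map_sum]
  simp only [map_mul, map_pow, MvPolynomial.aeval_C, hP, hN, prod_cexp_pow_toNat M z]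
  exact sum_coeff_mul_pow_eq p hd _ _

/-- **`exp '' E` IS FINITE when `e^{Σ Mᵢxᵢ}` is algebraic**: every `e^{Σ Mᵢx'ᵢ}`, `x'` a mate of
`x`, is a root of the (nonzero) rational polynomial annihilating `e^{Σ Mᵢxᵢ}`, because the
homogenised relation is a ℚ-polynomial relation of `(x, eˣ)` and mates satisfy all of those.
[folklore] -/
theorem cexp_image_intCombo_locusMates_finite (x : Fin n → ℂ) (M : Fin n → ℤ)
    (halg : IsAlgebraic ℚ (cexp (∑ i, (M i : ℂ) * x i))) :
    (cexp '' {s : ℂ | ∃ x' ∈ locusMates x, s = ∑ i, (M i : ℂ) * x' i}).Finite := by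
  obtain ⟨p, hp0, hpx⟩ := halg
  have hN : ∀ z : Fin n → ℂ, (∏ i, cexp (z i) ^ (-M i).toNat) ^ p.natDegree ≠ 0 := fun z =>
    pow_ne_zero _ (Finset.prod_ne_zero_iff.2 fun i _ => pow_ne_zero _ (Complex.exp_ne_zero _))
  refine (p.rootSet_finite ℂ).subset ?_
  rintro _ ⟨s, ⟨x', hx', rfl⟩, rfl⟩
  rw [Polynomial.mem_rootSet_of_ne hp0]
  have hRx := aeval_expPoint_homogenised p le_rfl M x
  rw [hpx, mul_zero] at hRx
  have h := hx'.2 _ hRx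
  rw [aeval_expPoint_homogenised p le_rfl M x'] at h
  exact (mul_eq_zero.1 h).resolve_left (hN x')

/-! ## The registered stub -/

/-- **Stub S3 — THE MIXED-SECTOR BRIDGE (registered stub `stub_mixedBridge`, PROVED).** For a pair
`x : Fin 2 → ℂ` and `M : Fin 2 → ℤ` with `e^{M₀x₀ + M₁x₁}` algebraic, the set
`E = {M₀x'₀ + M₁x'₁ : x' ∈ locusMates x}` of values of the combination on the mates of `x` is
`∅`-definable in `ℂ_exp` and has finitely many exponentials (all roots of the rational polynomial
annihilating `e^{M₀x₀ + M₁x₁}`).  No hypothesis on `x` (nor `M ≠ 0`) is needed. [folklore] -/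
theorem stub_mixedBridge : ∀ (x : Fin 2 → ℂ) (M : Fin 2 → ℤ), IsAlgebraic ℚ (Complex.exp (∑ i, (M i : ℂ) * x i)) → Set.Definable₁ (∅ : Set ℂ) Literature.ModelTheory.ExponentialFields.Language.expRing {s : ℂ | ∃ x' ∈ Summit.Schanuel.Schanuel.Cruxes.MinimalCounterexampleInAcl.KernelArithmeticSelection.locusMates x, s = ∑ i, (M i : ℂ) * x' i} ∧ (Complex.exp '' {s : ℂ | ∃ x' ∈ Summit.Schanuel.Schanuel.Cruxes.MinimalCounterexampleInAcl.KernelArithmeticSelection.locusMates x, s = ∑ i, (M i : ℂ) * x' i}).Finite := by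
  intro x M halg
  exact ⟨intCombo_locusMates_definable₁ x M, cexp_image_intCombo_locusMates_finite x M halg⟩

end Summit.Schanuel.Schanuel.Cruxes.MinimalCounterexampleInAcl.KernelArithmeticSelection

end

-- ======== segment: work/stubs/stub_glTwoReduction.lean ========
/-!
# `GL₂(ℤ)`-TRANSPORT OF RANK-2 FIRST FAILURES — crux stmt-Schanuel-0969 `RigidCore.MinimalCounterexampleInAcl`

Line `kernel-arithmetic-selection`, stub `stub_glTwoReduction` (gen 13 `GL₂(ℤ)` transport),
`--supports stmt-Schanuel-0969`.

For a rank-2 tuple `x = (x₀, x₁)` and an integer matrix `B = [[a, b], [−v, u]]` of determinant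
`a u + b v = 1` put `x̃ = B x = (a x₀ + b x₁, −v x₀ + u x₁)`; the inverse matrix is the INTEGER
matrix `[[u, −b], [v, a]]`, i.e. `x₀ = u x̃₀ − b x̃₁`, `x₁ = v x̃₀ + a x̃₁`.  Consequently

* `x̃` is ℚ-linearly independent iff `x` is;
* the fields `ℚ(x̃, e^{x̃})` and `ℚ(x, eˣ)` COINCIDE (as intermediate fields of `ℂ/ℚ`): the
  `x̃ᵢ` are integer combinations of the `xⱼ`, and `e^{x̃ᵢ}` are integer LAURENT monomials in the
  `e^{xⱼ}` (`e^{m p + n q} = (e^p)^m (e^q)^n`, `m n : ℤ`; intermediate fields are closed under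
  `zpow`), and conversely — so the transcendence degrees agree;
* if both `e^{x̃ᵢ}` are algebraic then so are both `e^{xⱼ}` (same Laurent monomials inside the
  intermediate field `ℚ̄ ∩ ℂ = algebraicClosure ℚ ℂ`), i.e. the log / off-log split is preserved;
* `x̃ ∈ acl(∅)² ⟹ x ∈ acl(∅)²`, since `acl^{ℂ_exp}(∅)` is a subring of `ℂ` containing `ℤ`
  (`add_mem_expAcl`, `mul_mem_expAcl`, `intCast_mem_expAcl`).

Hence `B` transports rank-2 first failures (`firstFailures 2`: ℚ-linearly independent,
`trdeg ℚ(x, eˣ) < 2`, Schanuel below rank 2) to rank-2 first failures, off-log ones to off-log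
ones, and pulls `acl`-membership back.  In the line this reduces the mixed sector of (S*)₂
(`e^{M·x} ∈ ℚ̄` for some `M ∈ ℤ² ∖ 0`) to the case `e^{x₀} ∈ ℚ̄` (primitive direction + Bézout).

## References

* [Lang1966] S. Lang, *Introduction to transcendental numbers*, Addison–Wesley 1966, Ch. II §1
  (invariance of `trdeg ℚ(x, eˣ)` under `GLₙ(ℤ)` acting on `x`; folklore bookkeeping around
  Schanuel's conjecture).
-/

noncomputable section

set_option linter.dupNamespace false

open Complex Set

namespace Summit.Schanuel.Schanuel.Cruxes.MinimalCounterexampleInAcl.KernelArithmeticSelection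

open Literature.NumberTheory.Transcendental (SchanuelRank)
open Summit.Schanuel.Schanuel.Theorems.AclSubsetLogFreeCore.Negative

/-! ## Integer combinations and their exponentials inside an intermediate field -/

/-- An integer combination of two elements of an intermediate field lies in it. [folklore] -/
theorem intCombo_mem (K : IntermediateField ℚ ℂ) {p q : ℂ} (hp : p ∈ K) (hq : q ∈ K)
    (m n : ℤ) : (m : ℂ) * p + (n : ℂ) * q ∈ K :=
  add_mem (mul_mem (intCast_mem K m) hp) (mul_mem (intCast_mem K n) hq)

/-- `e^{m p + n q} = (e^p)^m · (e^q)^n` for integers `m, n` (Laurent monomial). [folklore] -/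
theorem cexp_intCombo (p q : ℂ) (m n : ℤ) :
    cexp ((m : ℂ) * p + (n : ℂ) * q) = cexp p ^ m * cexp q ^ n := by
  rw [Complex.exp_add, Complex.exp_int_mul, Complex.exp_int_mul]

/-- If `e^p, e^q` lie in an intermediate field then so does `e^{m p + n q}` for integers `m, n`
(intermediate fields are closed under integer powers). [folklore] -/
theorem cexp_intCombo_mem (K : IntermediateField ℚ ℂ) {p q : ℂ} (hp : cexp p ∈ K)
    (hq : cexp q ∈ K) (m n : ℤ) : cexp ((m : ℂ) * p + (n : ℂ) * q) ∈ K := by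
  rw [cexp_intCombo]
  exact mul_mem (zpow_mem hp m) (zpow_mem hq n)

/-- If `e^p, e^q` are algebraic then so is `e^{m p + n q}` for integers `m, n`. [folklore] -/
theorem isAlgebraic_cexp_intCombo {p q : ℂ} (hp : IsAlgebraic ℚ (cexp p))
    (hq : IsAlgebraic ℚ (cexp q)) (m n : ℤ) :
    IsAlgebraic ℚ (cexp ((m : ℂ) * p + (n : ℂ) * q)) := by
  rw [← mem_algebraicClosure_iff] at hp hq ⊢
  exact cexp_intCombo_mem _ hp hq m n

/-- If `y₀, y₁` are integer combinations of `x₀, x₁` then `ℚ(y, eʸ) ≤ ℚ(x, eˣ)`. [folklore] -/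
theorem adjoin_le_of_intCombo {x y : Fin 2 → ℂ} (m n m' n' : ℤ)
    (h0 : y 0 = (m : ℂ) * x 0 + (n : ℂ) * x 1) (h1 : y 1 = (m' : ℂ) * x 0 + (n' : ℂ) * x 1) :
    IntermediateField.adjoin ℚ (range y ∪ range (cexp ∘ y)) ≤
      IntermediateField.adjoin ℚ (range x ∪ range (cexp ∘ x)) := by
  set K := IntermediateField.adjoin ℚ (range x ∪ range (cexp ∘ x)) with hK
  have hx : ∀ i, x i ∈ K := fun i => IntermediateField.subset_adjoin _ _ (Or.inl ⟨i, rfl⟩)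
  have hex : ∀ i, cexp (x i) ∈ K := fun i => IntermediateField.subset_adjoin _ _ (Or.inr ⟨i, rfl⟩)
  have hy : ∀ i, y i ∈ K ∧ cexp (y i) ∈ K := by
    rw [Fin.forall_fin_two, h0, h1]
    exact ⟨⟨intCombo_mem K (hx 0) (hx 1) m n, cexp_intCombo_mem K (hex 0) (hex 1) m n⟩,
      ⟨intCombo_mem K (hx 0) (hx 1) m' n', cexp_intCombo_mem K (hex 0) (hex 1) m' n'⟩⟩
  rw [IntermediateField.adjoin_le_iff]
  rintro _ (⟨i, rfl⟩ | ⟨i, rfl⟩)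
  · exact (hy i).1
  · exact (hy i).2

/-- Transport of a transcendence-degree bound along an EQUALITY of intermediate fields (the
`ℚ`-algebra structure on `↥K` depends on `K`, so this is `subst`, not `rw`). [folklore] -/
theorem trdeg_lt_of_eq {K L : IntermediateField ℚ ℂ} (h : K = L) {c : Cardinal}
    (hL : Algebra.trdeg ℚ ↥L < c) : Algebra.trdeg ℚ ↥K < c := by
  subst h
  exact hL

/-! ## The transport along `B = [[a, b], [−v, u]]`, `a u + b v = 1` -/

/-- **`SL₂(ℤ)`-transport of rank-2 first failures** (general form: `y = B x`). [folklore] -/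
theorem glTwo_transport {x y : Fin 2 → ℂ} {a b u v : ℤ} (hbez : a * u + b * v = 1)
    (hy0 : y 0 = (a : ℂ) * x 0 + (b : ℂ) * x 1) (hy1 : y 1 = -(v : ℂ) * x 0 + (u : ℂ) * x 1)
    (hx : x ∈ firstFailures 2) :
    y ∈ firstFailures 2 ∧
      ((∃ i, Transcendental ℚ (cexp (x i))) → ∃ i, Transcendental ℚ (cexp (y i))) ∧
      ((∀ i, y i ∈ expAcl) → ∀ i, x i ∈ expAcl) := by
  have hbezC : (a : ℂ) * u + b * v = 1 := by exact_mod_cast hbez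
  have hy1' : y 1 = ((-v : ℤ) : ℂ) * x 0 + (u : ℂ) * x 1 := by rw [hy1, Int.cast_neg]
  -- the inverse formulas
  have hx0 : x 0 = (u : ℂ) * y 0 + ((-b : ℤ) : ℂ) * y 1 := by
    rw [hy0, hy1, Int.cast_neg]
    linear_combination (-(x 0)) * hbezC
  have hx1 : x 1 = (v : ℂ) * y 0 + (a : ℂ) * y 1 := by
    rw [hy0, hy1]
    linear_combination (-(x 1)) * hbezC
  -- (1) linear independence
  have hli : LinearIndependent ℚ x := hx.1
  have hliy : LinearIndependent ℚ y := by
    rw [Fintype.linearIndependent_iff] at hli ⊢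
    intro g hg
    rw [Fin.sum_univ_two, hy0, hy1] at hg
    have key := hli ![g 0 * a - g 1 * v, g 0 * b + g 1 * u] (by
      rw [Fin.sum_univ_two]
      simp only [Matrix.cons_val_zero, Matrix.cons_val_one, Matrix.cons_val_fin_one,
        Rat.smul_def] at hg ⊢
      push_cast
      linear_combination hg)
    have h0 := key 0
    have h1 := key 1
    simp only [Matrix.cons_val_zero, Matrix.cons_val_one, Matrix.cons_val_fin_one] at h0 h1
    have hbezQ : (a : ℚ) * u + b * v = 1 := by exact_mod_cast hbez
    refine Fin.forall_fin_two.2 ⟨?_, ?_⟩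
    · linear_combination (u : ℚ) * h0 + (v : ℚ) * h1 - g 0 * hbezQ
    · linear_combination (-b : ℚ) * h0 + (a : ℚ) * h1 - g 1 * hbezQ
  -- (2) the fields coincide
  have hK : IntermediateField.adjoin ℚ (range y ∪ range (cexp ∘ y)) =
      IntermediateField.adjoin ℚ (range x ∪ range (cexp ∘ x)) :=
    le_antisymm (adjoin_le_of_intCombo a b (-v) u hy0 hy1')
      (adjoin_le_of_intCombo u (-b) v a hx0 hx1)
  refine ⟨⟨hliy, ?_, hx.2.2⟩, ?_, ?_⟩
  · exact trdeg_lt_of_eq hK hx.2.1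
  · -- (3) off-log is preserved (contrapositive: both `e^{yᵢ}` algebraic ⟹ both `e^{xⱼ}` algebraic)
    rintro ⟨i, hi⟩
    by_contra h
    simp only [not_exists, Transcendental, not_not] at h
    have halgx : ∀ i, IsAlgebraic ℚ (cexp (x i)) := by
      refine Fin.forall_fin_two.2 ⟨?_, ?_⟩
      · rw [hx0]
        exact isAlgebraic_cexp_intCombo (h 0) (h 1) u (-b)
      · rw [hx1]
        exact isAlgebraic_cexp_intCombo (h 0) (h 1) v a
    exact hi (halgx i)
  · -- (4) `acl`-membership pulls back
    intro hacl
    refine Fin.forall_fin_two.2 ⟨?_, ?_⟩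
    · rw [hx0]
      exact add_mem_expAcl (mul_mem_expAcl (intCast_mem_expAcl u) (hacl 0))
        (mul_mem_expAcl (intCast_mem_expAcl (-b)) (hacl 1))
    · rw [hx1]
      exact add_mem_expAcl (mul_mem_expAcl (intCast_mem_expAcl v) (hacl 0))
        (mul_mem_expAcl (intCast_mem_expAcl a) (hacl 1))

/-- **Stub `stub_glTwoReduction` (registered, PROVED): `GL₂(ℤ)` acts on rank-2 first failures
preserving the log/off-log split and `acl`-membership.**  For `x ∈ firstFailures 2` and integers
with `a u + b v = 1`, the tuple `x̃ = (a x₀ + b x₁, −v x₀ + u x₁)` is again a rank-2 first failure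
(ℚ-linear independence is preserved by the invertible integer matrix; `ℚ(x̃, e^{x̃}) = ℚ(x, eˣ)`
since the `e^{x̃ᵢ}` are integer Laurent monomials in the `e^{xⱼ}` and conversely, so the
transcendence degrees agree), it is off-log if `x` is (if both `e^{x̃ᵢ} ∈ ℚ̄` then
`e^{x₀} = (e^{x̃₀})^u (e^{x̃₁})^{−b}`, `e^{x₁} = (e^{x̃₀})^v (e^{x̃₁})^{a}` are algebraic), and
`x̃ ∈ acl(∅)² ⟹ x ∈ acl(∅)²` (`x₀ = u x̃₀ − b x̃₁`, `x₁ = v x̃₀ + a x̃₁`; `acl(∅)` is a subring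
containing `ℤ`). [folklore] -/
theorem stub_glTwoReduction : ∀ (x : Fin 2 → ℂ) (a b u v : ℤ), a * u + b * v = 1 → x ∈ Summit.Schanuel.Schanuel.Cruxes.MinimalCounterexampleInAcl.KernelArithmeticSelection.firstFailures 2 → (![(a : ℂ) * x 0 + (b : ℂ) * x 1, -(v : ℂ) * x 0 + (u : ℂ) * x 1] : Fin 2 → ℂ) ∈ Summit.Schanuel.Schanuel.Cruxes.MinimalCounterexampleInAcl.KernelArithmeticSelection.firstFailures 2 ∧ ((∃ i, Transcendental ℚ (Complex.exp (x i))) → ∃ i, Transcendental ℚ (Complex.exp ((![(a : ℂ) * x 0 + (b : ℂ) * x 1, -(v : ℂ) * x 0 + (u : ℂ) * x 1] : Fin 2 → ℂ) i))) ∧ ((∀ i, (![(a : ℂ) * x 0 + (b : ℂ) * x 1, -(v : ℂ) * x 0 + (u : ℂ) * x 1] : Fin 2 → ℂ) i ∈ Summit.Schanuel.Schanuel.Theorems.AclSubsetLogFreeCore.Negative.expAcl) → ∀ i, x i ∈ Summit.Schanuel.Schanuel.Theorems.AclSubsetLogFreeCore.Negative.expAcl) := by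
  intro x a b u v hbez hx
  exact glTwo_transport hbez rfl rfl hx

end Summit.Schanuel.Schanuel.Cruxes.MinimalCounterexampleInAcl.KernelArithmeticSelection

end

-- ======== segment: work/split/ABC_combined.lean ========
/-!
# Window recurrence is finite when `e^{x₀}` is algebraic — line `kernel-arithmetic-selection`, crux stmt-Schanuel-0969

Route `RigidCore`, crux (S*) `MinimalCounterexampleInAcl`, lead prover-line-stmt-Schanuel-0969-c3-0, registered stub
`stub_windowRecurrence_e0` (`--supports stmt-Schanuel-0969`).

For an off-log rank-2 first failure `x` with `e^{x₀} ∈ ℚ̄` the set `E = {x'₀ : x' ∈ locusMates x}` lies on finitely many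
cosets of `2πiℤ`; this file proves that LONG WINDOWS RECUR FINITELY OFTEN in `E`: there is `L` such that for every finite
`G ⊆ ℤ` with `|G| ≥ L` only finitely many `s` have `s + 2πig ∈ E` for all `g ∈ G`.  Structure:

* `branch_window_finite` — ON ONE BRANCH AT INFINITY `𝔟(t) = ((t⁻ᵉ, Φ₁ t/tᴺ), (Φ₂ t/tᴺ, Φ₃ t/tᴺ)) ⊆ W` of the ℚ-curve
  `W ∋ (x, eˣ)` over one coset `c + 2πiℤ` (hits at the principal root `t = x₀^{−1/e}`): if the branch carries infinitely
  many coset hits then `y₀ ≡ eᶜ` on it, a log-type `y₁` is impossible (`false_of_logType_pole`), so `y₁ = e^{ℓ₁(t)}` and the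
  hits are the `k` with `M(t_k) ∈ 2πiℤ` for the MEROMORPHIC phase `M = x₁ − ℓ₁`; if `M` were a polynomial in `t⁻ᵉ = x₀`,
  `e^{ℓ₁}` and `ℓ₁` would both be algebraic over `ℂ[x̂₀]` (`isAlgebraic_coords_of_branch`), forcing `ℓ₁` constant
  (`eventually_const_of_isAlgebraic_exp`) and infinitely many independent points in one fibre `eˣ = ω`
  (`finite_indepExpPoints_fibre`) — so `M` is non-degenerate and the COSET WINDOW RIGIDITY (registered stub
  `stub_windowRigidity_coset`, taken as a hypothesis here) bounds the recurrences;
* `windowRecurrence_e0_of` — the assembly over the finitely many cosets (`exp '' E` finite) and the finitely many branches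
  covering the large coset hits (registered stub `stub_cosetBranchCover`, taken as a hypothesis), with a pigeonhole from a
  long window to a long same-branch sub-window;
* `stub_windowRecurrence_e0` — the registered form, from the two stubs once landed.

References: card `Cruxes/MinimalCounterexampleInAcl/Ideas/torsor-self-selection.md` (crux-ideate r1, ideator 2); the tree's
cusp machinery `Literature/NumberTheory/Transcendental/ExpPoints*.lean` (line cusp-germ-schneider-sparsity of crux 0971).
-/

noncomputable section

set_option linter.dupNamespace false

open Complex Filter Topology Set Metric Polynomial

namespace Summit.Schanuel.Schanuel.Cruxes.MinimalCounterexampleInAcl.KernelArithmeticSelection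

open Literature.NumberTheory.Transcendental
open Literature.Analysis.Complex.LaurentGerm
open Literature.Analysis.Complex.MeromorphicGerm (analyticAt_pow_succ_mul_div_pow analyticAt_pow_succ_mul_inv_pow)
open Literature.Analysis.Complex.BranchOrders (exists_zpow_exp_form)
open Summit.Schanuel.Schanuel.Theorems (mem_of_isDefinedOver_bot_of_relations)

/-- The Taylor series of `f : ℂ → ℂ` at `0`, as a formal power series (local notation, as in the tree's cusp files). -/
local notation3 "𝓣[" f "]" =>
  (PowerSeries.mk fun n => ((Nat.factorial n : ℂ)⁻¹ * iteratedDeriv n f 0) : PowerSeries ℂ)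

/-- The Laurent expansion at `0` of a germ `f` with `zⁿ f(z)` analytic at `0` (local notation). -/
local notation3 "𝓛[" n ", " f "]" =>
  (HahnSeries.single (-((n : ℕ) : ℤ)) (1 : ℂ) *
    HahnSeries.ofPowerSeries ℤ ℂ 𝓣[fun z : ℂ => z ^ (n : ℕ) * (f : ℂ → ℂ) z] : LaurentSeries ℂ)

/-- The branch point `((t⁻ᵉ, Φ₁ t / tᴺ), (Φ₂ t / tᴺ, Φ₃ t / tᴺ)) ∈ ℂ² × ℂ²` (local notation). -/
local notation3 "𝔟[" e ", " N ", " Φ₁ ", " Φ₂ ", " Φ₃ ", " t "]" =>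
  (Sum.elim ![((t : ℂ) ^ (e : ℕ))⁻¹, (Φ₁ : ℂ → ℂ) t / t ^ (N : ℕ)]
    ![(Φ₂ : ℂ → ℂ) t / t ^ (N : ℕ), (Φ₃ : ℂ → ℂ) t / t ^ (N : ℕ)] : Fin 2 ⊕ Fin 2 → ℂ)

/-! ## Facts at a hit on a branch -/

section Branch

variable {W : Set (Fin 2 ⊕ Fin 2 → ℂ)} {e N : ℕ} {Φ₁ Φ₂ Φ₃ : ℂ → ℂ}

/-- Coordinates of a point on the branch. [folklore] -/
theorem coords_of_eq_branch {x : Fin 2 → ℂ} {t : ℂ} (h : Sum.elim x (cexp ∘ x) = 𝔟[e, N, Φ₁, Φ₂, Φ₃, t]) :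
    x 0 = (t ^ e)⁻¹ ∧ x 1 = Φ₁ t / t ^ N ∧ cexp (x 0) = Φ₂ t / t ^ N ∧ cexp (x 1) = Φ₃ t / t ^ N := by
  refine ⟨?_, ?_, ?_, ?_⟩
  · have := congrFun h (Sum.inl 0); simpa using this
  · have := congrFun h (Sum.inl 1); simpa using this
  · have := congrFun h (Sum.inr 0); simpa using this
  · have := congrFun h (Sum.inr 1); simpa using this

/-- A small parameter from a large first coordinate: `‖t‖ < δ` once `δ⁻¹ ^ e < ‖(t ^ e)⁻¹‖`. [folklore] -/
theorem norm_lt_of_inv_pow {t : ℂ} {δ : ℝ} (hδ : 0 < δ) (ht : t ≠ 0)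
    (h : δ⁻¹ ^ e < ‖(t ^ e)⁻¹‖) : ‖t‖ < δ := by
  rw [norm_inv, norm_pow, inv_pow] at h
  have hpos : 0 < ‖t‖ ^ e := pow_pos (norm_pos_iff.2 ht) e
  have h1 : ‖t‖ ^ e < δ ^ e := (inv_lt_inv₀ (pow_pos hδ e) hpos).1 h
  exact lt_of_pow_lt_pow_left₀ e hδ.le h1

end Branch


/-- Finitely many integers `m` have `‖c + 2πi m‖ ≤ B`. [folklore] -/
theorem finite_int_norm_coset_le (c : ℂ) (B : ℝ) :
    Set.Finite {m : ℤ | ‖c + 2 * ↑Real.pi * I * (m : ℂ)‖ ≤ B} := by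
  set K : ℝ := (B + ‖c‖) / (2 * Real.pi) with hK
  refine (Set.finite_Icc (⌊-K⌋) (⌈K⌉)).subset ?_
  intro m hm
  simp only [Set.mem_setOf_eq] at hm
  have h2π : 0 < 2 * Real.pi := by positivity
  have hnorm : ‖(2 * ↑Real.pi * I * (m : ℂ) : ℂ)‖ = 2 * Real.pi * |(m : ℝ)| := by
    rw [norm_mul, norm_mul, norm_mul, Complex.norm_I, Complex.norm_intCast, Complex.norm_real,
      Complex.norm_ofNat, Real.norm_eq_abs, abs_of_pos Real.pi_pos, mul_one]
  have hle : 2 * Real.pi * |(m : ℝ)| ≤ B + ‖c‖ := by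
    rw [← hnorm]
    calc ‖(2 * ↑Real.pi * I * (m : ℂ) : ℂ)‖ = ‖(c + 2 * ↑Real.pi * I * (m : ℂ)) - c‖ := by ring_nf
      _ ≤ ‖c + 2 * ↑Real.pi * I * (m : ℂ)‖ + ‖c‖ := norm_sub_le _ _
      _ ≤ B + ‖c‖ := by linarith
  have habs : |(m : ℝ)| ≤ K := by
    rw [hK, le_div_iff₀ h2π]; linarith
  obtain ⟨h1, h2⟩ := abs_le.1 habs
  refine ⟨?_, ?_⟩
  · have h := Int.floor_le_floor h1
    rwa [Int.floor_intCast] at h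
  · have h := Int.ceil_le_ceil h2
    rwa [Int.ceil_intCast] at h

section BranchPhase

variable {W : Set (Fin 2 ⊕ Fin 2 → ℂ)} {e N : ℕ} {Φ₁ Φ₂ Φ₃ : ℂ → ℂ}

/-- **The phase of a branch carrying infinitely many coset hits is a non-degenerate meromorphic germ.**  On a branch at
infinity `𝔟 ⊆ W` of a ℚ-curve `W` of dimension `< 2` whose coset hits (first coordinate in `c + 2πiℤ`) accumulate at `t = 0`:
`y₀ ≡ eᶜ`, `y₁` is not log-type (`false_of_logType_pole`), so `y₁ = e^{ℓ₁(t)}` with `ℓ₁` analytic, and the phase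
`M = x₁ − ℓ₁` is meromorphic and NOT a polynomial in `t⁻ᵉ = x₀` (else `ℓ₁` and `e^{ℓ₁}` are algebraic over `ℂ[x̂₀]` by
`isAlgebraic_coords_of_branch`, `ℓ₁` is constant by `eventually_const_of_isAlgebraic_exp`, and a fibre `eˣ = ω` carries
infinitely many independent points, against `finite_indepExpPoints_fibre`). [folklore] -/
theorem branch_phase_nondegenerate
    (hW : IsDefinedOver (⊥ : Subfield ℂ) W) (hdim : zariskiDim ℂ W < 2) (he : 0 < e) {r : ℝ} (hr : 0 < r)
    (hana : ∀ t : ℂ, ‖t‖ < r → AnalyticAt ℂ Φ₁ t ∧ AnalyticAt ℂ Φ₂ t ∧ AnalyticAt ℂ Φ₃ t)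
    (hWb : ∀ t : ℂ, 0 < ‖t‖ → ‖t‖ < r → 𝔟[e, N, Φ₁, Φ₂, Φ₃, t] ∈ W) (c : ℂ)
    (hhitc : ∀ δ : ℝ, 0 < δ → Set.Infinite {x | x ∈ indepExpPoints W ∧
      (∃ m : ℤ, x 0 = c + 2 * ↑Real.pi * I * (m : ℂ)) ∧
      ∃ t : ℂ, 0 < ‖t‖ ∧ ‖t‖ < δ ∧ Sum.elim x (cexp ∘ x) = 𝔟[e, N, Φ₁, Φ₂, Φ₃, t]}) :
    ∃ ℓ₁ : ℂ → ℂ, AnalyticAt ℂ ℓ₁ 0 ∧ (∀ᶠ t in 𝓝[≠] (0 : ℂ), Φ₃ t / t ^ N = cexp (ℓ₁ t)) ∧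
      AnalyticAt ℂ (fun t : ℂ => t ^ (N + 1) * (Φ₁ t / t ^ N - ℓ₁ t)) 0 ∧
      ¬ ∃ Q : Polynomial ℂ, ∀ᶠ t in 𝓝[≠] (0 : ℂ), Φ₁ t / t ^ N - ℓ₁ t = Q.eval (t ^ e)⁻¹ := by
  classical
  obtain ⟨hΦ₁, hΦ₂, hΦ₃⟩ := hana 0 (by rw [norm_zero]; exact hr)
  have hhit : ∀ δ : ℝ, 0 < δ → Set.Infinite {x | x ∈ indepExpPoints W ∧ ∃ t : ℂ, 0 < ‖t‖ ∧
      ‖t‖ < δ ∧ Sum.elim x (cexp ∘ x) = 𝔟[e, N, Φ₁, Φ₂, Φ₃, t]} :=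
    fun δ hδ => (hhitc δ hδ).mono fun x hx => ⟨hx.1, hx.2.2⟩
  have hfreq : ∀ {P : ℂ → Prop}, (∀ (x : Fin 2 → ℂ) (t : ℂ), x ∈ indepExpPoints W → 0 < ‖t‖ → ‖t‖ < r →
      Sum.elim x (cexp ∘ x) = 𝔟[e, N, Φ₁, Φ₂, Φ₃, t] → (∃ m : ℤ, x 0 = c + 2 * ↑Real.pi * I * (m : ℂ)) → P t) →
      ∃ᶠ t in 𝓝[≠] (0 : ℂ), P t := by
    intro P hP
    refine Literature.Analysis.Complex.MeromorphicGerm.frequently_nhdsNE_of_forall_exists fun ε hε => ?_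
    obtain ⟨x, hxI, hm, t, ht0, htε, hxt⟩ := (hhitc (min ε r) (lt_min hε hr)).nonempty
    exact ⟨t, ht0, htε.trans_le (min_le_left _ _),
      hP x t hxI ht0 (htε.trans_le (min_le_right _ _)) hxt hm⟩
  -- the branch is eventually in `W`
  have hWev : ∀ᶠ t in 𝓝[≠] (0 : ℂ), 𝔟[e, N, Φ₁, Φ₂, Φ₃, t] ∈ W := by
    have hball : ∀ᶠ t in 𝓝[≠] (0 : ℂ), ‖t‖ < r :=
      eventually_nhdsWithin_of_eventually_nhds
        (eventually_norm_sub_lt 0 hr |>.mono fun t ht => by simpa using ht)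
    filter_upwards [hball, self_mem_nhdsWithin] with t ht ht0
    have htne : t ≠ 0 := by rintro rfl; exact ht0 (Set.mem_singleton 0)
    exact hWb t (norm_pos_iff.2 htne) ht
  -- (B2) `y₀ ≡ eᶜ` on the branch
  have hy₀ev : ∀ᶠ t in 𝓝[≠] (0 : ℂ), Φ₂ t / t ^ N = t ^ (0 : ℤ) * cexp ((fun _ : ℂ => c) t) := by
    set F : ℂ → ℂ := fun t => Φ₂ t - cexp c * t ^ N with hF
    have hFan : AnalyticAt ℂ F 0 := hΦ₂.sub (analyticAt_const.mul (analyticAt_id.pow N))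
    have hFfreq : ∃ᶠ t in 𝓝[≠] (0 : ℂ), F t = 0 := by
      refine hfreq fun x t _ ht0 _ hxt hm => ?_
      obtain ⟨m, hm⟩ := hm
      obtain ⟨-, -, h2, -⟩ := coords_of_eq_branch hxt
      have htne : t ≠ 0 := norm_pos_iff.1 ht0
      have hexp0 : cexp (x 0) = cexp c := by
        rw [hm, Complex.exp_add, mul_comm (2 * ↑Real.pi * I) (m : ℂ), Complex.exp_int_mul_two_pi_mul_I, mul_one]
      rw [hF]
      show Φ₂ t - cexp c * t ^ N = 0
      have h' : cexp c = Φ₂ t / t ^ N := hexp0.symm.trans h2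
      rw [h', div_mul_cancel₀ _ (pow_ne_zero N htne), sub_self]
    have hFev : ∀ᶠ t in 𝓝 (0 : ℂ), F t = 0 := hFan.frequently_zero_iff_eventually_zero.1 hFfreq
    filter_upwards [eventually_nhdsWithin_of_eventually_nhds hFev, self_mem_nhdsWithin] with t ht ht0
    have htne : t ≠ 0 := by rintro rfl; exact ht0 (Set.mem_singleton 0)
    rw [zpow_zero, one_mul]
    rw [hF] at ht
    have : Φ₂ t = cexp c * t ^ N := sub_eq_zero.1 ht
    rw [this]
    field_simp
  -- (B3) the multiplicative form of `y₁`
  have hne₃ : ∃ᶠ t in 𝓝[≠] (0 : ℂ), Φ₃ t ≠ 0 := by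
    refine hfreq fun x t _ _ _ hxt _ h0 => ?_
    obtain ⟨-, -, -, h3⟩ := coords_of_eq_branch hxt
    rw [h0, zero_div] at h3
    exact Complex.exp_ne_zero _ h3
  obtain ⟨μ₁, -, -, ℓ₁, -, -, hℓ₁, -, -, -, hy₁⟩ := exists_zpow_exp_form hΦ₃ hne₃ N
  -- (B4) `y₁` is not log-type: `μ₁ = 0`
  have hμ₁ : μ₁ = 0 := by
    by_contra hμ
    refine false_of_logType_pole (W := W) (e := e) (N := N) (Φ₂ := Φ₂) hΦ₁ hhit (μ₀ := 0)
      (ℓ₀ := fun _ : ℂ => c) analyticAt_const hℓ₁ hy₀ev hy₁ (Or.inr hμ) ?_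
    rintro ⟨Φh, hΦh, hev⟩
    -- `(t^e)⁻¹` would be bounded near `0`
    have hcont : ContinuousAt Φh 0 := hΦh.continuousAt
    obtain ⟨δ₁, hδ₁, hB⟩ : ∃ δ₁ > 0, ∀ t : ℂ, ‖t‖ < δ₁ → ‖Φh t‖ < ‖Φh 0‖ + 1 := by
      have h := Metric.continuousAt_iff.1 hcont 1 one_pos
      obtain ⟨δ₁, hδ₁, h⟩ := h
      refine ⟨δ₁, hδ₁, fun t ht => ?_⟩
      have := h (by simpa [dist_eq_norm] using ht)
      rw [dist_eq_norm] at this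
      calc ‖Φh t‖ = ‖(Φh t - Φh 0) + Φh 0‖ := by ring_nf
        _ ≤ ‖Φh t - Φh 0‖ + ‖Φh 0‖ := norm_add_le _ _
        _ < ‖Φh 0‖ + 1 := by linarith
    obtain ⟨δ₂, hδ₂, hev'⟩ := exists_radius_of_eventually hev
    -- choose a small positive real `t`
    set Bd : ℝ := (‖Φh 0‖ + 1) / ‖(μ₁ : ℂ)‖ + ‖c‖ + 1 with hBd
    have hμne : (μ₁ : ℂ) ≠ 0 := by exact_mod_cast hμ
    have hμpos : 0 < ‖(μ₁ : ℂ)‖ := norm_pos_iff.2 hμne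
    have hBdpos : 0 < Bd := by rw [hBd]; positivity
    set τ : ℝ := min (min δ₁ δ₂) (Bd⁻¹ ^ ((e : ℝ)⁻¹)) / 2 with hτ
    have hmpos : 0 < min (min δ₁ δ₂) (Bd⁻¹ ^ ((e : ℝ)⁻¹)) :=
      lt_min (lt_min hδ₁ hδ₂) (Real.rpow_pos_of_pos (inv_pos.2 hBdpos) _)
    have hτpos : 0 < τ := by rw [hτ]; linarith
    have hτlt : τ < min (min δ₁ δ₂) (Bd⁻¹ ^ ((e : ℝ)⁻¹)) := by rw [hτ]; linarith
    have hτδ₁ : τ < δ₁ := hτlt.trans_le ((min_le_left _ _).trans (min_le_left _ _))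
    have hτδ₂ : τ < δ₂ := hτlt.trans_le ((min_le_left _ _).trans (min_le_right _ _))
    have hτB : τ < Bd⁻¹ ^ ((e : ℝ)⁻¹) := hτlt.trans_le (min_le_right _ _)
    set t : ℂ := (τ : ℂ) with ht
    have htnorm : ‖t‖ = τ := by rw [ht, Complex.norm_real, Real.norm_eq_abs, abs_of_pos hτpos]
    have ht0 : 0 < ‖t‖ := by rw [htnorm]; exact hτpos
    have hid := hev' t ht0 (by rw [htnorm]; exact hτδ₂)
    simp only [Int.cast_zero, zero_mul, sub_zero] at hid
    -- `μ₁ ((t^e)⁻¹ - c) = Φh t`, so `‖(t^e)⁻¹‖ ≤ ‖Φh t‖/‖μ₁‖ + ‖c‖ < Bd`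
    have hinv : (t ^ e)⁻¹ = Φh t / (μ₁ : ℂ) + c := by
      field_simp
      linear_combination hid
    have hle : ‖(t ^ e)⁻¹‖ < Bd := by
      rw [hinv]
      calc ‖Φh t / (μ₁ : ℂ) + c‖ ≤ ‖Φh t / (μ₁ : ℂ)‖ + ‖c‖ := norm_add_le _ _
        _ = ‖Φh t‖ / ‖(μ₁ : ℂ)‖ + ‖c‖ := by rw [norm_div]
        _ < (‖Φh 0‖ + 1) / ‖(μ₁ : ℂ)‖ + ‖c‖ + 1 := by
            have := hB t (by rw [htnorm]; exact hτδ₁)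
            have h2 : ‖Φh t‖ / ‖(μ₁ : ℂ)‖ ≤ (‖Φh 0‖ + 1) / ‖(μ₁ : ℂ)‖ :=
              div_le_div_of_nonneg_right this.le hμpos.le
            linarith
    -- but `‖(t^e)⁻¹‖ = τ^{-e} > Bd`
    have hge : Bd < ‖(t ^ e)⁻¹‖ := by
      rw [norm_inv, norm_pow, htnorm]
      have hτe : τ ^ e < (Bd⁻¹ ^ ((e : ℝ)⁻¹)) ^ e := pow_lt_pow_left₀ hτB hτpos.le he.ne'
      have heq : (Bd⁻¹ ^ ((e : ℝ)⁻¹)) ^ e = Bd⁻¹ := by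
        rw [← Real.rpow_natCast, ← Real.rpow_mul (inv_nonneg.2 hBdpos.le), inv_mul_cancel₀ (by exact_mod_cast he.ne'),
          Real.rpow_one]
      rw [heq] at hτe
      have := (inv_lt_inv₀ (inv_pos.2 hBdpos) (pow_pos hτpos e)).2 hτe
      rwa [inv_inv] at this
    exact absurd (hle.trans hge) (lt_irrefl _)
  subst hμ₁
  simp only [zpow_zero, one_mul] at hy₁
  -- (B5) the meromorphic phase `M = x₁ − ℓ₁(t)`
  set M : ℂ → ℂ := fun t => Φ₁ t / t ^ N - ℓ₁ t with hM
  have raise : ∀ {f : ℂ → ℂ} {n K : ℕ}, AnalyticAt ℂ (fun t : ℂ => t ^ n * f t) 0 → n ≤ K →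
      AnalyticAt ℂ (fun t : ℂ => t ^ K * f t) 0 := by
    intro f n K hf hle
    obtain ⟨k, rfl⟩ := Nat.exists_eq_add_of_le hle
    exact analyticAt_pow_add hf k
  have hf₁ : AnalyticAt ℂ (fun t : ℂ => t ^ (N + 1) * (Φ₁ t / t ^ N)) 0 := analyticAt_pow_succ_mul_div_pow hΦ₁ N
  have hℓK : AnalyticAt ℂ (fun t : ℂ => t ^ (N + 1) * ℓ₁ t) 0 :=
    raise (f := ℓ₁) (n := 0) (by simpa using hℓ₁) (Nat.zero_le _)
  have hMan : AnalyticAt ℂ (fun t : ℂ => t ^ (N + 1) * M t) 0 := by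
    have hneg : AnalyticAt ℂ (fun t : ℂ => t ^ (N + 1) * (-ℓ₁ t)) 0 := by
      simpa using analyticAt_const_mul hℓK (-1)
    simpa [hM, sub_eq_add_neg] using analyticAt_add hf₁ hneg
  -- (B6) `M` is not a polynomial in `(t^e)⁻¹`
  have hndeg : ¬ ∃ Q : Polynomial ℂ, ∀ᶠ t in 𝓝[≠] (0 : ℂ), M t = Q.eval (t ^ e)⁻¹ := by
    rintro ⟨Q, hQ⟩
    have req : ∀ {f : ℂ → ℂ} {n K : ℕ} (hf : AnalyticAt ℂ (fun t : ℂ => t ^ n * f t) 0) (hle : n ≤ K),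
        𝓛[K, f] = 𝓛[n, f] := fun hf hle => laurent_eq_of_analyticAt (raise hf hle) hf
    have hf₀ : AnalyticAt ℂ (fun t : ℂ => t ^ (e + 1) * (t ^ e)⁻¹) 0 := analyticAt_pow_succ_mul_inv_pow e
    have hg₀ : AnalyticAt ℂ (fun t : ℂ => t ^ (N + 1) * (Φ₂ t / t ^ N)) 0 := analyticAt_pow_succ_mul_div_pow hΦ₂ N
    have hg₁ : AnalyticAt ℂ (fun t : ℂ => t ^ (N + 1) * (Φ₃ t / t ^ N)) 0 := analyticAt_pow_succ_mul_div_pow hΦ₃ N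
    have hx₀ : 𝓛[e + 1, fun t : ℂ => (t ^ e)⁻¹] = HahnSeries.single (-(e : ℤ)) (1 : ℂ) := (laurent_inv_pow e).1
    have htr₀ : Transcendental ℂ 𝓛[e + 1, fun t : ℂ => (t ^ e)⁻¹] := by
      rw [hx₀]
      refine transcendental_of_coeff_ne_zero (n := -(e : ℤ)) (by omega) ?_
      rw [HahnSeries.coeff_single_same]; exact one_ne_zero
    obtain ⟨ha₁, -, ha₃⟩ := isAlgebraic_coords_of_branch hdim hf₀ hf₁ hg₀ hg₁ hWev htr₀
    set a : LaurentSeries ℂ := 𝓛[e + 1, fun t : ℂ => (t ^ e)⁻¹] with ha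
    set R' := Algebra.adjoin ℂ ({a} : Set (LaurentSeries ℂ)) with hR'
    -- the Laurent expansion of `Q((t^e)⁻¹)` lies in `R'`
    set P : MvPolynomial (Fin 2) ℂ := Polynomial.aeval (MvPolynomial.X 0 : MvPolynomial (Fin 2) ℂ) Q with hP
    have hPeval : ∀ t : ℂ, MvPolynomial.eval ![(t ^ e)⁻¹, (t ^ e)⁻¹] P = Q.eval (t ^ e)⁻¹ := by
      intro t
      have h := Polynomial.aeval_algHom_apply (MvPolynomial.aeval ![(t ^ e)⁻¹, (t ^ e)⁻¹])
        (MvPolynomial.X 0 : MvPolynomial (Fin 2) ℂ) Q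
      rw [MvPolynomial.aeval_X, Matrix.cons_val_zero] at h
      have h2 : MvPolynomial.eval ![(t ^ e)⁻¹, (t ^ e)⁻¹] P = MvPolynomial.aeval ![(t ^ e)⁻¹, (t ^ e)⁻¹] P := by
        rw [← MvPolynomial.coe_aeval_eq_eval]; rfl
      rw [h2, hP, ← h, Polynomial.coe_aeval_eq_eval]
    set K₀ : ℕ := ((e + 1) + (e + 1)) * P.totalDegree with hK₀
    obtain ⟨hLQ, hQan⟩ := laurent_eval hf₀ hf₀ P (N := K₀) le_rfl
    have hrange : Set.range ![a, a] = {a} := by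
      ext z
      simp only [Set.mem_range, Set.mem_singleton_iff]
      constructor
      · rintro ⟨i, rfl⟩; fin_cases i <;> rfl
      · rintro rfl; exact ⟨0, rfl⟩
    have hQmem : (MvPolynomial.aeval ![a, a] P : LaurentSeries ℂ) ∈ R' := by
      rw [hR', ← hrange, Algebra.adjoin_range_eq_range_aeval]
      exact ⟨P, rfl⟩
    have hQalg : IsAlgebraic R' (MvPolynomial.aeval ![a, a] P : LaurentSeries ℂ) :=
      isAlgebraic_algebraMap (⟨_, hQmem⟩ : R')
    -- `ℓ₁ = x₁ − Q((t^e)⁻¹)` on a punctured neighbourhood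
    have hℓeq : ∀ᶠ t in 𝓝[≠] (0 : ℂ), ℓ₁ t = Φ₁ t / t ^ N - MvPolynomial.eval ![(t ^ e)⁻¹, (t ^ e)⁻¹] P := by
      filter_upwards [hQ] with t ht
      rw [hPeval, ← ht, hM]; ring
    -- the Laurent expansion of `ℓ₁` is algebraic over `ℂ[x̂₀]`
    set K : ℕ := (N + 1) + K₀ with hK
    have hf₁K : AnalyticAt ℂ (fun t : ℂ => t ^ K * (Φ₁ t / t ^ N)) 0 := raise hf₁ (Nat.le_add_right _ _)
    have hQK : AnalyticAt ℂ (fun t : ℂ => t ^ K * MvPolynomial.eval ![(t ^ e)⁻¹, (t ^ e)⁻¹] P) 0 :=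
      raise hQan (Nat.le_add_left _ _)
    have hℓ₁K : AnalyticAt ℂ (fun t : ℂ => t ^ K * ℓ₁ t) 0 :=
      raise (f := ℓ₁) (n := 0) (by simpa using hℓ₁) (Nat.zero_le _)
    have hdiffK : AnalyticAt ℂ
        (fun t : ℂ => t ^ K * (Φ₁ t / t ^ N - MvPolynomial.eval ![(t ^ e)⁻¹, (t ^ e)⁻¹] P)) 0 := by
      have hneg : AnalyticAt ℂ (fun t : ℂ => t ^ K * (-MvPolynomial.eval ![(t ^ e)⁻¹, (t ^ e)⁻¹] P)) 0 := by
        simpa using analyticAt_const_mul hQK (-1)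
      simpa [sub_eq_add_neg] using analyticAt_add hf₁K hneg
    have hℓhat : 𝓛[0, ℓ₁] = 𝓛[N + 1, fun t : ℂ => Φ₁ t / t ^ N] - MvPolynomial.aeval ![a, a] P := by
      have h1 : 𝓛[0, ℓ₁] = 𝓛[K, ℓ₁] := (req (f := ℓ₁) (n := 0) (by simpa using hℓ₁) (Nat.zero_le _)).symm
      have h2 := laurent_sub hf₁K hQK
      have h3 := laurent_congr hℓ₁K hdiffK hℓeq
      beta_reduce at h2 h3
      rw [h1, h3, h2, req hf₁ (Nat.le_add_right _ _), req hQan (Nat.le_add_left _ _), hLQ]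
    have h₁ : IsAlgebraic R' 𝓛[0, ℓ₁] := by
      rw [hℓhat]
      exact ha₁.sub hQalg
    -- the Laurent expansion of `e^{ℓ₁} = y₁` is algebraic over `ℂ[x̂₀]`
    have hexpan : AnalyticAt ℂ (fun t => cexp (ℓ₁ t)) 0 := analyticAt_cexp.comp hℓ₁
    have hEK : AnalyticAt ℂ (fun t : ℂ => t ^ (N + 1) * cexp (ℓ₁ t)) 0 :=
      raise (f := fun t => cexp (ℓ₁ t)) (n := 0) (by simpa using hexpan) (Nat.zero_le _)
    have hEeq : 𝓛[N + 1, fun t : ℂ => Φ₃ t / t ^ N] = 𝓛[N + 1, fun t : ℂ => cexp (ℓ₁ t)] :=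
      laurent_congr hg₁ hEK hy₁
    have h₂ : IsAlgebraic R' 𝓛[0, fun t => cexp (ℓ₁ t)] := by
      rw [← req (f := fun t => cexp (ℓ₁ t)) (n := 0) (K := N + 1) (by simpa using hexpan) (Nat.zero_le _), ← hEeq]
      exact ha₃
    have hconst : ∀ᶠ t in 𝓝 (0 : ℂ), ℓ₁ t = ℓ₁ 0 := eventually_const_of_isAlgebraic_exp hℓ₁ h₁ h₂
    -- hence infinitely many independent points in the fibre over `(eᶜ, e^{ℓ₁ 0})`
    obtain ⟨δ₃, hδ₃, hδ₃P⟩ := exists_radius_of_eventually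
      ((eventually_nhdsWithin_of_eventually_nhds hconst).and (hy₁.and hy₀ev))
    refine (finite_indepExpPoints_fibre W hW hdim ![cexp c, cexp (ℓ₁ 0)]).not_infinite ((hhit δ₃ hδ₃).mono ?_)
    rintro x ⟨hxI, t, ht0, htδ, hxt⟩
    obtain ⟨hc1, hc2, hc3⟩ := hδ₃P t ht0 htδ
    obtain ⟨-, -, h2, h3⟩ := coords_of_eq_branch hxt
    refine ⟨hxI, funext fun i => ?_⟩
    fin_cases i
    · show cexp (x 0) = cexp c
      rw [h2, hc3, zpow_zero, one_mul]
    · show cexp (x 1) = cexp (ℓ₁ 0)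
      rw [h3, hc2, hc1]
  exact ⟨ℓ₁, hℓ₁, hy₁, hMan, hndeg⟩

end BranchPhase

/-- **Registered stub `stub_branchPhaseNondegenerate` (PROVED)** — explicit-binder form of `branch_phase_nondegenerate`. [folklore] -/
theorem stub_branchPhaseNondegenerate : ∀ (W : Set (Fin 2 ⊕ Fin 2 → ℂ)) (e N : ℕ) (Φ₁ Φ₂ Φ₃ : ℂ → ℂ) (r : ℝ) (c : ℂ), Literature.NumberTheory.Transcendental.IsDefinedOver (⊥ : Subfield ℂ) W → Literature.NumberTheory.Transcendental.zariskiDim ℂ W < 2 → 0 < e → 0 < r → (∀ t : ℂ, ‖t‖ < r → AnalyticAt ℂ Φ₁ t ∧ AnalyticAt ℂ Φ₂ t ∧ AnalyticAt ℂ Φ₃ t) → (∀ t : ℂ, 0 < ‖t‖ → ‖t‖ < r → (Sum.elim ![(t ^ e)⁻¹, Φ₁ t / t ^ N] ![Φ₂ t / t ^ N, Φ₃ t / t ^ N] : Fin 2 ⊕ Fin 2 → ℂ) ∈ W) → (∀ δ : ℝ, 0 < δ → Set.Infinite {x : Fin 2 → ℂ | x ∈ Literature.NumberTheory.Transcendental.indepExpPoints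 W ∧ (∃ m : ℤ, x 0 = c + 2 * ↑Real.pi * Complex.I * (m : ℂ)) ∧ ∃ t : ℂ, 0 < ‖t‖ ∧ ‖t‖ < δ ∧ Sum.elim x (Complex.exp ∘ x) = (Sum.elim ![(t ^ e)⁻¹, Φ₁ t / t ^ N] ![Φ₂ t / t ^ N, Φ₃ t / t ^ N] : Fin 2 ⊕ Fin 2 → ℂ)}) → ∃ ℓ₁ : ℂ → ℂ, AnalyticAt ℂ ℓ₁ 0 ∧ (∀ᶠ t in 𝓝[≠] (0 : ℂ), Φ₃ t / t ^ N = Complex.exp (ℓ₁ t)) ∧ AnalyticAt ℂ (fun t : ℂ => t ^ (N + 1) * (Φ₁ t / t ^ N - ℓ₁ t)) 0 ∧ ¬ ∃ Q : Polynomial ℂ, ∀ᶠ t in 𝓝[≠] (0 : ℂ), Φ₁ t / t ^ N - ℓ₁ t = Q.eval (t ^ e)⁻¹ :=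
  fun _ _ _ _ _ _ _ c hW hdim he hr hana hWb hhitc => branch_phase_nondegenerate hW hdim he hr hana hWb c hhitc


section BranchLemma

variable {W : Set (Fin 2 ⊕ Fin 2 → ℂ)} {e N : ℕ} {Φ₁ Φ₂ Φ₃ : ℂ → ℂ}

/-- **Per-branch window finiteness.**  On a branch at infinity `𝔟 ⊆ W` of a ℚ-curve `W` of dimension `< 2`, over a kernel
coset `c + 2πiℤ` (hits at the principal root `t = x₀^{−1/e}`), windows of length `≥ N + 3` recur finitely often — given the
coset window rigidity for meromorphic phases (registered stub `stub_windowRigidity_coset`, hypothesis `hrig`): if the branch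
carries finitely many coset hits this is trivial; otherwise `branch_phase_nondegenerate` supplies the non-degenerate meromorphic
phase `M = x₁ − ℓ₁` whose values at the hits lie in `2πiℤ`. [folklore] -/
theorem branch_window_finite
    (hrig : ∀ (e p : ℕ) (M : ℂ → ℂ) (c : ℂ) (G : Finset ℤ), 0 < e → AnalyticAt ℂ (fun t : ℂ => t ^ p * M t) 0 →
      (¬ ∃ Q : Polynomial ℂ, ∀ᶠ t in 𝓝[≠] (0 : ℂ), M t = Q.eval (t ^ e)⁻¹) → p + 2 ≤ G.card →
        Set.Finite {k : ℤ | ∀ j ∈ G, ∃ L : ℤ,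
          M ((c + 2 * ↑Real.pi * I * ((k + j : ℤ) : ℂ)) ^ (-((e : ℂ)⁻¹))) = (L : ℂ) * (2 * ↑Real.pi * I)})
    (hW : IsDefinedOver (⊥ : Subfield ℂ) W) (hdim : zariskiDim ℂ W < 2) (he : 0 < e) {r : ℝ} (hr : 0 < r)
    (hana : ∀ t : ℂ, ‖t‖ < r → AnalyticAt ℂ Φ₁ t ∧ AnalyticAt ℂ Φ₂ t ∧ AnalyticAt ℂ Φ₃ t)
    (hWb : ∀ t : ℂ, 0 < ‖t‖ → ‖t‖ < r → 𝔟[e, N, Φ₁, Φ₂, Φ₃, t] ∈ W) (c : ℂ) :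
    ∃ L : ℕ, ∀ G : Finset ℤ, L ≤ G.card →
      Set.Finite {k : ℤ | ∀ j ∈ G, ∃ x ∈ indepExpPoints W, ∃ t : ℂ,
        t = (x 0) ^ (-((e : ℂ)⁻¹)) ∧ x 0 = c + 2 * ↑Real.pi * I * ((k + j : ℤ) : ℂ) ∧
        0 < ‖t‖ ∧ ‖t‖ < r ∧ Sum.elim x (cexp ∘ x) = 𝔟[e, N, Φ₁, Φ₂, Φ₃, t]} := by
  classical
  refine ⟨N + 3, fun G hG => ?_⟩
  -- hits over the coset on this branch
  set Hit : ℤ → Prop := fun m => ∃ x ∈ indepExpPoints W, ∃ t : ℂ,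
      t = (x 0) ^ (-((e : ℂ)⁻¹)) ∧ x 0 = c + 2 * ↑Real.pi * I * (m : ℂ) ∧
      0 < ‖t‖ ∧ ‖t‖ < r ∧ Sum.elim x (cexp ∘ x) = 𝔟[e, N, Φ₁, Φ₂, Φ₃, t] with hHit
  have hGne : G.Nonempty := Finset.card_pos.1 (by omega)
  obtain ⟨j₀, hj₀⟩ := hGne
  have hsub : {k : ℤ | ∀ j ∈ G, ∃ x ∈ indepExpPoints W, ∃ t : ℂ,
        t = (x 0) ^ (-((e : ℂ)⁻¹)) ∧ x 0 = c + 2 * ↑Real.pi * I * ((k + j : ℤ) : ℂ) ∧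
        0 < ‖t‖ ∧ ‖t‖ < r ∧ Sum.elim x (cexp ∘ x) = 𝔟[e, N, Φ₁, Φ₂, Φ₃, t]} ⊆
      (fun k => k + j₀) ⁻¹' {m | Hit m} := fun k hk => hk j₀ hj₀
  by_cases hfin : {m : ℤ | Hit m}.Finite
  · exact (hfin.preimage (add_left_injective j₀).injOn).subset hsub
  -- ### Case B: infinitely many coset hits on this branch
  have hinf : {m : ℤ | Hit m}.Infinite := hfin
  obtain ⟨hΦ₁, hΦ₂, hΦ₃⟩ := hana 0 (by rw [norm_zero]; exact hr)
  -- (B0) small parameters: hits with large `x 0` have small `t`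
  have hsmall : ∀ {x : Fin 2 → ℂ} {t : ℂ} {δ : ℝ}, 0 < δ → Sum.elim x (cexp ∘ x) = 𝔟[e, N, Φ₁, Φ₂, Φ₃, t] →
      0 < ‖t‖ → δ⁻¹ ^ e < ‖x 0‖ → ‖t‖ < δ := by
    intro x t δ hδ hxt ht hx0
    obtain ⟨h0, -, -, -⟩ := coords_of_eq_branch hxt
    rw [h0] at hx0
    exact norm_lt_of_inv_pow hδ (norm_pos_iff.1 ht) hx0
  -- (B1) the coset hits accumulate at `t = 0`
  have hhitc : ∀ δ : ℝ, 0 < δ → Set.Infinite {x | x ∈ indepExpPoints W ∧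
      (∃ m : ℤ, x 0 = c + 2 * ↑Real.pi * I * (m : ℂ)) ∧
      ∃ t : ℂ, 0 < ‖t‖ ∧ ‖t‖ < δ ∧ Sum.elim x (cexp ∘ x) = 𝔟[e, N, Φ₁, Φ₂, Φ₃, t]} := by
    intro δ hδ
    set S : Set ℤ := {m | Hit m} \ {m | ‖c + 2 * ↑Real.pi * I * (m : ℂ)‖ ≤ δ⁻¹ ^ e} with hS
    have hSinf : S.Infinite := hinf.sdiff (finite_int_norm_coset_le c _)
    set pick : ℤ → (Fin 2 → ℂ) := fun m => if h : Hit m then h.choose else 0 with hpick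
    have hpick : ∀ m, Hit m → pick m ∈ indepExpPoints W ∧ ∃ t : ℂ,
        t = (pick m 0) ^ (-((e : ℂ)⁻¹)) ∧ pick m 0 = c + 2 * ↑Real.pi * I * (m : ℂ) ∧
        0 < ‖t‖ ∧ ‖t‖ < r ∧ Sum.elim (pick m) (cexp ∘ pick m) = 𝔟[e, N, Φ₁, Φ₂, Φ₃, t] := by
      intro m hm
      have h := hm.choose_spec
      simp only [hpick, dif_pos hm]
      exact ⟨h.1, h.2⟩
    refine Set.infinite_of_injOn_mapsTo (f := pick) ?_ ?_ hSinf
    · intro m hm m' hm' heq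
      obtain ⟨-, t, -, h0, -⟩ := hpick m hm.1
      obtain ⟨-, t', -, h0', -⟩ := hpick m' hm'.1
      have : (c + 2 * ↑Real.pi * I * (m : ℂ)) = c + 2 * ↑Real.pi * I * (m' : ℂ) := by rw [← h0, ← h0', heq]
      have h2 : (m : ℂ) = (m' : ℂ) := by
        have hne : (2 * ↑Real.pi * I : ℂ) ≠ 0 := by simp [Real.pi_ne_zero, I_ne_zero]
        exact mul_left_cancel₀ hne (by linear_combination this)
      exact_mod_cast h2
    · intro m hm
      obtain ⟨hxI, t, -, h0, ht0, htr, hxt⟩ := hpick m hm.1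
      have hlt : δ⁻¹ ^ e < ‖pick m 0‖ := by
        rw [h0]; exact lt_of_not_ge hm.2
      exact ⟨hxI, ⟨m, h0⟩, t, ht0, hsmall hδ hxt ht0 hlt, hxt⟩
  -- (B2)–(B6) the phase of the branch
  obtain ⟨ℓ₁, hℓ₁, hy₁, hMan, hndeg⟩ := branch_phase_nondegenerate hW hdim he hr hana hWb c hhitc
  -- (B7) coset window rigidity
  have hfinR := hrig e (N + 1) (fun t : ℂ => Φ₁ t / t ^ N - ℓ₁ t) c G he hMan hndeg (by omega)
  obtain ⟨δ₂, hδ₂, hδ₂P⟩ := exists_radius_of_eventually hy₁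
  set Bad : Set ℤ := ⋃ j ∈ G, {k : ℤ | ‖c + 2 * ↑Real.pi * I * ((k + j : ℤ) : ℂ)‖ ≤ δ₂⁻¹ ^ e} with hBad
  have hBadfin : Bad.Finite := by
    refine Set.Finite.biUnion G.finite_toSet fun j _ => ?_
    exact (finite_int_norm_coset_le c (δ₂⁻¹ ^ e)).preimage (f := fun k : ℤ => k + j) (add_left_injective j).injOn
  refine (hfinR.union hBadfin).subset ?_
  intro k hk
  by_cases hkB : k ∈ Bad
  · exact Or.inr hkB
  refine Or.inl fun j hj => ?_
  obtain ⟨x, -, t, htdef, hx0, ht0, -, hxt⟩ := hk j hj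
  have hlarge : δ₂⁻¹ ^ e < ‖x 0‖ := by
    rw [hx0]
    by_contra hle
    exact hkB (Set.mem_iUnion₂.2 ⟨j, hj, not_lt.1 hle⟩)
  have htδ : ‖t‖ < δ₂ := hsmall hδ₂ hxt ht0 hlarge
  have hy := hδ₂P t ht0 htδ
  obtain ⟨-, h1, -, h3⟩ := coords_of_eq_branch hxt
  have hexp : cexp (Φ₁ t / t ^ N) = cexp (ℓ₁ t) := by rw [← h1, h3, hy]
  obtain ⟨n, hn⟩ := Complex.exp_eq_exp_iff_exists_int.1 hexp
  refine ⟨n, ?_⟩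
  rw [← hx0, ← htdef]
  show Φ₁ t / t ^ N - ℓ₁ t = (n : ℂ) * (2 * ↑Real.pi * I)
  rw [hn]; ring


end BranchLemma

/-- **Registered stub `stub_branchWindowFinite` (PROVED)** — explicit-binder form of `branch_window_finite`. [folklore] -/
theorem stub_branchWindowFinite : (∀ (e p : ℕ) (M : ℂ → ℂ) (c : ℂ) (G : Finset ℤ), 0 < e → AnalyticAt ℂ (fun t : ℂ => t ^ p * M t) 0 → (¬ ∃ Q : Polynomial ℂ, ∀ᶠ t in 𝓝[≠] (0 : ℂ), M t = Q.eval (t ^ e)⁻¹) → p + 2 ≤ G.card → Set.Finite {k : ℤ | ∀ j ∈ G, ∃ L : ℤ, M ((c + 2 * ↑Real.pi * Complex.I * ((k + j : ℤ) : ℂ)) ^ (-((e : ℂ)⁻¹))) = (L : ℂ) * (2 * ↑Real.pi * Complex.I)}) → ∀ (W : Set (Fin 2 ⊕ Fin 2 → ℂ)) (e N : ℕ) (Φ₁ Φ₂ Φ₃ : ℂ → ℂ) (r : ℝ) (c : ℂ), Literature.NumberTheory.Transcendental.IsDefinedOver (⊥ : Subfield ℂ) W → Literature.NumberTheory.Transcendental.zariskiDim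 ℂ W < 2 → 0 < e → 0 < r → (∀ t : ℂ, ‖t‖ < r → AnalyticAt ℂ Φ₁ t ∧ AnalyticAt ℂ Φ₂ t ∧ AnalyticAt ℂ Φ₃ t) → (∀ t : ℂ, 0 < ‖t‖ → ‖t‖ < r → (Sum.elim ![(t ^ e)⁻¹, Φ₁ t / t ^ N] ![Φ₂ t / t ^ N, Φ₃ t / t ^ N] : Fin 2 ⊕ Fin 2 → ℂ) ∈ W) → ∃ L : ℕ, ∀ G : Finset ℤ, L ≤ G.card → Set.Finite {k : ℤ | ∀ j ∈ G, ∃ x ∈ Literature.NumberTheory.Transcendental.indepExpPoints W, ∃ t : ℂ, t = (x 0) ^ (-((e : ℂ)⁻¹)) ∧ x 0 = c + 2 * ↑Real.pi * Complex.I * ((k + j : ℤ) : ℂ) ∧ 0 < ‖t‖ ∧ ‖t‖ < r ∧ Sum.elim x (Complex.exp ∘ x) = (Sum.elim ![(t ^ e)⁻¹, Φ₁ t / t ^ N] ![Φ₂ t / t ^ N, Φ₃ t / t ^ N] : Fin 2 ⊕ Fin 2 → ℂ)} :=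
  fun hrig _ _ _ _ _ _ _ c hW hdim he hr hana hWb => branch_window_finite hrig hW hdim he hr hana hWb c

/-! ## Assembly over cosets and branches -/

section Assembly

/-- Recovering the integer parameter of a coset point. [folklore] -/
theorem round_coset (c : ℂ) (m : ℤ) :
    round (((c + 2 * ↑Real.pi * I * (m : ℂ) - c) / (2 * ↑Real.pi * I)).re) = m := by
  have hne : (2 * ↑Real.pi * I : ℂ) ≠ 0 := by simp [Real.pi_ne_zero, I_ne_zero]
  have : (c + 2 * ↑Real.pi * I * (m : ℂ) - c) / (2 * ↑Real.pi * I) = (m : ℂ) := by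
    field_simp; ring
  rw [this, Complex.intCast_re, round_intCast]

/-- Finitely many coset positions are first coordinates of points of a finite set. [folklore] -/
theorem finite_coset_positions_of_finite {X : Set (Fin 2 → ℂ)} (hX : X.Finite) (c : ℂ) :
    Set.Finite {m : ℤ | ∃ x ∈ X, x 0 = c + 2 * ↑Real.pi * I * (m : ℂ)} := by
  refine (hX.image fun x : Fin 2 → ℂ => round (((x 0 - c) / (2 * ↑Real.pi * I)).re)).subset ?_
  rintro m ⟨x, hx, hx0⟩
  refine ⟨x, hx, ?_⟩
  simp only
  rw [hx0, round_coset]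

/-- Mates of a tuple with `e^{x₀}` algebraic have `e^{x'₀}` among the roots of its minimal relation. [folklore] -/
theorem cexp_fst_mem_rootSet_of_mem_locusMates {x : Fin 2 → ℂ} {p : Polynomial ℚ}
    (hp : Polynomial.aeval (cexp (x 0)) p = 0) {x' : Fin 2 → ℂ} (hx' : x' ∈ locusMates x) (hp0 : p ≠ 0) :
    cexp (x' 0) ∈ p.rootSet ℂ := by
  set P : MvPolynomial (Fin 2 ⊕ Fin 2) ℚ :=
    Polynomial.aeval (MvPolynomial.X (Sum.inr 0) : MvPolynomial (Fin 2 ⊕ Fin 2) ℚ) p with hP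
  have hPev : ∀ z : Fin 2 → ℂ, MvPolynomial.aeval (Sum.elim z (cexp ∘ z)) P = Polynomial.aeval (cexp (z 0)) p := by
    intro z
    have h := Polynomial.aeval_algHom_apply (MvPolynomial.aeval (Sum.elim z (cexp ∘ z)))
      (MvPolynomial.X (Sum.inr 0) : MvPolynomial (Fin 2 ⊕ Fin 2) ℚ) p
    rw [MvPolynomial.aeval_X] at h
    rw [hP, ← h]
    simp
  have h0 : MvPolynomial.aeval (Sum.elim x (cexp ∘ x)) P = 0 := by rw [hPev, hp]
  have h1 : MvPolynomial.aeval (Sum.elim x' (cexp ∘ x')) P = 0 := hx'.2 P h0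
  rw [hPev] at h1
  rw [Polynomial.mem_rootSet]
  exact ⟨hp0, h1⟩

/-- **Window recurrence is finite when `e^{x₀}` is algebraic**, from the coset window rigidity (`hrig`, registered stub
`stub_windowRigidity_coset`) and the branch cover of the large coset hits (`hcov`, registered stub `stub_cosetBranchCover`).
See the module docstring. [folklore] -/
theorem windowRecurrence_e0_of
    (hrig : ∀ (e p : ℕ) (M : ℂ → ℂ) (c : ℂ) (G : Finset ℤ), 0 < e → AnalyticAt ℂ (fun t : ℂ => t ^ p * M t) 0 →
      (¬ ∃ Q : Polynomial ℂ, ∀ᶠ t in 𝓝[≠] (0 : ℂ), M t = Q.eval (t ^ e)⁻¹) → p + 2 ≤ G.card →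
        Set.Finite {k : ℤ | ∀ j ∈ G, ∃ L : ℤ,
          M ((c + 2 * ↑Real.pi * I * ((k + j : ℤ) : ℂ)) ^ (-((e : ℂ)⁻¹))) = (L : ℂ) * (2 * ↑Real.pi * I)})
    (hcov : ∀ (W : Set (Fin 2 ⊕ Fin 2 → ℂ)), IsZariskiClosed ℂ W → zariskiDim ℂ W < 2 → ∀ (c : ℂ),
      ∃ (e : ℕ) (R r : ℝ) (B : Finset ((ℂ → ℂ) × (ℂ → ℂ) × (ℂ → ℂ) × ℕ)) (X : Set (Fin 2 → ℂ)),
        0 < e ∧ 0 < r ∧ X.Finite ∧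
        (∀ b ∈ B, (∀ t : ℂ, ‖t‖ < r → AnalyticAt ℂ b.1 t ∧ AnalyticAt ℂ b.2.1 t ∧ AnalyticAt ℂ b.2.2.1 t) ∧
          ∀ t : ℂ, 0 < ‖t‖ → ‖t‖ < r →
            (Sum.elim ![(t ^ e)⁻¹, b.1 t / t ^ b.2.2.2] ![b.2.1 t / t ^ b.2.2.2, b.2.2.1 t / t ^ b.2.2.2] :
              Fin 2 ⊕ Fin 2 → ℂ) ∈ W) ∧
        ∀ x ∈ indepExpPoints W, (∃ k : ℤ, x 0 = c + 2 * ↑Real.pi * I * (k : ℂ)) → R < ‖x 0‖ → x ∉ X →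
          ∃ b ∈ B, 0 < ‖(x 0) ^ (-((e : ℂ)⁻¹))‖ ∧ ‖(x 0) ^ (-((e : ℂ)⁻¹))‖ < r ∧
            Sum.elim x (cexp ∘ x) =
              (Sum.elim ![(((x 0) ^ (-((e : ℂ)⁻¹))) ^ e)⁻¹, b.1 ((x 0) ^ (-((e : ℂ)⁻¹))) / ((x 0) ^ (-((e : ℂ)⁻¹))) ^ b.2.2.2]
                ![b.2.1 ((x 0) ^ (-((e : ℂ)⁻¹))) / ((x 0) ^ (-((e : ℂ)⁻¹))) ^ b.2.2.2,
                  b.2.2.1 ((x 0) ^ (-((e : ℂ)⁻¹))) / ((x 0) ^ (-((e : ℂ)⁻¹))) ^ b.2.2.2] : Fin 2 ⊕ Fin 2 → ℂ))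
    {x : Fin 2 → ℂ} (hx : x ∈ firstFailures 2) (halg : IsAlgebraic ℚ (cexp (x 0))) :
    ∃ L : ℕ, ∀ G : Finset ℤ, L ≤ G.card →
      Set.Finite {s : ℂ | ∀ g ∈ G, s + 2 * ↑Real.pi * I * (g : ℂ) ∈ {s : ℂ | ∃ x' ∈ locusMates x, s = x' 0}} := by
  classical
  -- the ℚ-curve through `(x, eˣ)` and its independent exponential points
  obtain ⟨W, hW, hd, hxW⟩ := exists_mem_indepExpPoints_of_trdeg_lt_two hx.1 (by exact_mod_cast hx.2.1)
  have hmate : ∀ x' ∈ locusMates x, x' ∈ indepExpPoints W :=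
    fun x' hx' => ⟨hx'.1, mem_of_isDefinedOver_bot_of_relations hW hxW.2 hx'.2⟩
  -- the finitely many exponential values of the first coordinates of mates
  obtain ⟨p, hp0, hp⟩ := halg
  set Rt : Finset ℂ := (p.rootSet_finite ℂ).toFinset with hRt
  have hroot : ∀ x' ∈ locusMates x, cexp (x' 0) ∈ Rt := fun x' hx' => by
    rw [hRt, Set.Finite.mem_toFinset]; exact cexp_fst_mem_rootSet_of_mem_locusMates hp hx' hp0
  -- cover data for every value `ρ` (coset `log ρ + 2πiℤ`)
  have hcov' := fun ρ : ℂ => hcov W hW.isZariskiClosed hd (Complex.log ρ)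
  choose eρ Rρ rρ Bρ Xρ heρ hrρ hXρ hBρ hrepρ using hcov'
  -- per-branch window bounds
  have hbr : ∀ (ρ : ℂ) (b : (ℂ → ℂ) × (ℂ → ℂ) × (ℂ → ℂ) × ℕ), b ∈ Bρ ρ → ∃ L : ℕ, ∀ G : Finset ℤ, L ≤ G.card →
      Set.Finite {k : ℤ | ∀ j ∈ G, ∃ x' ∈ indepExpPoints W, ∃ t : ℂ,
        t = (x' 0) ^ (-((eρ ρ : ℂ)⁻¹)) ∧ x' 0 = Complex.log ρ + 2 * ↑Real.pi * I * ((k + j : ℤ) : ℂ) ∧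
        0 < ‖t‖ ∧ ‖t‖ < rρ ρ ∧ Sum.elim x' (cexp ∘ x') = 𝔟[eρ ρ, b.2.2.2, b.1, b.2.1, b.2.2.1, t]} := by
    intro ρ b hb
    obtain ⟨hban, hbW⟩ := hBρ ρ b hb
    exact branch_window_finite hrig hW hd (heρ ρ) (hrρ ρ) hban hbW (Complex.log ρ)
  choose! Lb hLb using hbr
  -- the global window length
  set maxL : ℂ → ℕ := fun ρ => (Bρ ρ).sup (Lb ρ) with hmaxL
  set Lρ : ℂ → ℕ := fun ρ => (Bρ ρ).card * maxL ρ + 1 with hLρ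
  refine ⟨Rt.sup Lρ + 1, fun G hG => ?_⟩
  have hGne : G.Nonempty := Finset.card_pos.1 (by omega)
  obtain ⟨g₀, hg₀⟩ := hGne
  set E : Set ℂ := {s : ℂ | ∃ x' ∈ locusMates x, s = x' 0} with hE
  -- windows sit on one of the finitely many cosets
  set Kρ : ℂ → Set ℤ := fun ρ => {k : ℤ | ∀ g ∈ G, Complex.log ρ + 2 * ↑Real.pi * I * ((k + g : ℤ) : ℂ) ∈ E} with hKρ
  have hcover : {s : ℂ | ∀ g ∈ G, s + 2 * ↑Real.pi * I * (g : ℂ) ∈ E} ⊆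
      ⋃ ρ ∈ Rt, (fun k : ℤ => Complex.log ρ + 2 * ↑Real.pi * I * (k : ℂ)) '' Kρ ρ := by
    intro s hs
    obtain ⟨x', hx', hsx'⟩ := hs g₀ hg₀
    set ρ : ℂ := cexp s with hρ
    have hρmem : ρ ∈ Rt := by
      have h := hroot x' hx'
      rwa [← hsx', Complex.exp_add, mul_comm (2 * ↑Real.pi * I) (g₀ : ℂ), Complex.exp_int_mul_two_pi_mul_I,
        mul_one] at h
    have hρ0 : ρ ≠ 0 := Complex.exp_ne_zero s
    obtain ⟨k, hk⟩ : ∃ k : ℤ, s = Complex.log ρ + k * (2 * ↑Real.pi * I) :=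
      Complex.exp_eq_exp_iff_exists_int.1 (by rw [Complex.exp_log hρ0])
    refine Set.mem_iUnion₂.2 ⟨ρ, hρmem, k, ?_, ?_⟩
    · intro g hg
      have := hs g hg
      rw [hk] at this
      convert this using 1
      push_cast; ring
    · rw [hk]; ring
  refine (Set.Finite.biUnion Rt.finite_toSet fun ρ hρ => (Set.Finite.image _ ?_)).subset hcover
  -- ### finiteness of the window recurrences on the coset of `ρ`
  have hLρle : Lρ ρ + 1 ≤ G.card := (Nat.add_le_add_right (Finset.le_sup hρ) 1).trans hG
  -- bad positions: small first coordinate or exceptional point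
  set Bad : Set ℤ := ⋃ g ∈ G, ({k : ℤ | ‖Complex.log ρ + 2 * ↑Real.pi * I * ((k + g : ℤ) : ℂ)‖ ≤ Rρ ρ} ∪
      {k : ℤ | ∃ x' ∈ Xρ ρ, x' 0 = Complex.log ρ + 2 * ↑Real.pi * I * ((k + g : ℤ) : ℂ)}) with hBad
  have hBadfin : Bad.Finite := by
    refine Set.Finite.biUnion G.finite_toSet fun g _ => Set.Finite.union ?_ ?_
    · exact (finite_int_norm_coset_le (Complex.log ρ) (Rρ ρ)).preimage (f := fun k : ℤ => k + g)
        (add_left_injective g).injOn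
    · exact (finite_coset_positions_of_finite (hXρ ρ) (Complex.log ρ)).preimage (f := fun k : ℤ => k + g)
        (add_left_injective g).injOn
  -- good windows: a long same-branch sub-window
  set Rec : ((ℂ → ℂ) × (ℂ → ℂ) × (ℂ → ℂ) × ℕ) → Finset ℤ → Set ℤ := fun b G' =>
      {k : ℤ | ∀ j ∈ G', ∃ x' ∈ indepExpPoints W, ∃ t : ℂ,
        t = (x' 0) ^ (-((eρ ρ : ℂ)⁻¹)) ∧ x' 0 = Complex.log ρ + 2 * ↑Real.pi * I * ((k + j : ℤ) : ℂ) ∧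
        0 < ‖t‖ ∧ ‖t‖ < rρ ρ ∧ Sum.elim x' (cexp ∘ x') = 𝔟[eρ ρ, b.2.2.2, b.1, b.2.1, b.2.2.1, t]} with hRec
  have hRecfin : Set.Finite (⋃ b ∈ Bρ ρ, ⋃ G' ∈ G.powerset.filter (fun G' => Lb ρ b ≤ G'.card), Rec b G') := by
    refine Set.Finite.biUnion (Bρ ρ).finite_toSet fun b hb => Set.Finite.biUnion (Finset.finite_toSet _) fun G' hG' => ?_
    rw [Finset.coe_filter, Set.mem_setOf_eq] at hG'
    exact hLb ρ b hb G' hG'.2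
  refine (hBadfin.union hRecfin).subset ?_
  intro k hk
  by_cases hkB : k ∈ Bad
  · exact Or.inl hkB
  refine Or.inr ?_
  -- every position of the window is a large non-exceptional coset hit, hence on a branch
  have hpos : ∀ g ∈ G, ∃ b ∈ Bρ ρ, ∃ x' ∈ indepExpPoints W, ∃ t : ℂ,
      t = (x' 0) ^ (-((eρ ρ : ℂ)⁻¹)) ∧ x' 0 = Complex.log ρ + 2 * ↑Real.pi * I * ((k + g : ℤ) : ℂ) ∧
      0 < ‖t‖ ∧ ‖t‖ < rρ ρ ∧ Sum.elim x' (cexp ∘ x') = 𝔟[eρ ρ, b.2.2.2, b.1, b.2.1, b.2.2.1, t] := by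
    intro g hg
    obtain ⟨x', hx', hx'0⟩ := hk g hg
    have hxI : x' ∈ indepExpPoints W := hmate x' hx'
    have hlarge : Rρ ρ < ‖x' 0‖ := by
      by_contra hle
      refine hkB (Set.mem_iUnion₂.2 ⟨g, hg, Or.inl ?_⟩)
      show ‖Complex.log ρ + 2 * ↑Real.pi * I * ((k + g : ℤ) : ℂ)‖ ≤ Rρ ρ
      rw [hx'0]; exact not_lt.1 hle
    have hnotX : x' ∉ Xρ ρ := fun hX =>
      hkB (Set.mem_iUnion₂.2 ⟨g, hg, Or.inr ⟨x', hX, hx'0.symm⟩⟩)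
    obtain ⟨b, hb, ht0, htr, hrepr⟩ := hrepρ ρ x' hxI ⟨k + g, hx'0.symm⟩ hlarge hnotX
    exact ⟨b, hb, x', hxI, (x' 0) ^ (-((eρ ρ : ℂ)⁻¹)), rfl, hx'0.symm, ht0, htr, hrepr⟩
  choose! σ hσB hσ using hpos
  -- pigeonhole over the branches
  have hfib : ∃ b ∈ Bρ ρ, maxL ρ < (G.filter (fun g => σ g = b)).card := by
    by_contra hcon
    push Not at hcon
    have hsum : G.card = ∑ b ∈ Bρ ρ, (G.filter (fun g => σ g = b)).card :=
      Finset.card_eq_sum_card_fiberwise fun g hg => hσB g hg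
    have hle : ∑ b ∈ Bρ ρ, (G.filter (fun g => σ g = b)).card ≤ (Bρ ρ).card * maxL ρ := by
      calc ∑ b ∈ Bρ ρ, (G.filter (fun g => σ g = b)).card ≤ ∑ _b ∈ Bρ ρ, maxL ρ := Finset.sum_le_sum hcon
        _ = (Bρ ρ).card * maxL ρ := by rw [Finset.sum_const, smul_eq_mul]
    have h1 : Lρ ρ + 1 ≤ (Bρ ρ).card * maxL ρ := hLρle.trans (hsum ▸ hle)
    have h2 : Lρ ρ = (Bρ ρ).card * maxL ρ + 1 := rfl
    omega
  obtain ⟨b₀, hb₀, hcard⟩ := hfib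
  set G' : Finset ℤ := G.filter (fun g => σ g = b₀) with hG'
  have hLb₀ : Lb ρ b₀ ≤ G'.card := (Finset.le_sup (f := Lb ρ) hb₀).trans hcard.le
  refine Set.mem_iUnion₂.2 ⟨b₀, hb₀, Set.mem_iUnion₂.2 ⟨G', ?_, ?_⟩⟩
  · rw [Finset.mem_filter, Finset.mem_powerset]
    exact ⟨Finset.filter_subset _ _, hLb₀⟩
  · intro j hj
    rw [hG', Finset.mem_filter] at hj
    obtain ⟨hjG, hjb⟩ := hj
    have h := hσ j hjG
    rw [hjb] at h
    exact h

end Assembly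

/-! ## Registered forms -/

/-- **Registered stub `stub_windowRecurrenceCore` (PROVED): window recurrence is finite when `e^{x₀}` is algebraic, from the
coset window rigidity and the coset branch cover** (both registered stubs of the skeleton, here the two hypotheses; see
`windowRecurrence_e0_of`). [folklore] -/
theorem stub_windowRecurrenceCore : (∀ (e p : ℕ) (M : ℂ → ℂ) (c : ℂ) (G : Finset ℤ), 0 < e → AnalyticAt ℂ (fun t : ℂ => t ^ p * M t) 0 → (¬ ∃ Q : Polynomial ℂ, ∀ᶠ t in 𝓝[≠] (0 : ℂ), M t = Q.eval (t ^ e)⁻¹) → p + 2 ≤ G.card → Set.Finite {k : ℤ | ∀ j ∈ G, ∃ L : ℤ, M ((c + 2 * ↑Real.pi * Complex.I * ((k + j : ℤ) : ℂ)) ^ (-((e : ℂ)⁻¹))) = (L : ℂ) * (2 * ↑Real.pi * Complex.I)}) → (∀ (W : Set (Fin 2 ⊕ Fin 2 → ℂ)), Literature.NumberTheory.Transcendental.IsZariskiClosed ℂ W → Literature.NumberTheory.Transcendental.zariskiDim ℂ W < 2 → ∀ (c : ℂ), ∃ (e : ℕ) (R r : ℝ) (B : Finset ((ℂ → ℂ)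 × (ℂ → ℂ) × (ℂ → ℂ) × ℕ)) (X : Set (Fin 2 → ℂ)), 0 < e ∧ 0 < r ∧ X.Finite ∧ (∀ b ∈ B, (∀ t : ℂ, ‖t‖ < r → AnalyticAt ℂ b.1 t ∧ AnalyticAt ℂ b.2.1 t ∧ AnalyticAt ℂ b.2.2.1 t) ∧ ∀ t : ℂ, 0 < ‖t‖ → ‖t‖ < r → (Sum.elim ![(t ^ e)⁻¹, b.1 t / t ^ b.2.2.2] ![b.2.1 t / t ^ b.2.2.2, b.2.2.1 t / t ^ b.2.2.2] : Fin 2 ⊕ Fin 2 → ℂ) ∈ W) ∧ ∀ x ∈ Literature.NumberTheory.Transcendental.indepExpPoints W, (∃ k : ℤ, x 0 = c + 2 * ↑Real.pi * Complex.I * (k : ℂ)) → R < ‖x 0‖ → x ∉ X → ∃ b ∈ B, 0 < ‖(x 0) ^ (-((e : ℂ)⁻¹))‖ ∧ ‖(x 0) ^ (-((e : ℂ)⁻¹))‖ < r ∧ Sum.elim x (Complex.exp ∘ x) = (Sum.elim ![(((x 0) ^ (-((e : ℂ)⁻¹))) ^ e)⁻¹, b.1 ((x 0) ^ (-((e : ℂ)⁻¹)))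 / ((x 0) ^ (-((e : ℂ)⁻¹))) ^ b.2.2.2] ![b.2.1 ((x 0) ^ (-((e : ℂ)⁻¹))) / ((x 0) ^ (-((e : ℂ)⁻¹))) ^ b.2.2.2, b.2.2.1 ((x 0) ^ (-((e : ℂ)⁻¹))) / ((x 0) ^ (-((e : ℂ)⁻¹))) ^ b.2.2.2] : Fin 2 ⊕ Fin 2 → ℂ)) → ∀ (x : Fin 2 → ℂ), x ∈ Summit.Schanuel.Schanuel.Cruxes.MinimalCounterexampleInAcl.KernelArithmeticSelection.firstFailures 2 → IsAlgebraic ℚ (Complex.exp (x 0)) → ∃ L : ℕ, ∀ G : Finset ℤ, L ≤ G.card → Set.Finite {s : ℂ | ∀ g ∈ G, s + 2 * ↑Real.pi * Complex.I * (g : ℂ) ∈ {s : ℂ | ∃ x' ∈ Summit.Schanuel.Schanuel.Cruxes.MinimalCounterexampleInAcl.KernelArithmeticSelection.locusMates x, s = x' 0}} :=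
  fun hrig hcov _ hx halg => windowRecurrence_e0_of hrig hcov hx halg

end Summit.Schanuel.Schanuel.Cruxes.MinimalCounterexampleInAcl.KernelArithmeticSelection

end

-- ======== segment: composition (from the gen-15 skeleton) ========
noncomputable section

set_option linter.dupNamespace false

open Complex Set FirstOrder Filter Topology Polynomial

namespace Summit.Schanuel.Schanuel.Cruxes.MinimalCounterexampleInAcl.KernelArithmeticSelection

open Literature.NumberTheory.Transcendental (SchanuelRank IsDefinedOver zariskiDim)
open Literature.ModelTheory.ExponentialFields
open Summit.Schanuel.Schanuel.Theorems.AclSubsetLogFreeCore.Negative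

/-- Window recurrence is finite when `e^{x₀}` is algebraic (core ∘ rigidity ∘ cover). -/
theorem cert_windowRecurrence_e0 : ∀ (x : Fin 2 → ℂ), x ∈ firstFailures 2 → (∃ i, Transcendental ℚ (cexp (x i))) →
    IsAlgebraic ℚ (cexp (x 0)) → ∃ L : ℕ, ∀ G : Finset ℤ, L ≤ G.card →
      Set.Finite {s : ℂ | ∀ g ∈ G, s + 2 * ↑Real.pi * I * (g : ℂ) ∈ {s : ℂ | ∃ x' ∈ locusMates x, s = x' 0}} :=
  fun x hx _ halg => stub_windowRecurrenceCore stub_windowRigidity_coset stub_cosetBranchCover x hx halg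

/-- **(S*) AT RANK 2 WHEN `e^{x₀}` IS ALGEBRAIC** (off-log): bridge + one-sided selector if the hit set `K` of `x₀`'s coset is finite;
otherwise `K` contains windows of every length, which recur finitely often (`stub_windowRecurrence_e0`, also mirrored), and the window
selector applies; either way `x₀ ∈ acl(∅)` and the landed criterion `firstFailure_two_mem_expAcl_of_intCombo_mem` finishes. -/
theorem rankTwo_mixed_e0 {x : Fin 2 → ℂ} (hx : x ∈ firstFailures 2) (hoff : ∃ i, Transcendental ℚ (cexp (x i)))
    (halg : IsAlgebraic ℚ (cexp (x 0))) : ∀ i, x i ∈ expAcl := by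
  classical
  set E : Set ℂ := {s : ℂ | ∃ x' ∈ locusMates x, s = x' 0} with hE
  -- the bridge at `M = (1, 0)`
  have hsum : ∀ z : Fin 2 → ℂ, (∑ i, ((![1, 0] : Fin 2 → ℤ) i : ℂ) * z i) = z 0 := by
    intro z; simp [Fin.sum_univ_two]
  have hEeq : {s : ℂ | ∃ x' ∈ locusMates x, s = ∑ i, ((![1, 0] : Fin 2 → ℤ) i : ℂ) * x' i} = E := by
    ext s; simp only [hE, Set.mem_setOf_eq, hsum]
  have halg' : IsAlgebraic ℚ (cexp (∑ i, ((![1, 0] : Fin 2 → ℤ) i : ℂ) * x i)) := by rwa [hsum]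
  obtain ⟨hEdef, hEfin⟩ := stub_mixedBridge x ![1, 0] halg'
  rw [hEeq] at hEdef hEfin
  have huE : x 0 ∈ E := ⟨x, self_mem_locusMates x hx.1, rfl⟩
  have hM : (![1, 0] : Fin 2 → ℤ) ≠ 0 := by
    intro h; have := congrFun h 0; simp at this
  refine firstFailure_two_mem_expAcl_of_intCombo_mem hx ![1, 0] hM ?_
  rw [hsum]
  set K : Set ℤ := {k : ℤ | x 0 + 2 * ↑Real.pi * I * (k : ℂ) ∈ E} with hK
  by_cases hKfin : K.Finite
  · exact stub_selectorOneSided E (x 0) hEdef hEfin huE (Or.inl hKfin.bddBelow)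
  · obtain ⟨L, hL⟩ := cert_windowRecurrence_e0 x hx hoff halg
    have hKinf : K.Infinite := hKfin
    obtain ⟨F, hFK, hFcard⟩ := hKinf.exists_subset_card_eq (L + 1)
    have hFne : F.Nonempty := Finset.card_pos.1 (by omega)
    set k₀ : ℤ := F.min' hFne with hk₀
    set G : Finset ℤ := F.image (fun k => k - k₀) with hG
    have hk₀F : k₀ ∈ F := F.min'_mem hFne
    have h0G : (0 : ℤ) ∈ G := Finset.mem_image.2 ⟨k₀, hk₀F, sub_self _⟩
    have hGcard : G.card = F.card := Finset.card_image_of_injective _ sub_left_injective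
    have hwin : ∀ g ∈ G, x 0 + 2 * ↑Real.pi * I * ((k₀ + g : ℤ) : ℂ) ∈ E := by
      intro g hg
      obtain ⟨k, hkF, rfl⟩ := Finset.mem_image.1 hg
      have hk : k₀ + (k - k₀) = k := by ring
      rw [hk]
      exact hFK (Finset.mem_coe.2 hkF)
    have hfinP : Set.Finite {s : ℂ | ∀ g ∈ G, s + 2 * ↑Real.pi * I * (g : ℂ) ∈ E} :=
      hL G (by rw [hGcard, hFcard]; omega)
    have hfinN : Set.Finite {s : ℂ | ∀ g ∈ G, s - 2 * ↑Real.pi * I * (g : ℂ) ∈ E} := by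
      have h := hL (G.image Neg.neg)
        (by rw [Finset.card_image_of_injective _ neg_injective, hGcard, hFcard]; omega)
      refine h.subset ?_
      intro s hs g hg
      obtain ⟨g', hg', rfl⟩ := Finset.mem_image.1 hg
      have h' := hs g' hg'
      simp only [Int.cast_neg, mul_neg, ← sub_eq_add_neg]
      exact h'
    exact stub_selectorWindow E (x 0) G k₀ hEdef h0G hwin hfinP hfinN

/-- **(S*) AT RANK 2 ON THE MIXED SECTOR**: pass to the primitive direction `(a, b) = M / gcd` (its exponential is a root of `e^{Σ Mᵢxᵢ}`,
still algebraic), complete it to `GL₂(ℤ)` by Bézout, transport the first failure (`stub_glTwoReduction`) and apply `rankTwo_mixed_e0`. -/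
theorem rankTwo_mixed {x : Fin 2 → ℂ} (hx : x ∈ firstFailures 2) (hoff : ∃ i, Transcendental ℚ (cexp (x i)))
    (M : Fin 2 → ℤ) (hM : M ≠ 0) (halg : IsAlgebraic ℚ (cexp (∑ i, (M i : ℂ) * x i))) :
    ∀ i, x i ∈ expAcl := by
  classical
  -- the primitive direction
  set d : ℕ := Int.gcd (M 0) (M 1) with hd
  have hd0 : 0 < d := by
    rw [hd, Nat.pos_iff_ne_zero, Ne, Int.gcd_eq_zero_iff]
    rintro ⟨h0, h1⟩
    exact hM (funext fun i => by fin_cases i <;> assumption)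
  set a : ℤ := M 0 / d with ha
  set b : ℤ := M 1 / d with hb
  have hMa : M 0 = a * d := (Int.ediv_mul_cancel (Int.gcd_dvd_left _ _)).symm
  have hMb : M 1 = b * d := (Int.ediv_mul_cancel (Int.gcd_dvd_right _ _)).symm
  have hab : Int.gcd a b = 1 := Int.gcd_div_gcd_div_gcd hd0
  -- Bézout
  obtain ⟨u, v, hbez⟩ : ∃ u v : ℤ, a * u + b * v = 1 := by
    refine ⟨Int.gcdA a b, Int.gcdB a b, ?_⟩
    have h := Int.gcd_eq_gcd_ab a b
    rw [hab] at h
    push_cast at h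
    linarith [h]
  -- the exponential of the primitive combination is algebraic
  have hpow : cexp ((a : ℂ) * x 0 + (b : ℂ) * x 1) ^ d = cexp (∑ i, (M i : ℂ) * x i) := by
    rw [← Complex.exp_nat_mul, Fin.sum_univ_two, hMa, hMb]
    push_cast
    ring_nf
  have halg' : IsAlgebraic ℚ (cexp ((a : ℂ) * x 0 + (b : ℂ) * x 1)) :=
    IsAlgebraic.of_pow hd0 (by rw [hpow]; exact halg)
  -- transport
  obtain ⟨hx', hoff', hback⟩ := stub_glTwoReduction x a b u v hbez hx
  refine hback (rankTwo_mixed_e0 hx' (hoff' hoff) ?_)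
  simpa using halg'


/-- **CERTIFICATE: (S*) AT RANK 2 ON THE MIXED SECTOR, sorry-free in one file.** -/
theorem rankTwo_mixedSector_certificate : ∀ (x : Fin 2 → ℂ), x ∈ firstFailures 2 →
    (∃ i, Transcendental ℚ (cexp (x i))) → ∀ (M : Fin 2 → ℤ), M ≠ 0 →
    IsAlgebraic ℚ (cexp (∑ i, (M i : ℂ) * x i)) → ∀ i, x i ∈ expAcl :=
  fun _ hx hoff M hM halg => rankTwo_mixed hx hoff M hM halg

/-- Read-back: the conclusion is the crux's verbatim `∃ s, s.Finite ∧ Set.Definable₁ ∅ expRing s ∧ x i ∈ s`. -/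
example (x : Fin 2 → ℂ) (hx : x ∈ firstFailures 2) (hoff : ∃ i, Transcendental ℚ (cexp (x i)))
    (M : Fin 2 → ℤ) (hM : M ≠ 0) (halg : IsAlgebraic ℚ (cexp (∑ i, (M i : ℂ) * x i))) (i : Fin 2) :
    ∃ s : Set ℂ, s.Finite ∧ Set.Definable₁ (∅ : Set ℂ) Language.expRing s ∧ x i ∈ s :=
  rankTwo_mixedSector_certificate x hx hoff M hM halg i

end Summit.Schanuel.Schanuel.Cruxes.MinimalCounterexampleInAcl.KernelArithmeticSelection

end
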